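import Summits.HodgeConjecture.HodgeConjecture.Cruxes.BlochSeedDiscOne.DiamondLevelLaws

/-!
# BlochSeedDiscOne ∕ PairSpread (v12) — the PAIRWISE SPREAD Ψ and its companions: Θ = lex(Ψ + 2Q, −Q) empties the four-charged `K`-stratum (v8), given only the INTERFACE (v9); the apex strata (v10); and `K` absent ⟺ interface ∧ twin-apex ∧ (F1) at every even `h`, by the lexicographic one-apex key (v12)

`plan-lens-HodgeAV-control` g15–g16 (director-hodge req-36, LENSES-v3 «control»; crux of record H2 = `stmt-HodgeConjecture-18881` `BlochSeedDiscOne`,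
skeleton `Lines/birth.lean` 814a6a70c14e831a, rung `stub_rung_pad4_seedAt` (T_h) = `SeedB1OddDiamondG1H1 h`; critic of record idea-crit-6).  Companion
memos in this crux directory: `PAIR-SPREAD-g15.md` (Φ, the λ-window, the census narrative of v1–v6) and `THETA-KEY-g16.md` (Θ, the interface, the
`K`-core, the one-apex key; every census digit quoted below is detailed there).  Predecessor `ChargeInduction` (g13–g14: `totalCharge` Q, the class `K`).

THE QUANTITIES.  For a cell `Z` with letters `x_f = (node n_f, causal top t_f, charge c_f)`, `2|c_f| = t_f − n_f`:
`Ψ(Z) := Σ_{f<g} (|n_f − n_g| + |t_f − t_g|)` (`pairSpread`), `Q(Z) := Σ_f |c_f|` (`chargeSum`), the weighted keys `phiW a b = aΨ + bQ` (§4b), the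
`h`-free order Θ = lex(Ψ + 2Q ↑, Q ↓) realised on `◇_h` by `Θ_h = (2h+1)Ψ + (4h+1)Q` (§9, `theta_lt_iff`), and on the one-apex stratum the lexicographic
key (number of letters of causal top above the apex level ↑, then Ψ ↑) packed as `oneKey h X f = (8h+1)·(4 − lowTops X f) + Ψ X` (§9i).

KERNEL RESULTS (every even `h`; RULE D = `RuleDMu4Closed`, `◇_h` = `MConfig.InDiamond h`; no law, census row or conjecture is a hypothesis; 0 `sorry`):
* v7–v8 (§9–§9f) the Θ-rulebook (B)∕(A1)∕(A2) as theorems `ruleB_{N,P}_W`, `ruleA1_{N,P}_Θ`, `ruleA2_{N,P}_Θ`, the coverings `thetaStep_N`, `thetaStep_P`,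
  hence `thetaLawH_holds`, `fourChargedK_absent : h % 2 = 0 → C.InDiamond h → RuleDMu4Closed C → ApexBearingKAbsent C → FourChargedKAbsent C` and
  `kAbsent_iff_apexBearingKAbsent` — the four-charged `K`-stratum (64 % ∕ 69 % of `K` at ◇₈ ∕ ◇₁₀) is empty; the `K`-peel is its apex-bearing stratum.
* v9 (§9g) only the INTERFACE (A₃ᴵ) = `InterfaceKAbsent` (no high one-apex `K_N`-cell, no low one-apex `K_P`-cell) is consumed:
  `fourChargedK_absent_of_interface`, `kAbsent_iff_interface`.
* v10 (§9h) the apex strata: split two-apex and three-apex `K`-cells reduce by one clause, four-apex ones do not exist: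
  `kAbsent_iff_oneApex_twinApex : … → (KAbsent C ↔ OneApexKAbsent C ∧ TwinApexKAbsent C)`.
* v12 (§9i) the ONE-APEX stratum `h`-uniformly, no residual family: rules NA∕NB (`oneApex_N`), PA∕PT∕PB1∕PB2 (`oneApex_P`), `oneApexStep`,
  `oneApexK_absent_of_core`, and
  `kAbsent_iff_core : h % 2 = 0 → C.InDiamond h → RuleDMu4Closed C → (KAbsent C ↔ InterfaceKAbsent C ∧ TwinApexKAbsent C ∧ F1Absent C)`
  (`kAbsent_iff_core_h8` its ◇₈ instance) — (F1) = `F1Absent`: no node-flat one-apex `K_N`-cell (apex and the three charged nodes on one level; these have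
  no `K`-closed RULE-D clause at all — census family `B₀` — so no `K`-internal argument removes them).

CENSUS (hub-local, this seat's engines; digits ×1, detailed in the memos): Θ — 0 failing four-charged `K`-shapes at every even `h = 8, …, 34`
(118 739 854 shapes, both phases; every fixed λ in `Ψ + λQ` dies where the window `λ ∈ (2(h−10)∕(h−6), 2)` predicts); the one-apex rulebook — 0 failures,
0 residual heads over 4 542 891 one-apex non-base `K`-heads of `h = 8, …, 26`; the `K`-core least fixed points at `h = 8, 10` (base `I ∪ twin ∪ (F1)`,
29 % ∕ 26 % of `K`, closes to all of `K`; base `I ∪ B₀` does not: a cyclic core of 134 ∕ 5 177 at `h = 8`).  The experiment rows of record are gs-eng-2 g54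
j318002 ◇₈ `a459e02921a60310` ∕ ◇₁₀ `74004db439790926`.  The theorems make every census row above unnecessary; the census is what FOUND the keys.

REMOVED IN v12 (the crux-workfile size limit; all superseded by `fourChargedK_absent`, kept verbatim at tree commit 9b336ecbb914 = v10 and in the seat's
HOME mirror `ideators/plan-lens-HodgeAV-control/g16/lean/`): the λ = 1 law `PhiStep`, `phi`, `phi_le`, `phi_nonneg`, `FourChargedKAbsentAbove`,
`phiW_one_one`, `aboveW_one_one`, `phiStepW_one_one`, `phiStepW_of_phiStepWI`, the law in `h` `PhiLawH`, the reductions `fourChargedK_absent_of_phiStep ∕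
_of_phiLawH ∕ _of_thetaLawH`, `thetaLawH_of_P`, and the rule-A′₀ ∕ λ = 1 rule theorems `ruleA0_N_W`, `ruleA0_P_W`, `ruleA0_N`, `ruleA0_P`, `ruleB_N`,
`ruleB_P` (the weighted `ruleB_{N,P}_W` stay: the Θ-covering uses them).

HONEST STATUS.  Nothing here proves HC, HC_CM, HC_AV, H2 = `BlochSeedDiscOne` = `stmt-HodgeConjecture-18881`, the rung (T_h), or (A₃); what «`K` absent»
still needs is displayed, not proved: the absence of the interface cells (A₃ᴵ), of the twin-apex `K`-cells and of the (F1) cells — inputs that must come from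
the other design laws (G₁-closure, `H₁`-static line structure), not from RULE D.  HC_CM is not used and enters nowhere.  No `sorry`, no new axiom, no
`instance`, no notation; the only file-level `set_option` is `linter.dupNamespace false` (as in the sibling Cruxes files).  Imports `DiamondLevelLaws` only
(§0 restates five small `ChargeInduction` helpers so that the file does not depend on that module being built on the farm).
-/

set_option linter.dupNamespace false

namespace Summit.HodgeConjecture.HodgeConjecture.Cruxes.BlochSeedDiscOne.PairSpread

open Finset Summit.Ventures.HSemireg.Pad4Tower
open Summit.HodgeConjecture.HodgeConjecture.Cruxes.BlochSeedDiscOne.DiamondLevelLaws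

/-! ## §0 Helpers restated from `ChargeInduction` (v11) -/

theorem absCharge_of_uncharged {x : BPoint} (h0 : x.2 = (0, 0)) : absCharge x = 0 := by
  simp [absCharge, chargeOf, h0]

theorem coord_add_coord_add_two (x : BPoint) (m : Fin 4) : coord x m + coord x (m + 2) = 2 * x.1 := by
  fin_cases m <;> simp [coord] <;> ring

theorem adapted_add_two {x : BPoint} {m : Fin 4} (hm : Adapted x m) : Adapted x (m + 2) := by
  fin_cases m <;> simpa [Adapted] using hm

/-- every μ₄ letter has a TOP direction: an adapted coordinate of value `α + |c|`. -/
theorem exists_top_dir' {x : BPoint} (hxax : x.2 = (0, 0) ∨ AxisPt x) : ∃ k : Fin 4, Adapted x k ∧ coord x k = x.1 + absCharge x := by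
  obtain ⟨m, hm, hm0⟩ := exists_node_dir hxax
  exact ⟨m + 2, adapted_add_two hm, by have := coord_add_coord_add_two x m; omega⟩

/-- the LINE CHILD: `e > 0` null steps below a charged letter off the antipode of its node direction keep the top and lower the node by `2e`. -/
theorem lineChild_of_ray {x y : BPoint} {m r : Fin 4} {e : ℤ} (hxax : x.2 = (0, 0) ∨ AxisPt x) (hna : x.2 ≠ (0, 0))
    (hm : Adapted x m) (hm0 : coord x m = x.1 - absCharge x) (hr : r ≠ m + 2) (he : 0 < e) (hxy : x = ray y r e)
    (hyax : y.2 = (0, 0) ∨ AxisPt y) (hy : absCharge y ≤ y.1) :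
    y.2 ≠ (0, 0) ∧ causalTop y = causalTop x ∧ nodeLevel y + 2 * e = nodeLevel x := by
  obtain ⟨α, a, b⟩ := y
  subst hxy
  simp only [causalTop, nodeLevel, absCharge, chargeOf, coord, AxisPt, Adapted, Prod.mk.injEq, ne_eq] at *
  fin_cases m <;> fin_cases r <;> simp at hxax hna hm hm0 hr hyax hy ⊢ <;>
    (simp only [abs_eq_max_neg, max_def] at *; split_ifs at * <;> omega)

/-- the APEX LOWERING: if the apex `aI` is `d > 0` null steps (any direction) above `y`, then `y` is charged with causal top `a` and charge `d`. -/
theorem apexLower_of_ray {a : ℤ} {y : BPoint} {r : Fin 4} {d : ℤ} (hd : 0 < d) (hy : ((a, 0, 0) : BPoint) = ray y r d) :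
    y.2 ≠ (0, 0) ∧ causalTop y = a ∧ absCharge y = d := by
  obtain ⟨α, p, q⟩ := y
  simp only [causalTop, absCharge, chargeOf, ne_eq, Prod.mk.injEq]
  fin_cases r <;> simp [ray, Prod.ext_iff] at hy ⊢ <;> (simp only [abs_eq_max_neg, max_def] at *; split_ifs at * <;> omega)

/-! ## §1 The three shapes of a RULE-D outcome at one letter -/

/-- `y` is a DESCENT of `x`: same node level, strictly lower causal top (partial descent `−e`, or the full descent to the apex `nI`). -/
def DescOf (x y : BPoint) : Prop := nodeLevel y = nodeLevel x ∧ causalTop y < causalTop x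

/-- `y` is an OVERSHOOT of `x`: charged, causal top = the node level of `x`, node strictly lower (the top ray continued through the apex `nI`). -/
def OverOf (x y : BPoint) : Prop := y.2 ≠ (0, 0) ∧ causalTop y = nodeLevel x ∧ nodeLevel y < nodeLevel x

/-- `y` is a DROP of `x`: charged, same causal top, node strictly lower (a charged letter charging deeper, or an apex lowered to a line letter). -/
def DropOf (x y : BPoint) : Prop := y.2 ≠ (0, 0) ∧ causalTop y = causalTop x ∧ nodeLevel y < nodeLevel x

/-- **the full top-child geometry**: `e > 0` null steps below a charged μ₄ letter `x` along a direction `r ≠ k + 2` (`k` the top direction of `x`),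
staying a μ₄ letter, is a DESCENT (`node =`, top `−2e`, charge `−e`) or an OVERSHOOT (`node <`, top = old node, node = old top `− 2e`). -/
theorem topChild_full {x y : BPoint} {k r : Fin 4} {e : ℤ} (hxax : x.2 = (0, 0) ∨ AxisPt x) (hna : x.2 ≠ (0, 0))
    (hk : Adapted x k) (hk0 : coord x k = x.1 + absCharge x) (hr : r ≠ k + 2) (he : 0 < e) (hxy : x = ray y r e)
    (hyax : y.2 = (0, 0) ∨ AxisPt y) (hy : absCharge y ≤ y.1) :
    (nodeLevel y = nodeLevel x ∧ causalTop y + 2 * e = causalTop x ∧ absCharge y + e = absCharge x) ∨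
    (y.2 ≠ (0, 0) ∧ causalTop y = nodeLevel x ∧ nodeLevel y + 2 * e = causalTop x ∧ absCharge x + absCharge y = e) := by
  obtain ⟨α, a, b⟩ := y
  subst hxy
  simp only [causalTop, nodeLevel, absCharge, chargeOf, coord, AxisPt, Adapted, Prod.mk.injEq, ne_eq] at *
  fin_cases k <;> fin_cases r <;> simp at hxax hna hk hk0 hr hyax hy ⊢ <;>
    (simp only [abs_eq_max_neg, max_def] at *; split_ifs at * <;> omega)

/-- **the full node-child geometry**: `d > 0` null steps below a charged μ₄ letter `x` along its NODE direction `m` is a DROP (top `=`, node `−2d`,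
charge `+d`).  (`lineChild_of_ray` with `r = m`.) -/
theorem nodeChild_full {x y : BPoint} {m : Fin 4} {d : ℤ} (hxax : x.2 = (0, 0) ∨ AxisPt x) (hna : x.2 ≠ (0, 0))
    (hm : Adapted x m) (hm0 : coord x m = x.1 - absCharge x) (hd : 0 < d) (hxy : x = ray y m d)
    (hyax : y.2 = (0, 0) ∨ AxisPt y) (hy : absCharge y ≤ y.1) :
    y.2 ≠ (0, 0) ∧ causalTop y = causalTop x ∧ nodeLevel y + 2 * d = nodeLevel x :=
  lineChild_of_ray hxax hna hm hm0 (fin4_ne_add_two m) hd hxy hyax hy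

/-! ## §2 RULE D below an `N`-cell in OUTCOME FORM -/

/-- the outcome of the top coordinate of a charged letter `g` of `Z ∈ C.lower` settled below in a direction `r ≠ k+2`: a descent or an overshoot. -/
theorem topOutcome {h : ℤ} {C : MConfig} (hU : C.InDiamond h) {Z P : MCell} (hZ : Z ∈ C.lower) (hP : P ∈ C.upper) {g : Fin 4}
    (hgc : (Z g).2 ≠ (0, 0)) {k r : Fin 4} (hk : Adapted (Z g) k) (hk0 : coord (Z g) k = (Z g).1 + absCharge (Z g)) (hr : r ≠ k + 2)
    (hlt : (P g).1 < (Z g).1) (hray : Z g = ray (P g) r ((Z g).1 - (P g).1)) : DescOf (Z g) (P g) ∨ OverOf (Z g) (P g) := by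
  rcases topChild_full (hU.1 Z hZ g).1 hgc hk hk0 hr (by omega) hray (hU.2 P hP g).1 (hU.2 P hP g).2.1 with ⟨hn, ht, -⟩ | ⟨hc, ht, hn, -⟩
  · exact Or.inl ⟨hn, by omega⟩
  · refine Or.inr ⟨hc, ht, ?_⟩
    have := absCharge_nonneg (P g)
    have h1 : nodeLevel (Z g) + 2 * absCharge (Z g) = causalTop (Z g) := by unfold nodeLevel causalTop; ring
    have hcg : 0 < absCharge (Z g) := absCharge_pos_of_not_isApex (hU.1 Z hZ g).1 (not_isApex_of_snd_ne hgc)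
    have h2 : nodeLevel (P g) + 2 * absCharge (P g) = causalTop (P g) := by unfold nodeLevel causalTop; ring
    have hcp : 0 < absCharge (P g) := absCharge_pos_of_not_isApex (hU.2 P hP g).1 (not_isApex_of_snd_ne hc)
    omega

/-- the outcome of the node coordinate of a letter `j` of `Z ∈ C.lower` moved below in a direction `b ≠ m + 2` (`m` the node direction; for a
charged letter only `b = m` stays a μ₄ letter, for an apex every such `b` does): a DROP. -/
theorem nodeOutcome {h : ℤ} {C : MConfig} (hU : C.InDiamond h) {Z P : MCell} (hZ : Z ∈ C.lower) (hP : P ∈ C.upper) {j : Fin 4}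
    {m b : Fin 4} (hm : Adapted (Z j) m) (hm0 : coord (Z j) m = (Z j).1 - absCharge (Z j)) (hb : b ≠ m + 2)
    (hlt : (P j).1 < (Z j).1) (hray : Z j = ray (P j) b ((Z j).1 - (P j).1)) : DropOf (Z j) (P j) := by
  by_cases hj0 : (Z j).2 = (0, 0)
  · -- an apex lowered: charged, top = the apex height, charge d
    have hZj : Z j = ((Z j).1, 0, 0) := by ext <;> simp [hj0]
    rw [hZj] at hray
    obtain ⟨hc, ht, hq⟩ := apexLower_of_ray (by omega) hray
    have hta : causalTop (Z j) = (Z j).1 := by unfold causalTop; rw [absCharge_of_uncharged hj0]; ring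
    have hna : nodeLevel (Z j) = (Z j).1 := by unfold nodeLevel; rw [absCharge_of_uncharged hj0]; ring
    refine ⟨hc, by rw [ht, hta], ?_⟩
    unfold nodeLevel at hna ⊢; rw [hq]; omega
  · obtain ⟨hc, ht, hn⟩ := lineChild_of_ray (hU.1 Z hZ j).1 hj0 hm hm0 hb (by omega) hray (hU.2 P hP j).1 (hU.2 P hP j).2.1
    exact ⟨hc, ht, by omega⟩

theorem dirOK_ne_add_two {x : BPoint} {k a : Fin 4} (h : DirOK x k a) : a ≠ k + 2 :=
  h.elim (fun e => e ▸ fin4_ne_add_two a) fun h' => h'.2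

/-- **EDGE (tn) in OUTCOME FORM** (KERNEL, law-free, every `h`): RULE D at (top of the charged letter `g`, node of `j ≠ g`) below an `N`-cell `Z` with
`top(Z g) ≠ node(Z j)` is served by some `P ∈ C.upper` agreeing with `Z` off `{g, j}` whose `g`-letter is `Z g`, a descent or an overshoot of it, whose
`j`-letter is `Z j` or a drop of it, and which moves at least one of the two. -/
theorem edge_tn_outcomes {h : ℤ} {C : MConfig} (hU : C.InDiamond h) {Z : MCell} (hZ : Z ∈ C.lower) (hD : RuleDMu4N C Z) {g j : Fin 4}
    (hgj : g ≠ j) (hgc : (Z g).2 ≠ (0, 0)) (hne : causalTop (Z g) ≠ nodeLevel (Z j)) :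
    ∃ P ∈ C.upper, MAgree2 P Z g j ∧ (P g = Z g ∨ DescOf (Z g) (P g) ∨ OverOf (Z g) (P g)) ∧ (P j = Z j ∨ DropOf (Z j) (P j)) ∧
      (P g ≠ Z g ∨ P j ≠ Z j) := by
  obtain ⟨k, hk, hk0⟩ := exists_top_dir' (hU.1 Z hZ g).1
  obtain ⟨m, hm, hm0⟩ := exists_node_dir (hU.1 Z hZ j).1
  have hne' : coord (Z g) k ≠ coord (Z j) m := by rw [hk0, hm0]; unfold causalTop nodeLevel at hne; exact hne
  rcases hD g j hgj k m hk hm hne' with ⟨r, hr, P, hP, hag, hlt, hray⟩ | ⟨r, hr, P, hP, hag, hlt, hray⟩ |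
      ⟨a, b, ha, hb, P, hP, hag2, hlt1, hray1, hlt2, hray2⟩
  · refine ⟨P, hP, fun f hf _ => hag f hf, Or.inr (topOutcome hU hZ hP hgc hk hk0 hr hlt hray), Or.inl (hag j hgj.symm), Or.inl ?_⟩
    intro e; rw [e] at hlt; exact lt_irrefl _ hlt
  · refine ⟨P, hP, fun f _ hf => hag f hf, Or.inl (hag g hgj), Or.inr (nodeOutcome hU hZ hP hm hm0 hr hlt hray), Or.inr ?_⟩
    intro e; rw [e] at hlt; exact lt_irrefl _ hlt
  · have ha' : a = k := ha.elim id fun h' => absurd h'.1 (not_isApex_of_snd_ne hgc)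
    subst ha'
    refine ⟨P, hP, hag2, Or.inr (topOutcome hU hZ hP hgc hk hk0 (fin4_ne_add_two _) hlt1 hray1), Or.inr (nodeOutcome hU hZ hP hm hm0 (dirOK_ne_add_two hb) hlt2 hray2),
      Or.inl ?_⟩
    intro e; rw [e] at hlt1; exact lt_irrefl _ hlt1

/-- **EDGE (nn) in OUTCOME FORM** (KERNEL, law-free, every `h`): RULE D at (node of `g`, node of `j`), `g ≠ j`, node levels different, below an
`N`-cell `Z` is served by some `P ∈ C.upper` agreeing with `Z` off `{g, j}` whose `g`- and `j`-letters are `Z`'s or drops of them, not both `Z`'s. -/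
theorem edge_nn_outcomes {h : ℤ} {C : MConfig} (hU : C.InDiamond h) {Z : MCell} (hZ : Z ∈ C.lower) (hD : RuleDMu4N C Z) {g j : Fin 4}
    (hgj : g ≠ j) (hne : nodeLevel (Z g) ≠ nodeLevel (Z j)) :
    ∃ P ∈ C.upper, MAgree2 P Z g j ∧ (P g = Z g ∨ DropOf (Z g) (P g)) ∧ (P j = Z j ∨ DropOf (Z j) (P j)) ∧ (P g ≠ Z g ∨ P j ≠ Z j) := by
  obtain ⟨k, hk, hk0⟩ := exists_node_dir (hU.1 Z hZ g).1
  obtain ⟨m, hm, hm0⟩ := exists_node_dir (hU.1 Z hZ j).1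
  have hne' : coord (Z g) k ≠ coord (Z j) m := by rw [hk0, hm0]; unfold nodeLevel at hne; exact hne
  rcases hD g j hgj k m hk hm hne' with ⟨r, hr, P, hP, hag, hlt, hray⟩ | ⟨r, hr, P, hP, hag, hlt, hray⟩ |
      ⟨a, b, ha, hb, P, hP, hag2, hlt1, hray1, hlt2, hray2⟩
  · refine ⟨P, hP, fun f hf _ => hag f hf, Or.inr (nodeOutcome hU hZ hP hk hk0 hr hlt hray), Or.inl (hag j hgj.symm), Or.inl ?_⟩
    intro e; rw [e] at hlt; exact lt_irrefl _ hlt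
  · refine ⟨P, hP, fun f _ hf => hag f hf, Or.inl (hag g hgj), Or.inr (nodeOutcome hU hZ hP hm hm0 hr hlt hray), Or.inr ?_⟩
    intro e; rw [e] at hlt; exact lt_irrefl _ hlt
  · refine ⟨P, hP, hag2, Or.inr (nodeOutcome hU hZ hP hk hk0 (dirOK_ne_add_two ha) hlt1 hray1),
      Or.inr (nodeOutcome hU hZ hP hm hm0 (dirOK_ne_add_two hb) hlt2 hray2), Or.inl ?_⟩
    intro e; rw [e] at hlt1; exact lt_irrefl _ hlt1

/-! ## §3 The pairwise spread and its arithmetic -/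

/-- the total pairwise spread of four integers. -/
def spreadOf (v : Fin 4 → ℤ) : ℤ := |v 0 - v 1| + |v 0 - v 2| + |v 0 - v 3| + |v 1 - v 2| + |v 1 - v 3| + |v 2 - v 3|

/-- **Ψ, the PAIRWISE SPREAD** of a cell: node spread plus top spread. -/
def pairSpread (Z : MCell) : ℤ := spreadOf (fun f => nodeLevel (Z f)) + spreadOf (fun f => causalTop (Z f))

theorem spreadOf_nonneg (v : Fin 4 → ℤ) : 0 ≤ spreadOf v := by
  unfold spreadOf; positivity

/-- four values in `[0, h]` have spread `≤ 4h` (attained by `0, 0, h, h`). -/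
theorem spreadOf_le {v : Fin 4 → ℤ} {h : ℤ} (h0 : ∀ f, 0 ≤ v f) (hh : ∀ f, v f ≤ h) : spreadOf v ≤ 4 * h := by
  have a0 := h0 0; have a1 := h0 1; have a2 := h0 2; have a3 := h0 3; have b0 := hh 0; have b1 := hh 1; have b2 := hh 2; have b3 := hh 3
  unfold spreadOf; simp only [abs_eq_max_neg, max_def]; split_ifs <;> omega

/-- lowering `a` to `b ≤ a` changes `|a − c|` by at most `a − b` … -/
theorem absPair_lower_le (a b c : ℤ) (hba : b ≤ a) : |a - c| ≤ |b - c| + (a - b) := by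
  rcases le_total 0 (a - c) with h1 | h1 <;> rcases le_total 0 (b - c) with h2 | h2 <;>
    simp only [abs_of_nonneg, abs_of_nonpos, h1, h2] <;> omega

theorem absPair_lower_le' (a b c : ℤ) (hba : b ≤ a) : |c - a| ≤ |c - b| + (a - b) := by
  rw [abs_sub_comm c a, abs_sub_comm c b]; exact absPair_lower_le a b c hba

/-- … and raises it by exactly `a − b` when `c ≥ a`. -/
theorem absPair_lower_min (a b c : ℤ) (hba : b ≤ a) (hac : a ≤ c) : |b - c| = |a - c| + (a - b) := by
  rw [abs_of_nonpos (by omega : b - c ≤ 0), abs_of_nonpos (by omega : a - c ≤ 0)]; ring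

theorem absPair_lower_min' (a b c : ℤ) (hba : b ≤ a) (hac : a ≤ c) : |c - b| = |c - a| + (a - b) := by
  rw [abs_sub_comm c b, abs_sub_comm c a]; exact absPair_lower_min a b c hba hac

/-- lowering ANY entry by `δ ≥ 0` costs at most `3δ` of spread. -/
theorem spreadOf_lower_any {v w : Fin 4 → ℤ} {y : Fin 4} (hw : ∀ g, g ≠ y → w g = v g) (hy : w y ≤ v y) :
    spreadOf v ≤ spreadOf w + 3 * (v y - w y) := by
  fin_cases y <;> simp only [spreadOf, Fin.zero_eta, Fin.mk_one, Fin.isValue, Fin.reduceFinMk, ne_eq] at *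
  · have e1 := hw 1 (by decide); have e2 := hw 2 (by decide); have e3 := hw 3 (by decide)
    have t0 := absPair_lower_le (v 0) (w 0) (v 1) hy; have t1 := absPair_lower_le (v 0) (w 0) (v 2) hy; have t2 := absPair_lower_le (v 0) (w 0) (v 3) hy
    rw [e1, e2, e3]; omega
  · have e1 := hw 0 (by decide); have e2 := hw 2 (by decide); have e3 := hw 3 (by decide)
    have t0 := absPair_lower_le' (v 1) (w 1) (v 0) hy; have t3 := absPair_lower_le (v 1) (w 1) (v 2) hy; have t4 := absPair_lower_le (v 1) (w 1) (v 3) hy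
    rw [e1, e2, e3]; omega
  · have e1 := hw 0 (by decide); have e2 := hw 1 (by decide); have e3 := hw 3 (by decide)
    have t1 := absPair_lower_le' (v 2) (w 2) (v 0) hy; have t3 := absPair_lower_le' (v 2) (w 2) (v 1) hy; have t5 := absPair_lower_le (v 2) (w 2) (v 3) hy
    rw [e1, e2, e3]; omega
  · have e1 := hw 0 (by decide); have e2 := hw 1 (by decide); have e3 := hw 2 (by decide)
    have t2 := absPair_lower_le' (v 3) (w 3) (v 0) hy; have t4 := absPair_lower_le' (v 3) (w 3) (v 1) hy; have t5 := absPair_lower_le' (v 3) (w 3) (v 2) hy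
    rw [e1, e2, e3]; omega

/-- lowering a MINIMAL entry by `δ ≥ 0` raises the spread by exactly `3δ`. -/
theorem spreadOf_lower_min {v w : Fin 4 → ℤ} {y : Fin 4} (hmin : ∀ g, v y ≤ v g) (hw : ∀ g, g ≠ y → w g = v g) (hy : w y ≤ v y) :
    spreadOf w = spreadOf v + 3 * (v y - w y) := by
  fin_cases y <;> simp only [spreadOf, Fin.zero_eta, Fin.mk_one, Fin.isValue, Fin.reduceFinMk, ne_eq] at *
  · have e1 := hw 1 (by decide); have e2 := hw 2 (by decide); have e3 := hw 3 (by decide)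
    have t0 := absPair_lower_min (v 0) (w 0) (v 1) hy (hmin 1); have t1 := absPair_lower_min (v 0) (w 0) (v 2) hy (hmin 2); have t2 := absPair_lower_min (v 0) (w 0) (v 3) hy (hmin 3)
    rw [e1, e2, e3]; omega
  · have e1 := hw 0 (by decide); have e2 := hw 2 (by decide); have e3 := hw 3 (by decide)
    have t0 := absPair_lower_min' (v 1) (w 1) (v 0) hy (hmin 0); have t3 := absPair_lower_min (v 1) (w 1) (v 2) hy (hmin 2); have t4 := absPair_lower_min (v 1) (w 1) (v 3) hy (hmin 3)
    rw [e1, e2, e3]; omega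
  · have e1 := hw 0 (by decide); have e2 := hw 1 (by decide); have e3 := hw 3 (by decide)
    have t1 := absPair_lower_min' (v 2) (w 2) (v 0) hy (hmin 0); have t3 := absPair_lower_min' (v 2) (w 2) (v 1) hy (hmin 1); have t5 := absPair_lower_min (v 2) (w 2) (v 3) hy (hmin 3)
    rw [e1, e2, e3]; omega
  · have e1 := hw 0 (by decide); have e2 := hw 1 (by decide); have e3 := hw 2 (by decide)
    have t2 := absPair_lower_min' (v 3) (w 3) (v 0) hy (hmin 0); have t4 := absPair_lower_min' (v 3) (w 3) (v 1) hy (hmin 1); have t5 := absPair_lower_min' (v 3) (w 3) (v 2) hy (hmin 2)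
    rw [e1, e2, e3]; omega

/-- lowering an entry with AT MOST ONE entry strictly below it (a second-lowest entry) by `δ ≥ 0` raises the spread by at least `δ`. -/
theorem spreadOf_lower_second {v w : Fin 4 → ℤ} {y u : Fin 4} (hsec : ∀ g, g ≠ u → v y ≤ v g) (hw : ∀ g, g ≠ y → w g = v g)
    (hy : w y ≤ v y) : spreadOf v + (v y - w y) ≤ spreadOf w := by
  fin_cases y <;> fin_cases u <;> simp only [spreadOf, Fin.zero_eta, Fin.mk_one, Fin.isValue, Fin.reduceFinMk, ne_eq] at *
  · have e1 := hw 1 (by decide); have e2 := hw 2 (by decide); have e3 := hw 3 (by decide)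
    have t0 := absPair_lower_min (v 0) (w 0) (v 1) hy (hsec 1 (by decide)); have t1 := absPair_lower_min (v 0) (w 0) (v 2) hy (hsec 2 (by decide)); have t2 := absPair_lower_min (v 0) (w 0) (v 3) hy (hsec 3 (by decide))
    rw [e1, e2, e3]; omega
  · have e1 := hw 1 (by decide); have e2 := hw 2 (by decide); have e3 := hw 3 (by decide)
    have t0 := absPair_lower_le (v 0) (w 0) (v 1) hy; have t1 := absPair_lower_min (v 0) (w 0) (v 2) hy (hsec 2 (by decide)); have t2 := absPair_lower_min (v 0) (w 0) (v 3) hy (hsec 3 (by decide))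
    rw [e1, e2, e3]; omega
  · have e1 := hw 1 (by decide); have e2 := hw 2 (by decide); have e3 := hw 3 (by decide)
    have t0 := absPair_lower_min (v 0) (w 0) (v 1) hy (hsec 1 (by decide)); have t1 := absPair_lower_le (v 0) (w 0) (v 2) hy; have t2 := absPair_lower_min (v 0) (w 0) (v 3) hy (hsec 3 (by decide))
    rw [e1, e2, e3]; omega
  · have e1 := hw 1 (by decide); have e2 := hw 2 (by decide); have e3 := hw 3 (by decide)
    have t0 := absPair_lower_min (v 0) (w 0) (v 1) hy (hsec 1 (by decide)); have t1 := absPair_lower_min (v 0) (w 0) (v 2) hy (hsec 2 (by decide)); have t2 := absPair_lower_le (v 0) (w 0) (v 3) hy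
    rw [e1, e2, e3]; omega
  · have e1 := hw 0 (by decide); have e2 := hw 2 (by decide); have e3 := hw 3 (by decide)
    have t0 := absPair_lower_le' (v 1) (w 1) (v 0) hy; have t3 := absPair_lower_min (v 1) (w 1) (v 2) hy (hsec 2 (by decide)); have t4 := absPair_lower_min (v 1) (w 1) (v 3) hy (hsec 3 (by decide))
    rw [e1, e2, e3]; omega
  · have e1 := hw 0 (by decide); have e2 := hw 2 (by decide); have e3 := hw 3 (by decide)
    have t0 := absPair_lower_min' (v 1) (w 1) (v 0) hy (hsec 0 (by decide)); have t3 := absPair_lower_min (v 1) (w 1) (v 2) hy (hsec 2 (by decide)); have t4 := absPair_lower_min (v 1) (w 1) (v 3) hy (hsec 3 (by decide))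
    rw [e1, e2, e3]; omega
  · have e1 := hw 0 (by decide); have e2 := hw 2 (by decide); have e3 := hw 3 (by decide)
    have t0 := absPair_lower_min' (v 1) (w 1) (v 0) hy (hsec 0 (by decide)); have t3 := absPair_lower_le (v 1) (w 1) (v 2) hy; have t4 := absPair_lower_min (v 1) (w 1) (v 3) hy (hsec 3 (by decide))
    rw [e1, e2, e3]; omega
  · have e1 := hw 0 (by decide); have e2 := hw 2 (by decide); have e3 := hw 3 (by decide)
    have t0 := absPair_lower_min' (v 1) (w 1) (v 0) hy (hsec 0 (by decide)); have t3 := absPair_lower_min (v 1) (w 1) (v 2) hy (hsec 2 (by decide)); have t4 := absPair_lower_le (v 1) (w 1) (v 3) hy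
    rw [e1, e2, e3]; omega
  · have e1 := hw 0 (by decide); have e2 := hw 1 (by decide); have e3 := hw 3 (by decide)
    have t1 := absPair_lower_le' (v 2) (w 2) (v 0) hy; have t3 := absPair_lower_min' (v 2) (w 2) (v 1) hy (hsec 1 (by decide)); have t5 := absPair_lower_min (v 2) (w 2) (v 3) hy (hsec 3 (by decide))
    rw [e1, e2, e3]; omega
  · have e1 := hw 0 (by decide); have e2 := hw 1 (by decide); have e3 := hw 3 (by decide)
    have t1 := absPair_lower_min' (v 2) (w 2) (v 0) hy (hsec 0 (by decide)); have t3 := absPair_lower_le' (v 2) (w 2) (v 1) hy; have t5 := absPair_lower_min (v 2) (w 2) (v 3) hy (hsec 3 (by decide))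
    rw [e1, e2, e3]; omega
  · have e1 := hw 0 (by decide); have e2 := hw 1 (by decide); have e3 := hw 3 (by decide)
    have t1 := absPair_lower_min' (v 2) (w 2) (v 0) hy (hsec 0 (by decide)); have t3 := absPair_lower_min' (v 2) (w 2) (v 1) hy (hsec 1 (by decide)); have t5 := absPair_lower_min (v 2) (w 2) (v 3) hy (hsec 3 (by decide))
    rw [e1, e2, e3]; omega
  · have e1 := hw 0 (by decide); have e2 := hw 1 (by decide); have e3 := hw 3 (by decide)
    have t1 := absPair_lower_min' (v 2) (w 2) (v 0) hy (hsec 0 (by decide)); have t3 := absPair_lower_min' (v 2) (w 2) (v 1) hy (hsec 1 (by decide)); have t5 := absPair_lower_le (v 2) (w 2) (v 3) hy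
    rw [e1, e2, e3]; omega
  · have e1 := hw 0 (by decide); have e2 := hw 1 (by decide); have e3 := hw 2 (by decide)
    have t2 := absPair_lower_le' (v 3) (w 3) (v 0) hy; have t4 := absPair_lower_min' (v 3) (w 3) (v 1) hy (hsec 1 (by decide)); have t5 := absPair_lower_min' (v 3) (w 3) (v 2) hy (hsec 2 (by decide))
    rw [e1, e2, e3]; omega
  · have e1 := hw 0 (by decide); have e2 := hw 1 (by decide); have e3 := hw 2 (by decide)
    have t2 := absPair_lower_min' (v 3) (w 3) (v 0) hy (hsec 0 (by decide)); have t4 := absPair_lower_le' (v 3) (w 3) (v 1) hy; have t5 := absPair_lower_min' (v 3) (w 3) (v 2) hy (hsec 2 (by decide))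
    rw [e1, e2, e3]; omega
  · have e1 := hw 0 (by decide); have e2 := hw 1 (by decide); have e3 := hw 2 (by decide)
    have t2 := absPair_lower_min' (v 3) (w 3) (v 0) hy (hsec 0 (by decide)); have t4 := absPair_lower_min' (v 3) (w 3) (v 1) hy (hsec 1 (by decide)); have t5 := absPair_lower_le' (v 3) (w 3) (v 2) hy
    rw [e1, e2, e3]; omega
  · have e1 := hw 0 (by decide); have e2 := hw 1 (by decide); have e3 := hw 2 (by decide)
    have t2 := absPair_lower_min' (v 3) (w 3) (v 0) hy (hsec 0 (by decide)); have t4 := absPair_lower_min' (v 3) (w 3) (v 1) hy (hsec 1 (by decide)); have t5 := absPair_lower_min' (v 3) (w 3) (v 2) hy (hsec 2 (by decide))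
    rw [e1, e2, e3]; omega

/-- Ψ of a `◇_h` cell lies in `[0, 8h]`. -/
theorem pairSpread_nonneg (Z : MCell) : 0 ≤ pairSpread Z := by
  unfold pairSpread; have := spreadOf_nonneg (fun f => nodeLevel (Z f)); have := spreadOf_nonneg (fun f => causalTop (Z f)); omega

theorem pairSpread_le {h : ℤ} {Z : MCell} (hZ : MCell.InDiamond h Z) : pairSpread Z ≤ 8 * h := by
  have hn : ∀ f, 0 ≤ nodeLevel (Z f) ∧ nodeLevel (Z f) ≤ h ∧ 0 ≤ causalTop (Z f) ∧ causalTop (Z f) ≤ h := fun f => by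
    have h1 := (hZ f).2.1; have h2 := (hZ f).2.2.2; have h3 := absCharge_nonneg (Z f)
    unfold nodeLevel causalTop; omega
  unfold pairSpread
  have := spreadOf_le (v := fun f => nodeLevel (Z f)) (fun f => (hn f).1) (fun f => (hn f).2.1)
  have := spreadOf_le (v := fun f => causalTop (Z f)) (fun f => (hn f).2.2.1) (fun f => (hn f).2.2.2)
  omega

theorem two_mul_absCharge (x : BPoint) : 2 * absCharge x = causalTop x - nodeLevel x := by
  unfold causalTop nodeLevel; ring

/-- the total charge `Q(Z) = Σ_f |charge of letter f|`, written out (`ChargeInduction.totalCharge`). -/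
def chargeSum (Z : MCell) : ℤ := absCharge (Z 0) + absCharge (Z 1) + absCharge (Z 2) + absCharge (Z 3)

theorem chargeSum_nonneg (Z : MCell) : 0 ≤ chargeSum Z := by
  unfold chargeSum
  have := absCharge_nonneg (Z 0); have := absCharge_nonneg (Z 1); have := absCharge_nonneg (Z 2); have := absCharge_nonneg (Z 3); omega

theorem chargeSum_le {h : ℤ} {Z : MCell} (hZ : MCell.InDiamond h Z) : chargeSum Z ≤ 2 * h := by
  have hn : ∀ f, 2 * absCharge (Z f) ≤ h := fun f => by
    have h1 := (hZ f).2.1; have h2 := (hZ f).2.2.2; have h3 := absCharge_nonneg (Z f)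
    omega
  unfold chargeSum; have := hn 0; have := hn 1; have := hn 2; have := hn 3; omega

/-- slotwise comparison of total charge. -/
theorem chargeSum_mono {Z P : MCell} (hle : ∀ f, absCharge (Z f) ≤ absCharge (P f)) : chargeSum Z ≤ chargeSum P := by
  unfold chargeSum; have := hle 0; have := hle 1; have := hle 2; have := hle 3; omega

/-! ## §4 The kernel class `K`, the law (Φ-STEP_h), and the reduction -/

/-- an apex-bearing cell: some letter is an apex `O` ∕ `nI`. -/
def ApexBearing (Z : MCell) : Prop := ∃ f, (Z f).2 = (0, 0)

/-- a four-charged cell: every letter charged. -/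
def FourCharged (Z : MCell) : Prop := ∀ f, (Z f).2 ≠ (0, 0)

/-- the SHAPE CLASS `K_N` of `N`-cells the kernel declares absent (`ChargeInduction` v11: phase 1 + (CD-N) + the `N` seeds):
`≥ 2` charged letters and not level, or level with a charged letter of node level `< 2·(count)`. -/
def KN (Z : MCell) : Prop :=
  (2 ≤ chargeCount Z ∧ ¬ LevelCell Z) ∨ (LevelCell Z ∧ ∃ f, (Z f).2 ≠ (0, 0) ∧ nodeLevel (Z f) < 2 * (chargeCount Z : ℤ))

/-- the SHAPE CLASS `K_P` of `P`-cells the kernel declares absent: `≥ 3` charged and not level, or `2` charged, not level and not HIGH (a charged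
letter of node `< 4`), or level with a charged letter of node `< 2·(count) − 2` ((CD-P)). -/
def KP (P : MCell) : Prop :=
  (3 ≤ chargeCount P ∧ ¬ LevelCell P) ∨ (chargeCount P = 2 ∧ ¬ LevelCell P ∧ ∃ f, (P f).2 ≠ (0, 0) ∧ nodeLevel (P f) < 4) ∨
    (LevelCell P ∧ ∃ f, (P f).2 ≠ (0, 0) ∧ nodeLevel (P f) < 2 * (chargeCount P : ℤ) - 2)

/-- (A₃) the APEX-BEARING `K`-cells are absent (in the peel they die through `X⁺`, A2I⁻ and the line-phase laws; displayed here). -/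
def ApexBearingKAbsent (C : MConfig) : Prop :=
  (∀ Z ∈ C.lower, KN Z → ApexBearing Z → False) ∧ (∀ P ∈ C.upper, KP P → ApexBearing P → False)

/-- a real `P`-cell with EXACTLY ONE apex, the apex lying strictly below the causal top of every (charged) other letter — the only apex-bearing
`P`-cells the Φ∕Θ-peel of an `N`-head ever produces (a descended minimum reaching its node; §9g). -/
def LowApexP (P : MCell) : Prop := ∃ f, (P f).2 = (0, 0) ∧ ∀ g, g ≠ f → (P g).2 ≠ (0, 0) ∧ nodeLevel (P f) < causalTop (P g)

/-- a real `N`-cell with EXACTLY ONE apex, the apex lying strictly above the node of every (charged) other letter — the only apex-bearing `N`-cells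
the peel of a `P`-head ever produces (a lifted maximum reaching its top; §9g). -/
def HighApexN (Z : MCell) : Prop := ∃ f, (Z f).2 = (0, 0) ∧ ∀ g, g ≠ f → (Z g).2 ≠ (0, 0) ∧ nodeLevel (Z g) < causalTop (Z f)

/-- (A₃ᴵ) the INTERFACE of the peel is absent: no high-one-apex `N`-cell of `K_N`, no low-one-apex `P`-cell of `K_P` (§9g: this — not all of (A₃) —
is what the four-charged peel consumes; implied by (A₃), `interfaceKAbsent_of_apexBearingKAbsent`). -/
def InterfaceKAbsent (C : MConfig) : Prop :=
  (∀ Z ∈ C.lower, KN Z → HighApexN Z → False) ∧ (∀ P ∈ C.upper, KP P → LowApexP P → False)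

theorem interfaceKAbsent_of_apexBearingKAbsent {C : MConfig} (hA : ApexBearingKAbsent C) : InterfaceKAbsent C :=
  ⟨fun Z hZ hK ⟨f, hf, _⟩ => hA.1 Z hZ hK ⟨f, hf⟩, fun P hP hK ⟨f, hf, _⟩ => hA.2 P hP hK ⟨f, hf⟩⟩

/-- the four-charged `K`-cells are absent. -/
def FourChargedKAbsent (C : MConfig) : Prop :=
  (∀ Z ∈ C.lower, KN Z → FourCharged Z → False) ∧ (∀ P ∈ C.upper, KP P → FourCharged P → False)

/-! ## §4b Weighted keys `Φ_{a,b} = a·Ψ + b·Q` and THE LAW IN `h`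

The census admits `Ψ + λ·Q` exactly for `λ` in a WINDOW (memo `PAIR-SPREAD-g15.md` §2): `◇₈` `λ ∈ {0, 1}` pass, `λ = 2` fails (400 heads: the
`≥ 3`-fold-maximum descents, `ΔΨ = +2e`, `ΔQ = −e`); `◇₁₀` `λ ∈ {1∕2, 1, 3∕2}` pass, `λ = 0` fails (52 heads: the FLOOR-OVERSHOOT family
`[(0,h,h∕2)², (h−4,h−2,1)²]`, `ΔΨ = 10 − h`, `ΔQ = (h−6)∕2`), `λ = 2` fails (2 184).  Both families are `h`-uniform, whence the window
`λ ∈ (2(h−10)∕(h−6), 2)`: no fixed `λ` serves all `h`; the `h`-free key is the limit `λ → 2⁻` = Θ of §9.  Everything KERNEL below holds for all weights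
`0 < a`, `0 ≤ b ≤ 2a` (the rules) resp. `0 ≤ a, b` (the reduction `fourChargedK_absent_of_phiStepWI`). -/

/-- the weighted key `Φ_{a,b}(Z) = a·Ψ(Z) + b·Q(Z)`. -/
def phiW (a b : ℤ) (Z : MCell) : ℤ := a * pairSpread Z + b * chargeSum Z

theorem phiW_nonneg {a b : ℤ} (ha : 0 ≤ a) (hb : 0 ≤ b) (Z : MCell) : 0 ≤ phiW a b Z :=
  add_nonneg (mul_nonneg ha (pairSpread_nonneg Z)) (mul_nonneg hb (chargeSum_nonneg Z))

theorem phiW_le {a b h : ℤ} (ha : 0 ≤ a) (hb : 0 ≤ b) {Z : MCell} (hZ : MCell.InDiamond h Z) : phiW a b Z ≤ a * (8 * h) + b * (2 * h) :=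
  add_le_add (mul_le_mul_of_nonneg_left (pairSpread_le hZ) ha) (mul_le_mul_of_nonneg_left (chargeSum_le hZ) hb)

/-- DISPLAYED INDUCTION HYPOTHESIS for the weighted key: the four-charged `K`-cells of `Φ_{a,b} > φ` are absent. -/
def FourChargedKAbsentAboveW (a b : ℤ) (C : MConfig) (φ : ℤ) : Prop :=
  (∀ Z ∈ C.lower, KN Z → FourCharged Z → φ < phiW a b Z → False) ∧ (∀ P ∈ C.upper, KP P → FourCharged P → φ < phiW a b P → False)

/-- **(Φ_{a,b}-STEP_h)** — the weighted one-integer law (CONJECTURED for `λ = b∕a` inside the window; as a ONE-CLAUSE certificate it is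
census-exact at `h = 8` for `(a,b) ∈ {(1,0), (1,1)}` and at `h = 10` for `(a,b) ∈ {(2,1), (1,1), (2,3)}`, and census-false at `h = 8` for `(1,2)`,
at `h = 10` for `(1,0)` and `(1,2)`).  NOT proved for any weights. -/
def PhiStepW (a b h : ℤ) : Prop :=
  ∀ C : MConfig, C.InDiamond h → RuleDMu4Closed C → ApexBearingKAbsent C → ∀ φ : ℤ, FourChargedKAbsentAboveW a b C φ →
    (∀ Z ∈ C.lower, KN Z → FourCharged Z → phiW a b Z = φ → False) ∧ (∀ P ∈ C.upper, KP P → FourCharged P → phiW a b P = φ → False)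

/-- **THE WEIGHTED Φ-PEEL** (KERNEL, all weights `0 ≤ a, b`): downward induction on the single integer `Φ_{a,b} ∈ [0, 8ah + 2bh]`. -/
theorem fourChargedK_absent_of_phiStepW {a b h : ℤ} (ha : 0 ≤ a) (hb : 0 ≤ b) (hS : PhiStepW a b h) {C : MConfig} (hU : C.InDiamond h)
    (hD : RuleDMu4Closed C) (hA : ApexBearingKAbsent C) : FourChargedKAbsent C := by
  have hbN : ∀ Z ∈ C.lower, phiW a b Z ≤ a * (8 * h) + b * (2 * h) := fun Z hZ => phiW_le ha hb (hU.1 Z hZ)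
  have hbP : ∀ P ∈ C.upper, phiW a b P ≤ a * (8 * h) + b * (2 * h) := fun P hP => phiW_le ha hb (hU.2 P hP)
  generalize a * (8 * h) + b * (2 * h) = B at hbN hbP
  have key : ∀ n : ℕ, (∀ Z ∈ C.lower, KN Z → FourCharged Z → B - n ≤ phiW a b Z → False) ∧
      (∀ P ∈ C.upper, KP P → FourCharged P → B - n ≤ phiW a b P → False) := by
    intro n
    induction n with
    | zero =>
      have hab : FourChargedKAbsentAboveW a b C B :=
        ⟨fun Z hZ _ _ hlt => absurd (hbN Z hZ) (not_le.2 hlt), fun P hP _ _ hlt => absurd (hbP P hP) (not_le.2 hlt)⟩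
      obtain ⟨hN, hP⟩ := hS C hU hD hA B hab
      refine ⟨fun Z hZ hK h4 hle => hN Z hZ hK h4 ?_, fun P hP' hK h4 hle => hP P hP' hK h4 ?_⟩
      · have := hbN Z hZ; push_cast at hle; omega
      · have := hbP P hP'; push_cast at hle; omega
    | succ n ih =>
      have hab : FourChargedKAbsentAboveW a b C (B - (n + 1)) :=
        ⟨fun Z hZ hK h4 hlt => ih.1 Z hZ hK h4 (by omega), fun P hP hK h4 hlt => ih.2 P hP hK h4 (by omega)⟩
      obtain ⟨hN, hP⟩ := hS C hU hD hA (B - (n + 1)) hab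
      refine ⟨fun Z hZ hK h4 hle => ?_, fun P hP' hK h4 hle => ?_⟩
      · by_cases he : phiW a b Z = B - (n + 1)
        · exact hN Z hZ hK h4 he
        · exact ih.1 Z hZ hK h4 (by push_cast at hle; omega)
      · by_cases he : phiW a b P = B - (n + 1)
        · exact hP P hP' hK h4 he
        · exact ih.2 P hP' hK h4 (by push_cast at hle; omega)
  refine ⟨fun Z hZ hK h4 => (key B.toNat).1 Z hZ hK h4 ?_, fun P hP hK h4 => (key B.toNat).2 P hP hK h4 ?_⟩
  · have := phiW_nonneg ha hb Z; have := Int.self_le_toNat B; omega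
  · have := phiW_nonneg ha hb P; have := Int.self_le_toNat B; omega

/-! ## §5 RULE B of the rulebook as a KERNEL step: the (node, node) clause at a unique node-minimal letter -/

theorem chargeCount_eq_four {Z : MCell} (hall : ∀ f, (Z f).2 ≠ (0, 0)) : chargeCount Z = 4 := by
  unfold chargeCount
  rw [Finset.filter_true_of_mem (fun f _ => hall f)]
  simp

/-- tops decide levelness: cells with the same causal tops slotwise are level together. -/
theorem levelCell_iff_of_tops {P Z : MCell} (ht : ∀ f, causalTop (P f) = causalTop (Z f)) : LevelCell P ↔ LevelCell Z := by
  unfold LevelCell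
  constructor
  · intro hl f g; rw [← ht f, ← ht g]; exact hl f g
  · intro hl f g; rw [ht f, ht g]; exact hl f g

/-- **RULE B** (KERNEL, law-free, every `h`).  A four-charged `N`-cell `Z ∈ C.lower` with a UNIQUE node-minimal letter `y` and a letter `z` of the
second node level, which is non-level or has `node(y) ≤ 4` or `node(z) ≤ 6`: RULE D at (node of `y`, node of `z`) is served by a four-charged
`P ∈ C.upper` of class `K_P` (same tops; drops of `y` and∕or `z`) with `Ψ(P) > Ψ(Z)` (`+3δ` for a drop of the minimum, `≥ +δ` for a drop of the
second-lowest letter) and `Q(P) ≥ Q(Z)`, so `Φ(P) > Φ(Z)`.  Hence `Z` is absent as soon as the four-charged `K`-cells of larger Φ are.  (First rule of the g15 rulebook: 23 064 ∕ 61 810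
◇₈ and 137 824 ∕ 297 974 ◇₁₀ four-charged `K`-heads are peeled by it.) -/
theorem ruleB_N_W {a b : ℤ} (ha : 0 < a) (hb : 0 ≤ b) {h : ℤ} {C : MConfig} (hU : C.InDiamond h) {Z : MCell} (hZ : Z ∈ C.lower) (hD : RuleDMu4N C Z) (h4 : FourCharged Z)
    {y z : Fin 4} (hyz : y ≠ z) (hy : ∀ g, g ≠ y → nodeLevel (Z y) < nodeLevel (Z g)) (hz : ∀ g, g ≠ y → nodeLevel (Z z) ≤ nodeLevel (Z g))
    (hlev : ¬ LevelCell Z ∨ nodeLevel (Z y) ≤ 4 ∨ nodeLevel (Z z) ≤ 6) (hIH : FourChargedKAbsentAboveW a b C (phiW a b Z)) : False := by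
  have hne : nodeLevel (Z y) ≠ nodeLevel (Z z) := ne_of_lt (hy z hyz.symm)
  obtain ⟨P, hP, hag, hoy, hoz, hmv⟩ := edge_nn_outcomes hU hZ hD hyz hne
  -- slotwise: tops are kept, nodes do not go up, letters stay charged
  have hslot : ∀ f, causalTop (P f) = causalTop (Z f) ∧ nodeLevel (P f) ≤ nodeLevel (Z f) ∧ (P f).2 ≠ (0, 0) := by
    intro f
    by_cases hfy : f = y
    · subst hfy
      rcases hoy with e | ⟨hc, ht, hn⟩
      · rw [e]; exact ⟨rfl, le_rfl, h4 f⟩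
      · exact ⟨ht, hn.le, hc⟩
    by_cases hfz : f = z
    · subst hfz
      rcases hoz with e | ⟨hc, ht, hn⟩
      · rw [e]; exact ⟨rfl, le_rfl, h4 f⟩
      · exact ⟨ht, hn.le, hc⟩
    · rw [hag f hfy hfz]; exact ⟨rfl, le_rfl, h4 f⟩
  have h4P : FourCharged P := fun f => (hslot f).2.2
  have hcc : chargeCount P = 4 := chargeCount_eq_four h4P
  have hlvl : LevelCell P ↔ LevelCell Z := levelCell_iff_of_tops fun f => (hslot f).1
  -- `P ∈ K_P`
  have hKP : KP P := by
    by_cases hl : LevelCell Z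
    · right; right
      refine ⟨hlvl.2 hl, ?_⟩
      rcases hlev with hnl | hy4 | hz6
      · exact (hnl hl).elim
      · refine ⟨y, h4P y, ?_⟩; rw [hcc]; have := (hslot y).2.1; push_cast; omega
      · -- `z` has node `≤ 6`: whichever of `y`, `z` dropped has node `< 6`
        rcases hoz with e | ⟨-, -, hn⟩
        · rcases hoy with e' | ⟨-, -, hn'⟩
          · exact (hmv.elim (fun hne' => (hne' e').elim) fun hne' => (hne' e).elim)
          · refine ⟨y, h4P y, ?_⟩; rw [hcc]; have := hy z hyz.symm; push_cast; omega
        · refine ⟨z, h4P z, ?_⟩; rw [hcc]; push_cast; omega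
    · left; exact ⟨by rw [hcc]; norm_num, fun hl' => hl (hlvl.1 hl')⟩
  -- Ψ goes up: tops are kept; on the nodes lower `y` first (the minimum: `+3δ_y`), then `z` (second-lowest: `≥ +δ_z`)
  have htops : (fun f => causalTop (P f)) = fun f => causalTop (Z f) := funext fun f => (hslot f).1
  have hlt : pairSpread Z < pairSpread P := by
    have hPy := (hslot y).2.1
    have hPz := (hslot z).2.1
    let m : Fin 4 → ℤ := fun f => if f = y then nodeLevel (P y) else nodeLevel (Z f)
    have hmy : m y = nodeLevel (P y) := by simp [m]
    have hmg : ∀ g, g ≠ y → m g = nodeLevel (Z g) := fun g hg => by simp [m, hg]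
    have hmz : m z = nodeLevel (Z z) := hmg z (Ne.symm hyz)
    have hm1 : spreadOf m = spreadOf (fun f => nodeLevel (Z f)) + 3 * (nodeLevel (Z y) - m y) := by
      refine spreadOf_lower_min (v := fun f => nodeLevel (Z f)) (w := m) (y := y) ?_ ?_ ?_
      · intro g; show nodeLevel (Z y) ≤ nodeLevel (Z g)
        by_cases hg : g = y
        · subst hg; exact le_rfl
        · exact (hy g hg).le
      · intro g hg; exact hmg g hg
      · show m y ≤ nodeLevel (Z y); rw [hmy]; exact hPy
    have hm2 : spreadOf m + (m z - nodeLevel (P z)) ≤ spreadOf (fun f => nodeLevel (P f)) := by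
      refine spreadOf_lower_second (v := m) (w := fun f => nodeLevel (P f)) (y := z) (u := y) ?_ ?_ ?_
      · intro g hg; show m z ≤ m g; rw [hmz, hmg g hg]; exact hz g hg
      · intro g hg; show nodeLevel (P g) = m g
        by_cases hgy : g = y
        · rw [hgy, hmy]
        · rw [hmg g hgy, hag g hgy hg]
      · show nodeLevel (P z) ≤ m z; rw [hmz]; exact hPz
    have hδ : 0 < (nodeLevel (Z y) - m y) + (m z - nodeLevel (P z)) := by
      rw [hmy, hmz]
      rcases hmv with hne' | hne'
      · rcases hoy with e | ⟨-, -, hn⟩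
        · exact (hne' e).elim
        · omega
      · rcases hoz with e | ⟨-, -, hn⟩
        · exact (hne' e).elim
        · omega
    rw [hmy] at hm1 hδ; rw [hmz] at hm2 hδ
    unfold pairSpread; rw [htops]; omega
  -- and `Q` does not go down (tops kept, nodes not raised)
  have hQ : chargeSum Z ≤ chargeSum P := chargeSum_mono fun f => by
    have := two_mul_absCharge (Z f); have := two_mul_absCharge (P f); have := (hslot f).1; have := (hslot f).2.1; omega
  have e1 := mul_lt_mul_of_pos_left hlt ha
  have e2 := mul_le_mul_of_nonneg_left hQ hb
  exact hIH.2 P hP hKP h4P (by unfold phiW; linarith)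

/-! ## §6 The `P`-side by duality: RULE D above a `P`-cell at two top coordinates, and RULE B above -/

set_option linter.unusedSimpArgs false in
theorem absCharge_dualPt (h : ℤ) (x : BPoint) : absCharge (dualPt h x) = absCharge x := by
  obtain ⟨a, b₁, b₂⟩ := x
  simp only [absCharge, chargeOf, dualPt]
  rw [show -b₁ - -b₂ = -(b₁ - b₂) by ring, abs_neg]

set_option linter.unusedSimpArgs false in
theorem causalTop_dualPt (h : ℤ) (x : BPoint) : causalTop (dualPt h x) = h - nodeLevel x := by
  unfold causalTop nodeLevel; rw [absCharge_dualPt]; simp only [dualPt]; ring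

set_option linter.unusedSimpArgs false in
theorem nodeLevel_dualPt (h : ℤ) (x : BPoint) : nodeLevel (dualPt h x) = h - causalTop x := by
  unfold causalTop nodeLevel; rw [absCharge_dualPt]; simp only [dualPt]; ring

set_option linter.unusedSimpArgs false in
theorem snd_dualPt_ne {h : ℤ} {x : BPoint} (hx : x.2 ≠ (0, 0)) : (dualPt h x).2 ≠ (0, 0) := by
  obtain ⟨a, b₁, b₂⟩ := x
  simp only [dualPt, ne_eq, Prod.mk.injEq, neg_eq_zero] at hx ⊢
  exact hx

set_option linter.unusedSimpArgs false in
/-- the dual of a `◇_h` letter is a `◇_h` letter (`h` even). -/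
theorem inDiamond_dualPt {h : ℤ} (hh : h % 2 = 0) {x : BPoint} (hx : InDiamond h x) : InDiamond h (dualPt h x) := by
  obtain ⟨a, b₁, b₂⟩ := x
  have hq : absCharge (dualPt h (a, b₁, b₂)) = absCharge (a, b₁, b₂) := absCharge_dualPt h _
  obtain ⟨hax, h1, h2, h3⟩ := hx
  refine ⟨?_, ?_, ?_, ?_⟩
  · rcases hax with h0 | hA
    · left; simp only [Prod.mk.injEq] at h0; simp [dualPt, h0.1, h0.2]
    · right; simp only [AxisPt, dualPt, ne_eq, neg_eq_zero] at hA ⊢; exact hA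
  · rw [hq]; simp only [dualPt]; simp only at h3; omega
  · rw [hq]; simp only [dualPt]; simp only at h1 h2 h3; omega
  · rw [hq]; simp only [dualPt]; simp only at h1; omega

/-- the dual of a `◇_h` configuration is a `◇_h` configuration (`h` even). -/
theorem inDiamond_dual {h : ℤ} (hh : h % 2 = 0) {C : MConfig} (hU : C.InDiamond h) : (C.dual h).InDiamond h := by
  refine ⟨fun Z hZ f => ?_, fun P hP f => ?_⟩
  · have hP := mem_dual_lower.1 hZ
    have := inDiamond_dualPt hh (hU.2 _ hP f)
    simpa [dualCell, dualPt_dualPt] using this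
  · have hZ := mem_dual_upper.1 hP
    have := inDiamond_dualPt hh (hU.1 _ hZ f)
    simpa [dualCell, dualPt_dualPt] using this

/-- `n` is a TOP RAISE of `x`: charged, same node level, strictly higher causal top (the dual of a drop). -/
def RaiseOf (x n : BPoint) : Prop := n.2 ≠ (0, 0) ∧ nodeLevel n = nodeLevel x ∧ causalTop x < causalTop n

set_option linter.unusedSimpArgs false in
theorem raiseOf_of_dropOf_dual {h : ℤ} {x n : BPoint} (hd : DropOf (dualPt h x) (dualPt h n)) : RaiseOf x n := by
  obtain ⟨hc, ht, hn⟩ := hd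
  rw [causalTop_dualPt, causalTop_dualPt] at ht
  rw [nodeLevel_dualPt, nodeLevel_dualPt] at hn
  refine ⟨fun h0 => hc ?_, by omega, by omega⟩
  simp only [dualPt, h0, Prod.mk.injEq, neg_zero, and_self]

/-- **EDGE (tt) ABOVE in OUTCOME FORM** (KERNEL, `h` even, law-free): RULE D above a `P`-cell at (top of `y`, top of `z`), `y ≠ z`, tops different, is
served by some `N ∈ C.lower` agreeing with `P` off `{y, z}` whose `y`- and `z`-letters are `P`'s or top raises of them, not both `P`'s.
(`edge_nn_outcomes` in `C.dual h`.) -/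
theorem edge_tt_outcomes_P {h : ℤ} (hh : h % 2 = 0) {C : MConfig} (hU : C.InDiamond h) {P : MCell} (hP : P ∈ C.upper) (hD : RuleDMu4P C P)
    {y z : Fin 4} (hyz : y ≠ z) (hne : causalTop (P y) ≠ causalTop (P z)) :
    ∃ N ∈ C.lower, MAgree2 N P y z ∧ (N y = P y ∨ RaiseOf (P y) (N y)) ∧ (N z = P z ∨ RaiseOf (P z) (N z)) ∧ (N y ≠ P y ∨ N z ≠ P z) := by
  have hU' := inDiamond_dual hh hU
  have hZ' : dualCell h P ∈ (C.dual h).lower := dualCell_mem_dual_lower hP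
  have hD' : RuleDMu4N (C.dual h) (dualCell h P) := (ruleDMu4P_dual h C P).2 hD
  have hne' : nodeLevel (dualCell h P y) ≠ nodeLevel (dualCell h P z) := by
    show nodeLevel (dualPt h (P y)) ≠ nodeLevel (dualPt h (P z)); rw [nodeLevel_dualPt, nodeLevel_dualPt]; omega
  obtain ⟨P', hP', hag, hoy, hoz, hmv⟩ := edge_nn_outcomes hU' hZ' hD' hyz hne'
  have hN : dualCell h P' ∈ C.lower := mem_dual_upper.1 hP'
  have hback : ∀ f, P' f = dualPt h (dualCell h P' f) := fun f => by simp [dualCell, dualPt_dualPt]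
  have hPf : ∀ f, dualCell h P f = dualPt h (P f) := fun f => rfl
  refine ⟨dualCell h P', hN, fun f hf1 hf2 => ?_, ?_, ?_, ?_⟩
  · show dualPt h (P' f) = P f; rw [hag f hf1 hf2, hPf, dualPt_dualPt]
  · rcases hoy with e | hd
    · left; show dualPt h (P' y) = P y; rw [e, hPf, dualPt_dualPt]
    · right; rw [hback y, hPf] at hd; exact raiseOf_of_dropOf_dual hd
  · rcases hoz with e | hd
    · left; show dualPt h (P' z) = P z; rw [e, hPf, dualPt_dualPt]
    · right; rw [hback z, hPf] at hd; exact raiseOf_of_dropOf_dual hd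
  · rcases hmv with hn | hn
    · left; intro e; apply hn; rw [hback y, hPf]; exact congrArg (dualPt h) e
    · right; intro e; apply hn; rw [hback z, hPf]; exact congrArg (dualPt h) e

/-- spread is invariant under negation of all entries … -/
theorem spreadOf_neg (v : Fin 4 → ℤ) : spreadOf (fun f => -v f) = spreadOf v := by
  simp only [spreadOf]
  rw [show -v 0 - -v 1 = -(v 0 - v 1) by ring, show -v 0 - -v 2 = -(v 0 - v 2) by ring, show -v 0 - -v 3 = -(v 0 - v 3) by ring,
    show -v 1 - -v 2 = -(v 1 - v 2) by ring, show -v 1 - -v 3 = -(v 1 - v 3) by ring, show -v 2 - -v 3 = -(v 2 - v 3) by ring]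
  simp only [abs_neg]

/-- … so raising a MAXIMAL entry by `δ ≥ 0` raises the spread by exactly `3δ` … -/
theorem spreadOf_raise_max {v w : Fin 4 → ℤ} {y : Fin 4} (hmax : ∀ g, v g ≤ v y) (hw : ∀ g, g ≠ y → w g = v g) (hy : v y ≤ w y) :
    spreadOf w = spreadOf v + 3 * (w y - v y) := by
  have := spreadOf_lower_min (v := fun f => -v f) (w := fun f => -w f) (y := y) (fun g => by simpa using hmax g)
    (fun g hg => by simp [hw g hg]) (by simpa using hy)
  rw [spreadOf_neg, spreadOf_neg] at this; omega

/-- … and raising an entry with at most one entry strictly above it by `δ ≥ 0` raises the spread by at least `δ`. -/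
theorem spreadOf_raise_second {v w : Fin 4 → ℤ} {y u : Fin 4} (hsec : ∀ g, g ≠ u → v g ≤ v y) (hw : ∀ g, g ≠ y → w g = v g)
    (hy : v y ≤ w y) : spreadOf v + (w y - v y) ≤ spreadOf w := by
  have := spreadOf_lower_second (v := fun f => -v f) (w := fun f => -w f) (y := y) (u := u) (fun g hg => by simpa using hsec g hg)
    (fun g hg => by simp [hw g hg]) (by simpa using hy)
  rw [spreadOf_neg, spreadOf_neg] at this; omega

/-- **RULE B ABOVE** (KERNEL, `h` even, law-free).  A four-charged `P`-cell `P ∈ C.upper` with a UNIQUE top-maximal letter `y` and a letter `z` of the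
second causal top: RULE D at (top of `y`, top of `z`) is served by a four-charged NON-LEVEL `N ∈ C.lower` (class `K_N`; top raises of `y` and∕or `z`)
with `Ψ(N) > Ψ(P)` and `Q(N) ≥ Q(P)`, so `Φ(N) > Φ(P)`.  Hence `P` is absent as soon as the four-charged `K`-cells of larger Φ are.  (The dual of `ruleB_N`; no level proviso is needed on
this side because a cell with a unique maximal top is not level and its raises stay non-level.) -/
theorem ruleB_P_W {a b : ℤ} (ha : 0 < a) (hb : 0 ≤ b) {h : ℤ} (hh : h % 2 = 0) {C : MConfig} (hU : C.InDiamond h) {P : MCell} (hP : P ∈ C.upper) (hD : RuleDMu4P C P)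
    (h4 : FourCharged P) {y z : Fin 4} (hyz : y ≠ z) (hy : ∀ g, g ≠ y → causalTop (P g) < causalTop (P y))
    (hz : ∀ g, g ≠ y → causalTop (P g) ≤ causalTop (P z)) (hIH : FourChargedKAbsentAboveW a b C (phiW a b P)) : False := by
  have hne : causalTop (P y) ≠ causalTop (P z) := (ne_of_lt (hy z hyz.symm)).symm
  obtain ⟨N, hN, hag, hoy, hoz, hmv⟩ := edge_tt_outcomes_P hh hU hP hD hyz hne
  have hslot : ∀ f, nodeLevel (N f) = nodeLevel (P f) ∧ causalTop (P f) ≤ causalTop (N f) ∧ (N f).2 ≠ (0, 0) := by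
    intro f
    by_cases hfy : f = y
    · subst hfy
      rcases hoy with e | ⟨hc, hn, ht⟩
      · rw [e]; exact ⟨rfl, le_rfl, h4 f⟩
      · exact ⟨hn, ht.le, hc⟩
    by_cases hfz : f = z
    · subst hfz
      rcases hoz with e | ⟨hc, hn, ht⟩
      · rw [e]; exact ⟨rfl, le_rfl, h4 f⟩
      · exact ⟨hn, ht.le, hc⟩
    · rw [hag f hfy hfz]; exact ⟨rfl, le_rfl, h4 f⟩
  have h4N : FourCharged N := fun f => (hslot f).2.2
  have hcc : chargeCount N = 4 := chargeCount_eq_four h4N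
  -- a third letter `g₀ ∉ {y, z}` keeps its top `≤ top z < top y ≤ top (N y)`: `N` is not level
  obtain ⟨g₀, hg₀y, hg₀z⟩ : ∃ g₀ : Fin 4, g₀ ≠ y ∧ g₀ ≠ z := by
    by_cases h0 : (0 : Fin 4) ≠ y ∧ (0 : Fin 4) ≠ z
    · exact ⟨0, h0⟩
    by_cases h1 : (1 : Fin 4) ≠ y ∧ (1 : Fin 4) ≠ z
    · exact ⟨1, h1⟩
    · refine ⟨2, ?_, ?_⟩ <;> omega
  have hnl : ¬ LevelCell N := by
    intro hl
    have e := hl g₀ y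
    rw [hag g₀ hg₀y hg₀z] at e
    have := hy g₀ hg₀y; have := (hslot y).2.1; omega
  have hKN : KN N := Or.inl ⟨by rw [hcc]; norm_num, hnl⟩
  -- Ψ goes up: nodes are kept; on the tops raise `y` first (the maximum: `+3δ_y`), then `z` (second-highest: `≥ +δ_z`)
  have hnodes : (fun f => nodeLevel (N f)) = fun f => nodeLevel (P f) := funext fun f => (hslot f).1
  have hlt : pairSpread P < pairSpread N := by
    have hNy := (hslot y).2.1
    have hNz := (hslot z).2.1
    let m : Fin 4 → ℤ := fun f => if f = y then causalTop (N y) else causalTop (P f)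
    have hmy : m y = causalTop (N y) := by simp [m]
    have hmg : ∀ g, g ≠ y → m g = causalTop (P g) := fun g hg => by simp [m, hg]
    have hmz : m z = causalTop (P z) := hmg z (Ne.symm hyz)
    have hm1 : spreadOf m = spreadOf (fun f => causalTop (P f)) + 3 * (m y - causalTop (P y)) := by
      refine spreadOf_raise_max (v := fun f => causalTop (P f)) (w := m) (y := y) ?_ ?_ ?_
      · intro g; show causalTop (P g) ≤ causalTop (P y)
        by_cases hg : g = y
        · subst hg; exact le_rfl
        · exact (hy g hg).le
      · intro g hg; exact hmg g hg
      · show causalTop (P y) ≤ m y; rw [hmy]; exact hNy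
    have hm2 : spreadOf m + (causalTop (N z) - m z) ≤ spreadOf (fun f => causalTop (N f)) := by
      refine spreadOf_raise_second (v := m) (w := fun f => causalTop (N f)) (y := z) (u := y) ?_ ?_ ?_
      · intro g hg; show m g ≤ m z; rw [hmz, hmg g hg]; exact hz g hg
      · intro g hg; show causalTop (N g) = m g
        by_cases hgy : g = y
        · rw [hgy, hmy]
        · rw [hmg g hgy, hag g hgy hg]
      · show m z ≤ causalTop (N z); rw [hmz]; exact hNz
    have hδ : 0 < (m y - causalTop (P y)) + (causalTop (N z) - m z) := by
      rw [hmy, hmz]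
      rcases hmv with hne' | hne'
      · rcases hoy with e | ⟨-, -, ht⟩
        · exact (hne' e).elim
        · omega
      · rcases hoz with e | ⟨-, -, ht⟩
        · exact (hne' e).elim
        · omega
    rw [hmy] at hm1 hδ; rw [hmz] at hm2 hδ
    unfold pairSpread; rw [hnodes]; omega
  -- and `Q` does not go down (nodes kept, tops not lowered)
  have hQ : chargeSum P ≤ chargeSum N := chargeSum_mono fun f => by
    have := two_mul_absCharge (P f); have := two_mul_absCharge (N f); have := (hslot f).1; have := (hslot f).2.1; omega
  have e1 := mul_lt_mul_of_pos_left hlt ha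
  have e2 := mul_le_mul_of_nonneg_left hQ hb
  exact hIH.1 N hN hKN h4N (by unfold phiW; linarith)

/-! ## §7 RULE A′₀ of the rulebook as a KERNEL step: the (top, node) clause at a letter that is simultaneously top- and node-minimal -/

/-- the sum of a `Fin 4`-vector, written out. -/
def sum4 (v : Fin 4 → ℤ) : ℤ := v 0 + v 1 + v 2 + v 3

theorem sum4_two_slots {v w : Fin 4 → ℤ} {x y : Fin 4} (hxy : x ≠ y) (h : ∀ f, f ≠ x → f ≠ y → w f = v f) :
    sum4 w = sum4 v + (w x - v x) + (w y - v y) := by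
  fin_cases x <;> fin_cases y <;>
    first
    | exact absurd rfl hxy
    | (simp only [sum4]
       have h0 := h 0; have h1 := h 1; have h2 := h 2; have h3 := h 3
       simp at h0 h1 h2 h3 ⊢
       omega)

theorem chargeSum_eq_sum4 (Z : MCell) : chargeSum Z = sum4 fun f => absCharge (Z f) := rfl

theorem chargeCount_ge_three {P : MCell} {x : Fin 4} (h : ∀ f, f ≠ x → (P f).2 ≠ (0, 0)) : 3 ≤ chargeCount P := by
  unfold chargeCount
  calc 3 = (Finset.univ.erase x).card := by rw [Finset.card_erase_of_mem (Finset.mem_univ x)]; simp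
    _ ≤ _ := Finset.card_le_card fun f hf => by
        rw [Finset.mem_erase] at hf
        rw [Finset.mem_filter]; exact ⟨Finset.mem_univ f, h f hf.1⟩

/-- a third index. -/
theorem exists_third (x y : Fin 4) : ∃ g : Fin 4, g ≠ x ∧ g ≠ y := by
  by_cases h0 : (0 : Fin 4) ≠ x ∧ (0 : Fin 4) ≠ y
  · exact ⟨0, h0⟩
  by_cases h1 : (1 : Fin 4) ≠ x ∧ (1 : Fin 4) ≠ y
  · exact ⟨1, h1⟩
  · refine ⟨2, ?_, ?_⟩ <;> omega

/-! ## §8 RULE A′₀ above a `P`-cell (the `N ↔ P` dual of §7, proved directly: the class `K` is not self-dual) -/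

/-- `n` is a LIFT of `x`: same causal top, strictly higher node level (the dual of a descent; `n` may be the apex at that top). -/
def LiftOf (x n : BPoint) : Prop := causalTop n = causalTop x ∧ nodeLevel x < nodeLevel n

/-- `n` is an UPWARD OVERSHOOT of `x`: charged, node level = the causal top of `x`, causal top strictly higher (the dual of an overshoot). -/
def OverUpOf (x n : BPoint) : Prop := n.2 ≠ (0, 0) ∧ nodeLevel n = causalTop x ∧ causalTop x < causalTop n

theorem liftOf_of_descOf_dual {h : ℤ} {x n : BPoint} (hd : DescOf (dualPt h x) (dualPt h n)) : LiftOf x n := by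
  obtain ⟨hn, ht⟩ := hd
  rw [nodeLevel_dualPt, nodeLevel_dualPt] at hn
  rw [causalTop_dualPt, causalTop_dualPt] at ht
  exact ⟨by omega, by omega⟩

set_option linter.unusedSimpArgs false in
theorem overUpOf_of_overOf_dual {h : ℤ} {x n : BPoint} (hd : OverOf (dualPt h x) (dualPt h n)) : OverUpOf x n := by
  obtain ⟨hc, ht, hn⟩ := hd
  rw [causalTop_dualPt, nodeLevel_dualPt] at ht
  rw [nodeLevel_dualPt, nodeLevel_dualPt] at hn
  refine ⟨fun h0 => hc ?_, by omega, by omega⟩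
  simp only [dualPt, h0, Prod.mk.injEq, neg_zero, and_self]

/-- **EDGE (nt) ABOVE in OUTCOME FORM** (KERNEL, `h` even, law-free): RULE D above a `P`-cell at (node of `x`, top of `y`), `x ≠ y`, `x` charged,
`node(x) ≠ top(y)`, is served by some `N ∈ C.lower` agreeing with `P` off `{x, y}` whose `x`-letter is `P`'s, a lift or an upward overshoot of it and
whose `y`-letter is `P`'s or a top raise of it, not both `P`'s.  (`edge_tn_outcomes` in `C.dual h`.) -/
theorem edge_nt_outcomes_P {h : ℤ} (hh : h % 2 = 0) {C : MConfig} (hU : C.InDiamond h) {P : MCell} (hP : P ∈ C.upper) (hD : RuleDMu4P C P)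
    {x y : Fin 4} (hxy : x ≠ y) (hxc : (P x).2 ≠ (0, 0)) (hne : nodeLevel (P x) ≠ causalTop (P y)) :
    ∃ N ∈ C.lower, MAgree2 N P x y ∧ (N x = P x ∨ LiftOf (P x) (N x) ∨ OverUpOf (P x) (N x)) ∧ (N y = P y ∨ RaiseOf (P y) (N y)) ∧
      (N x ≠ P x ∨ N y ≠ P y) := by
  have hU' := inDiamond_dual hh hU
  have hZ' : dualCell h P ∈ (C.dual h).lower := dualCell_mem_dual_lower hP
  have hD' : RuleDMu4N (C.dual h) (dualCell h P) := (ruleDMu4P_dual h C P).2 hD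
  have hxc' : (dualCell h P x).2 ≠ (0, 0) := snd_dualPt_ne hxc
  have hne' : causalTop (dualCell h P x) ≠ nodeLevel (dualCell h P y) := by
    show causalTop (dualPt h (P x)) ≠ nodeLevel (dualPt h (P y)); rw [causalTop_dualPt, nodeLevel_dualPt]; omega
  obtain ⟨P', hP', hag, hox, hoy, hmv⟩ := edge_tn_outcomes hU' hZ' hD' hxy hxc' hne'
  have hN : dualCell h P' ∈ C.lower := mem_dual_upper.1 hP'
  have hback : ∀ f, P' f = dualPt h (dualCell h P' f) := fun f => by simp [dualCell, dualPt_dualPt]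
  have hPf : ∀ f, dualCell h P f = dualPt h (P f) := fun f => rfl
  refine ⟨dualCell h P', hN, fun f hf1 hf2 => ?_, ?_, ?_, ?_⟩
  · show dualPt h (P' f) = P f; rw [hag f hf1 hf2, hPf, dualPt_dualPt]
  · rcases hox with e | hd | hd
    · left; show dualPt h (P' x) = P x; rw [e, hPf, dualPt_dualPt]
    · right; left; rw [hback x, hPf] at hd; exact liftOf_of_descOf_dual hd
    · right; right; rw [hback x, hPf] at hd; exact overUpOf_of_overOf_dual hd
  · rcases hoy with e | hd
    · left; show dualPt h (P' y) = P y; rw [e, hPf, dualPt_dualPt]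
    · right; rw [hback y, hPf] at hd; exact raiseOf_of_dropOf_dual hd
  · rcases hmv with hn | hn
    · left; intro e; apply hn; rw [hback x, hPf]; exact congrArg (dualPt h) e
    · right; intro e; apply hn; rw [hback y, hPf]; exact congrArg (dualPt h) e

/-! ## §9 (v7, g16) THE `h`-FREE KEY: Θ = lex(Ψ + 2Q ↑, Q ↓), its integer form `Θ_h = (2h+1)·Ψ + (4h+1)·Q`, and the three-rule Θ-RULEBOOK

The window's upper end is `2` at every `h` and the `λ = 2` failures are exact TIES, so the `h`-FREE key is the limit `λ → 2⁻`: Θ := (G ↑, then Q ↓),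
`G := Ψ + 2Q` (`gKey`; `G∕2` = the rank-weighted height), realised on `◇_h` (`0 ≤ Q ≤ 2h`) by `Θ_h := (2h+1)·Ψ + (4h+1)·Q = phiW (2h+1) (4h+1)`
(`theta_lt_iff`); `4h+1 ≤ 2(2h+1)`, so every weighted theorem of §4b–§8 applies to Θ_h.  SHAPE CENSUS (`tools/shaperef.py` = `tools/theta.c`, row-identical
to the g15 data at `h = 8, …, 16`, run to `h = 34`): 0 Θ-failures among 118 739 854 four-charged `K`-shapes, every fixed `λ` dying where predicted
(`λ = 3∕2` from `h = 22`, `λ = 1` from 16, `λ = 1∕2` and lex(Ψ,Q) from 12, `λ = 0` from 10, `λ = 2` always).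
THE Θ-RULEBOOK (N-view; `P` read through `(n,t) ↦ (h−t, h−n)`; 100 % first-try at `h = 8, …, 20`):
  (B)  unique node-minimum `y`: the (node `y`, node `z`) clause, `z` a second node-minimal letter — `ruleB_N_W` ∕ `ruleB_P_W` (§5–§6);
  (A1) a TOP-MINIMAL letter `w` that is not THIN-HIGH (`w` the unique node-maximum with `n_w − n_u ≥ t_w − n_w` for all `u ≠ w`) and a node-minimal
       `x ≠ w`: the (top `w`, node `x`) clause — `ruleA1_N_Θ` (every outcome raises `G` by `≥ 2`) and its `P`-dual with one proviso (§9e);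
  (A2) `u` the unique top-minimum and thin-high, `s` a letter of the second causal top, `x ≠ s` node-minimal: the (top `s`, node `x`) clause —
       `ruleA2_N_Θ` (a descent of `s` keeps `G` and lowers `Q` — the λ = 2 ties, broken by Θ; every other outcome raises `G`).
  COVERING (`thetaStep_N`; dual `thetaStep_P` in §9e): unique node-minimum ⇒ (B) or (A1) with `w = z`; tied ⇒ some top-minimal letter is not thin-high ⇒
  (A1), unless the top-minimum is unique and thin-high ⇒ (A2).  NOT proved here: (A₃)∕(A₃ᴵ), (T_h), H2, HC; HC_CM unused. -/

/-- `G = Ψ + 2Q`, twice the rank-weighted height. -/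
def gKey (Z : MCell) : ℤ := pairSpread Z + 2 * chargeSum Z

theorem phiW_theta_eq (h : ℤ) (Z : MCell) : phiW (2 * h + 1) (4 * h + 1) Z = (2 * h + 1) * gKey Z - chargeSum Z := by
  unfold phiW gKey; ring

/-- a strict rise of `G` raises Θ_h (the new cell lying in `◇_h`) … -/
theorem theta_lt_of_gKey_lt {h : ℤ} {Z P : MCell} (hP : MCell.InDiamond h P) (hG : gKey Z < gKey P) :
    phiW (2 * h + 1) (4 * h + 1) Z < phiW (2 * h + 1) (4 * h + 1) P := by
  rw [phiW_theta_eq, phiW_theta_eq]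
  have hQP := chargeSum_le hP
  have hQZ := chargeSum_nonneg Z
  have h0 : 0 ≤ h := by have := chargeSum_nonneg P; omega
  nlinarith

/-- … and so does a strict fall of `Q` at non-decreasing `G`. -/
theorem theta_lt_of_gKey_le {h : ℤ} {Z P : MCell} (h0 : 0 ≤ h) (hG : gKey Z ≤ gKey P) (hQ : chargeSum P < chargeSum Z) :
    phiW (2 * h + 1) (4 * h + 1) Z < phiW (2 * h + 1) (4 * h + 1) P := by
  rw [phiW_theta_eq, phiW_theta_eq]; nlinarith

/-- **Θ_h IS THE LEXICOGRAPHIC KEY** `(G ↑, Q ↓)` on `◇_h`. -/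
theorem theta_lt_iff {h : ℤ} {Z P : MCell} (hZ : MCell.InDiamond h Z) (hP : MCell.InDiamond h P) :
    phiW (2 * h + 1) (4 * h + 1) Z < phiW (2 * h + 1) (4 * h + 1) P ↔ gKey Z < gKey P ∨ (gKey Z = gKey P ∧ chargeSum P < chargeSum Z) := by
  have h0 : 0 ≤ h := by have := chargeSum_nonneg P; have := chargeSum_le hP; omega
  constructor
  · intro hlt
    rcases lt_trichotomy (gKey Z) (gKey P) with hl | he | hg
    · exact Or.inl hl
    · right; refine ⟨he, ?_⟩
      rw [phiW_theta_eq, phiW_theta_eq, he] at hlt; omega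
    · exact absurd hlt (not_lt.2 (theta_lt_of_gKey_lt hZ hg).le)
  · rintro (hl | ⟨he, hq⟩)
    · exact theta_lt_of_gKey_lt hP hl
    · exact theta_lt_of_gKey_le h0 he.le hq

/-- **THE Θ-LAW** (CONJECTURE as a whole; its `N`-half is `thetaStep_N` below, a theorem for every `h`): at every even height `h ≥ 8` the four-charged
stratum of `K_h` is peeled by the single integer `Θ_h = (2h+1)·Ψ + (4h+1)·Q` — ONE key for all `h` up to the order it induces (lex(G, −Q)).  One-clause
certificate census-exact at `h = 8, 10, …, 34` (0 ∕ 118 739 854 failing shapes). -/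
def ThetaLawH : Prop := ∀ h : ℤ, 8 ≤ h → h % 2 = 0 → PhiStepW (2 * h + 1) (4 * h + 1) h

/-! ### §9a The gap form of the spread arithmetic -/

theorem absPair_lower_gap (a b c g : ℤ) (_hba : b ≤ a) (hg : a - c ≤ g) (hg0 : 0 ≤ g) : |a - c| + (a - b) ≤ |b - c| + 2 * g := by
  rcases abs_cases (a - c) with ⟨h1, _⟩ | ⟨h1, _⟩ <;> rcases abs_cases (b - c) with ⟨h3, _⟩ | ⟨h3, _⟩ <;> omega

theorem absPair_lower_gap' (a b c g : ℤ) (hba : b ≤ a) (hg : a - c ≤ g) (hg0 : 0 ≤ g) : |c - a| + (a - b) ≤ |c - b| + 2 * g := by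
  rw [abs_sub_comm c a, abs_sub_comm c b]; exact absPair_lower_gap a b c g hba hg hg0

/-- lowering ANY entry `y` by `d ≥ 0` lowers the spread by at most `d + 2g` whenever some other entry `z` has `v y − v z ≤ g`, `g ≥ 0`
(so by at most `d` if another entry is `≥ v y`: the loss of a falling maximum is governed by its gap to the runner-up). -/
theorem spreadOf_lower_gap {v w : Fin 4 → ℤ} {y z : Fin 4} {g : ℤ} (hzy : z ≠ y) (hg : v y - v z ≤ g) (hg0 : 0 ≤ g)
    (hw : ∀ f, f ≠ y → w f = v f) (hy : w y ≤ v y) : spreadOf v ≤ spreadOf w + (v y - w y) + 2 * g := by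
  fin_cases y <;> fin_cases z <;> simp only [spreadOf, Fin.zero_eta, Fin.mk_one, Fin.isValue, Fin.reduceFinMk, ne_eq] at *
  · simp at hzy
  · have e1 := hw 1 (by decide); have e2 := hw 2 (by decide); have e3 := hw 3 (by decide)
    have t1 := absPair_lower_gap (v 0) (w 0) (v 1) g hy hg hg0; have t2 := absPair_lower_le (v 0) (w 0) (v 2) hy; have t3 := absPair_lower_le (v 0) (w 0) (v 3) hy
    rw [e1, e2, e3]; omega
  · have e1 := hw 1 (by decide); have e2 := hw 2 (by decide); have e3 := hw 3 (by decide)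
    have t1 := absPair_lower_le (v 0) (w 0) (v 1) hy; have t2 := absPair_lower_gap (v 0) (w 0) (v 2) g hy hg hg0; have t3 := absPair_lower_le (v 0) (w 0) (v 3) hy
    rw [e1, e2, e3]; omega
  · have e1 := hw 1 (by decide); have e2 := hw 2 (by decide); have e3 := hw 3 (by decide)
    have t1 := absPair_lower_le (v 0) (w 0) (v 1) hy; have t2 := absPair_lower_le (v 0) (w 0) (v 2) hy; have t3 := absPair_lower_gap (v 0) (w 0) (v 3) g hy hg hg0
    rw [e1, e2, e3]; omega
  · have e0 := hw 0 (by decide); have e2 := hw 2 (by decide); have e3 := hw 3 (by decide)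
    have t0 := absPair_lower_gap' (v 1) (w 1) (v 0) g hy hg hg0; have t2 := absPair_lower_le (v 1) (w 1) (v 2) hy; have t3 := absPair_lower_le (v 1) (w 1) (v 3) hy
    rw [e0, e2, e3]; omega
  · simp at hzy
  · have e0 := hw 0 (by decide); have e2 := hw 2 (by decide); have e3 := hw 3 (by decide)
    have t0 := absPair_lower_le' (v 1) (w 1) (v 0) hy; have t2 := absPair_lower_gap (v 1) (w 1) (v 2) g hy hg hg0; have t3 := absPair_lower_le (v 1) (w 1) (v 3) hy
    rw [e0, e2, e3]; omega
  · have e0 := hw 0 (by decide); have e2 := hw 2 (by decide); have e3 := hw 3 (by decide)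
    have t0 := absPair_lower_le' (v 1) (w 1) (v 0) hy; have t2 := absPair_lower_le (v 1) (w 1) (v 2) hy; have t3 := absPair_lower_gap (v 1) (w 1) (v 3) g hy hg hg0
    rw [e0, e2, e3]; omega
  · have e0 := hw 0 (by decide); have e1 := hw 1 (by decide); have e3 := hw 3 (by decide)
    have t0 := absPair_lower_gap' (v 2) (w 2) (v 0) g hy hg hg0; have t1 := absPair_lower_le' (v 2) (w 2) (v 1) hy; have t3 := absPair_lower_le (v 2) (w 2) (v 3) hy
    rw [e0, e1, e3]; omega
  · have e0 := hw 0 (by decide); have e1 := hw 1 (by decide); have e3 := hw 3 (by decide)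
    have t0 := absPair_lower_le' (v 2) (w 2) (v 0) hy; have t1 := absPair_lower_gap' (v 2) (w 2) (v 1) g hy hg hg0; have t3 := absPair_lower_le (v 2) (w 2) (v 3) hy
    rw [e0, e1, e3]; omega
  · simp at hzy
  · have e0 := hw 0 (by decide); have e1 := hw 1 (by decide); have e3 := hw 3 (by decide)
    have t0 := absPair_lower_le' (v 2) (w 2) (v 0) hy; have t1 := absPair_lower_le' (v 2) (w 2) (v 1) hy; have t3 := absPair_lower_gap (v 2) (w 2) (v 3) g hy hg hg0
    rw [e0, e1, e3]; omega
  · have e0 := hw 0 (by decide); have e1 := hw 1 (by decide); have e2 := hw 2 (by decide)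
    have t0 := absPair_lower_gap' (v 3) (w 3) (v 0) g hy hg hg0; have t1 := absPair_lower_le' (v 3) (w 3) (v 1) hy; have t2 := absPair_lower_le' (v 3) (w 3) (v 2) hy
    rw [e0, e1, e2]; omega
  · have e0 := hw 0 (by decide); have e1 := hw 1 (by decide); have e2 := hw 2 (by decide)
    have t0 := absPair_lower_le' (v 3) (w 3) (v 0) hy; have t1 := absPair_lower_gap' (v 3) (w 3) (v 1) g hy hg hg0; have t2 := absPair_lower_le' (v 3) (w 3) (v 2) hy
    rw [e0, e1, e2]; omega
  · have e0 := hw 0 (by decide); have e1 := hw 1 (by decide); have e2 := hw 2 (by decide)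
    have t0 := absPair_lower_le' (v 3) (w 3) (v 0) hy; have t1 := absPair_lower_le' (v 3) (w 3) (v 1) hy; have t2 := absPair_lower_gap' (v 3) (w 3) (v 2) g hy hg hg0
    rw [e0, e1, e2]; omega
  · simp at hzy

/-! ### §9b RULE (A1) below an `N`-cell: the (top, node) clause at a top-minimal letter that is not thin-high -/

/-- **RULE (A1) BELOW** (KERNEL, law-free, every `h`; it contains `ruleA0_N`).  A four-charged `K_N`-cell `Z ∈ C.lower`, a TOP-MINIMAL letter `w`
which is NOT THIN-HIGH — witnessed by a letter `z ≠ w` with `n_w − n_z < t_w − n_w` (automatic unless `w` is the unique node-maximum) — and a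
node-minimal letter `x ≠ w`: RULE D at (top of `w`, node of `x`) is served by a `P ∈ C.upper` of class `K_P` which is apex-bearing (`w` at its apex)
or four-charged with `G(P) ≥ G(Z) + 2` (descent `τ` and drop `δ`: `ΔG = 2τ + 4δ`; overshoot: `ΔG ≥ 2(t_w − n_w) − 2(n_w − n_z)⁺ + 2δ ≥ 2`), hence
`Θ_h(P) > Θ_h(Z)` (`theta_lt_of_gKey_lt`).  So `Z` is absent once the apex-bearing `K`-cells and the four-charged `K`-cells of larger Θ_h are. -/
theorem ruleA1_N_Θ {h : ℤ} {C : MConfig} (hU : C.InDiamond h) {Z : MCell} (hZ : Z ∈ C.lower) (hD : RuleDMu4N C Z) (h4 : FourCharged Z) (hK : KN Z)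
    {w x z : Fin 4} (hwx : w ≠ x) (hzw : z ≠ w) (hwt : ∀ g, causalTop (Z w) ≤ causalTop (Z g)) (hxn : ∀ g, nodeLevel (Z x) ≤ nodeLevel (Z g))
    (hz : nodeLevel (Z w) - nodeLevel (Z z) < causalTop (Z w) - nodeLevel (Z w))
    (hA : InterfaceKAbsent C) (hIH : FourChargedKAbsentAboveW (2 * h + 1) (4 * h + 1) C (phiW (2 * h + 1) (4 * h + 1) Z)) : False := by
  -- parity: a level `K_N`-cell has its node-minimum `x` at node `≤ 6`
  have hlev : ¬ LevelCell Z ∨ nodeLevel (Z x) ≤ 6 := by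
    rcases hK with ⟨-, hnl⟩ | ⟨-, f, -, hfn⟩
    · exact Or.inl hnl
    · right
      rw [chargeCount_eq_four h4] at hfn; push_cast at hfn
      have := hxn f
      have hpar : nodeLevel (Z x) % 2 = 0 := (hU.1 Z hZ x).2.2.1
      omega
  have hcw : 0 < absCharge (Z w) := absCharge_pos_of_not_isApex (hU.1 Z hZ w).1 (not_isApex_of_snd_ne (h4 w))
  have h2w := two_mul_absCharge (Z w)
  have hne : causalTop (Z w) ≠ nodeLevel (Z x) := by have := hxn w; omega
  obtain ⟨P, hP, hag, how, hox, hmv⟩ := edge_tn_outcomes hU hZ hD hwx (h4 w) hne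
  have hPg : ∀ g, g ≠ w → g ≠ x → P g = Z g := fun g h1 h2 => hag g h1 h2
  have hPx : causalTop (P x) = causalTop (Z x) ∧ nodeLevel (P x) ≤ nodeLevel (Z x) ∧ (P x).2 ≠ (0, 0) ∧ (P x ≠ Z x → nodeLevel (P x) < nodeLevel (Z x)) := by
    rcases hox with e | ⟨hc, ht, hn⟩
    · rw [e]; exact ⟨rfl, le_rfl, h4 x, fun hne' => (hne' rfl).elim⟩
    · exact ⟨ht, hn.le, hc, fun _ => hn⟩
  have hPw : causalTop (P w) ≤ causalTop (Z w) ∧ nodeLevel (P w) ≤ nodeLevel (Z w) ∧ (P w ≠ Z w → causalTop (P w) < causalTop (Z w)) := by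
    rcases how with e | ⟨hn, ht⟩ | ⟨-, ht, hn⟩
    · rw [e]; exact ⟨le_rfl, le_rfl, fun hne' => (hne' rfl).elim⟩
    · exact ⟨ht.le, hn.le, fun _ => ht⟩
    · refine ⟨by rw [ht]; omega, hn.le, fun _ => by rw [ht]; omega⟩
  have h3P : 3 ≤ chargeCount P := chargeCount_ge_three fun f hfw => by
    by_cases hfx : f = x
    · rw [hfx]; exact hPx.2.2.1
    · rw [hPg f hfw hfx]; exact h4 f
  -- class `K_P`
  have hKP : KP P := by
    by_cases hmw : P w = Z w
    · have htops : ∀ f, causalTop (P f) = causalTop (Z f) := fun f => by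
        by_cases hfw : f = w
        · rw [hfw, hmw]
        by_cases hfx : f = x
        · rw [hfx]; exact hPx.1
        · rw [hPg f hfw hfx]
      have hlvl := levelCell_iff_of_tops htops
      rcases hlev with hnl | hx6
      · exact Or.inl ⟨h3P, fun hl => hnl (hlvl.1 hl)⟩
      · by_cases hl : LevelCell Z
        · have h4P : FourCharged P := fun f => by
            by_cases hfw : f = w
            · rw [hfw, hmw]; exact h4 w
            by_cases hfx : f = x
            · rw [hfx]; exact hPx.2.2.1
            · rw [hPg f hfw hfx]; exact h4 f
          have hcc := chargeCount_eq_four h4P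
          have hdx : nodeLevel (P x) < nodeLevel (Z x) := hPx.2.2.2 (hmv.elim (fun hne' => (hne' hmw).elim) id)
          have hparP : nodeLevel (P x) % 2 = 0 := (hU.2 P hP x).2.2.1
          have hparZ : nodeLevel (Z x) % 2 = 0 := (hU.1 Z hZ x).2.2.1
          right; right; refine ⟨hlvl.2 hl, x, hPx.2.2.1, ?_⟩; rw [hcc]; push_cast; omega
        · exact Or.inl ⟨h3P, fun hl' => hl (hlvl.1 hl')⟩
    · refine Or.inl ⟨h3P, fun hl => ?_⟩
      have e := hl x w
      rw [hPx.1] at e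
      have := hwt x; have := hPw.2.2 hmw; omega
  -- apex-bearing outcome: absent by (A₃)
  by_cases haw : (P w).2 = (0, 0)
  · refine hA.2 P hP hKP ⟨w, haw, fun g hg => ?_⟩
    have hcw : 0 < absCharge (Z w) := absCharge_pos_of_not_isApex (hU.1 Z hZ w).1 (not_isApex_of_snd_ne (h4 w))
    have h2w := two_mul_absCharge (Z w)
    have hw1 := hPw.2.1; have hwg := hwt g
    by_cases hgx : g = x
    · rw [hgx]; exact ⟨hPx.2.2.1, by rw [hPx.1]; have := hwt x; omega⟩
    · rw [hPg g hg hgx]; exact ⟨h4 g, by omega⟩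
  have h4P : FourCharged P := fun f => by
    by_cases hfw : f = w
    · rw [hfw]; exact haw
    by_cases hfx : f = x
    · rw [hfx]; exact hPx.2.2.1
    · rw [hPg f hfw hfx]; exact h4 f
  -- tops: only `w` moves, and it is the minimum: `+3τ` exactly
  have ht1 : spreadOf (fun f => causalTop (P f)) = spreadOf (fun f => causalTop (Z f)) + 3 * (causalTop (Z w) - causalTop (P w)) := by
    refine spreadOf_lower_min (v := fun f => causalTop (Z f)) (w := fun f => causalTop (P f)) (y := w) (fun g => hwt g) ?_ hPw.1
    intro g hg; show causalTop (P g) = causalTop (Z g)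
    by_cases hgx : g = x
    · rw [hgx]; exact hPx.1
    · rw [hPg g hg hgx]
  -- charges
  have hQ : sum4 (fun f => absCharge (P f)) = sum4 (fun f => absCharge (Z f)) + (absCharge (P w) - absCharge (Z w)) + (absCharge (P x) - absCharge (Z x)) :=
    sum4_two_slots hwx fun f h1 h2 => by simp [hPg f h1 h2]
  have h2Pw := two_mul_absCharge (P w); have h2Px := two_mul_absCharge (P x); have h2Zx := two_mul_absCharge (Z x)
  have hQ2 : 2 * chargeSum P = 2 * chargeSum Z + ((causalTop (P w) - nodeLevel (P w)) - (causalTop (Z w) - nodeLevel (Z w)))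
      + (nodeLevel (Z x) - nodeLevel (P x)) := by
    rw [chargeSum_eq_sum4, chargeSum_eq_sum4, hQ]; have := hPx.1; omega
  -- nodes, via the intermediate vector in which only `w` has moved
  let m : Fin 4 → ℤ := fun f => if f = w then nodeLevel (P w) else nodeLevel (Z f)
  have hmw' : m w = nodeLevel (P w) := by simp [m]
  have hmg : ∀ g, g ≠ w → m g = nodeLevel (Z g) := fun g hg => by simp [m, hg]
  -- `w` lowered with the witness `z`: the loss is at most `d + 2(t_w − n_w − 1)`
  have hn1 : spreadOf (fun f => nodeLevel (Z f)) ≤ spreadOf m + (nodeLevel (Z w) - m w) + 2 * (causalTop (Z w) - nodeLevel (Z w) - 1) := by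
    refine spreadOf_lower_gap (v := fun f => nodeLevel (Z f)) (w := m) (y := w) (z := z) hzw ?_ ?_ (fun g hg => hmg g hg) ?_
    · show nodeLevel (Z w) - nodeLevel (Z z) ≤ causalTop (Z w) - nodeLevel (Z w) - 1; omega
    · omega
    · show m w ≤ nodeLevel (Z w); rw [hmw']; exact hPw.2.1
  -- then `x` lowered, with at most one entry (`w`) strictly below it: `≥ +δ`
  have hn2 : spreadOf m + (m x - nodeLevel (P x)) ≤ spreadOf (fun f => nodeLevel (P f)) := by
    refine spreadOf_lower_second (v := m) (w := fun f => nodeLevel (P f)) (y := x) (u := w) ?_ ?_ ?_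
    · intro g hg; show m x ≤ m g; rw [hmg x (Ne.symm hwx), hmg g hg]; exact hxn g
    · intro g hg; show nodeLevel (P g) = m g
      by_cases hgw : g = w
      · rw [hgw, hmw']
      · rw [hmg g hgw, hPg g hgw hg]
    · show nodeLevel (P x) ≤ m x; rw [hmg x (Ne.symm hwx)]; exact hPx.2.1
  rw [hmw'] at hn1; rw [hmg x (Ne.symm hwx)] at hn2
  -- `G` rises by at least 2
  have hG : gKey Z + 2 ≤ gKey P := by
    have hδ := hPx.2.1
    rcases how with e | ⟨hn, ht⟩ | ⟨-, ht, hn⟩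
    · -- only `x` dropped, by `δ > 0`: nodes `+3δ` exactly
      have hdx : nodeLevel (P x) < nodeLevel (Z x) := hPx.2.2.2 (hmv.elim (fun hne' => (hne' e).elim) id)
      have hn0 : spreadOf (fun f => nodeLevel (P f)) = spreadOf (fun f => nodeLevel (Z f)) + 3 * (nodeLevel (Z x) - nodeLevel (P x)) := by
        refine spreadOf_lower_min (v := fun f => nodeLevel (Z f)) (w := fun f => nodeLevel (P f)) (y := x) (fun g => hxn g) ?_ hPx.2.1
        intro g hg; show nodeLevel (P g) = nodeLevel (Z g)
        by_cases hgw : g = w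
        · rw [hgw, e]
        · rw [hPg g hgw hg]
      rw [e] at ht1 hQ2
      unfold gKey pairSpread; omega
    · -- a descent `τ > 0` of `w` (node kept) and a drop `δ ≥ 0` of `x`: `ΔG = 2τ + 4δ`
      have hn0 : spreadOf (fun f => nodeLevel (P f)) = spreadOf (fun f => nodeLevel (Z f)) + 3 * (nodeLevel (Z x) - nodeLevel (P x)) := by
        refine spreadOf_lower_min (v := fun f => nodeLevel (Z f)) (w := fun f => nodeLevel (P f)) (y := x) (fun g => hxn g) ?_ hPx.2.1
        intro g hg; show nodeLevel (P g) = nodeLevel (Z g)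
        by_cases hgw : g = w
        · rw [hgw, hn]
        · rw [hPg g hgw hg]
      unfold gKey pairSpread; omega
    · -- the overshoot: `t(P w) = n(Z w)`, `n(P w) < n(Z w)`; `ΔG ≥ 2 + 2δ`
      unfold gKey pairSpread; omega
  exact hIH.2 P hP hKP h4P (theta_lt_of_gKey_lt (hU.2 P hP) (by omega))

/-! ### §9c RULE (A2) below an `N`-cell: the runner-up top `s` of a unique, thin-high top-minimum `u` -/

/-- three letters of `Fin 4` always leave a fourth. -/
theorem fin4_exists_ne₃ (a b c : Fin 4) : ∃ g : Fin 4, g ≠ a ∧ g ≠ b ∧ g ≠ c := by revert a b c; decide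

/-- **RULE (A2) BELOW** (KERNEL, law-free, every `h`).  A four-charged `N`-cell `Z ∈ C.lower` whose top-minimum `u` is UNIQUE; a letter `s ≠ u` of the
second causal top with `n_s < t_u` which is not the unique node-maximum (a letter `z ≠ s` with `n_s ≤ n_z`) — automatic when `u` is thin-high —
and a node-minimal letter `x ≠ s`: RULE D at (top of `s`, node of `x`) is served by a `P ∈ C.upper` of class `K_P` (never level: `u` and a third
letter keep their different tops) which is apex-bearing or four-charged with `Θ_h(P) > Θ_h(Z)`: a pure descent of `s` keeps `G` and LOWERS `Q` (the
`λ = 2` ties, broken by Θ: `theta_lt_of_gKey_le`), every other outcome raises `G` (`4δ`, resp. `≥ 2(t_u − n_s) + 2δ` through the overshoot, where the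
top of `s` first meets `t_u` (`+τ₁`) and then passes below the minimum (`+3τ₂`)). -/
theorem ruleA2_N_Θ {h : ℤ} {C : MConfig} (hU : C.InDiamond h) {Z : MCell} (hZ : Z ∈ C.lower) (hD : RuleDMu4N C Z) (h4 : FourCharged Z)
    {u s x z : Fin 4} (hsu : s ≠ u) (hxs : x ≠ s) (hzs : z ≠ s)
    (hu : ∀ g, g ≠ u → causalTop (Z u) < causalTop (Z g)) (hs : ∀ g, g ≠ u → causalTop (Z s) ≤ causalTop (Z g))
    (hns : nodeLevel (Z s) < causalTop (Z u)) (hz : nodeLevel (Z s) ≤ nodeLevel (Z z)) (hxn : ∀ g, nodeLevel (Z x) ≤ nodeLevel (Z g))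
    (hA : InterfaceKAbsent C) (hIH : FourChargedKAbsentAboveW (2 * h + 1) (4 * h + 1) C (phiW (2 * h + 1) (4 * h + 1) Z)) : False := by
  have hcs : 0 < absCharge (Z s) := absCharge_pos_of_not_isApex (hU.1 Z hZ s).1 (not_isApex_of_snd_ne (h4 s))
  have h2s := two_mul_absCharge (Z s)
  have hus : causalTop (Z u) < causalTop (Z s) := hu s hsu
  have hne : causalTop (Z s) ≠ nodeLevel (Z x) := by have := hxn s; omega
  obtain ⟨P, hP, hag, how, hox, hmv⟩ := edge_tn_outcomes hU hZ hD (Ne.symm hxs) (h4 s) hne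
  have hPg : ∀ g, g ≠ s → g ≠ x → P g = Z g := fun g h1 h2 => hag g h1 h2
  have hPx : causalTop (P x) = causalTop (Z x) ∧ nodeLevel (P x) ≤ nodeLevel (Z x) ∧ (P x).2 ≠ (0, 0) ∧ (P x ≠ Z x → nodeLevel (P x) < nodeLevel (Z x)) := by
    rcases hox with e | ⟨hc, ht, hn⟩
    · rw [e]; exact ⟨rfl, le_rfl, h4 x, fun hne' => (hne' rfl).elim⟩
    · exact ⟨ht, hn.le, hc, fun _ => hn⟩
  have hPs : causalTop (P s) ≤ causalTop (Z s) ∧ nodeLevel (P s) ≤ nodeLevel (Z s) ∧ (P s ≠ Z s → causalTop (P s) < causalTop (Z s)) := by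
    rcases how with e | ⟨hn, ht⟩ | ⟨-, ht, hn⟩
    · rw [e]; exact ⟨le_rfl, le_rfl, fun hne' => (hne' rfl).elim⟩
    · exact ⟨ht.le, hn.le, fun _ => ht⟩
    · refine ⟨by rw [ht]; omega, hn.le, fun _ => by rw [ht]; omega⟩
  have h3P : 3 ≤ chargeCount P := chargeCount_ge_three fun f hfs => by
    by_cases hfx : f = x
    · rw [hfx]; exact hPx.2.2.1
    · rw [hPg f hfs hfx]; exact h4 f
  -- `u` keeps its top, and a third letter keeps its larger top: `P` is not level, so it is of class `K_P`
  have htu : causalTop (P u) = causalTop (Z u) := by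
    by_cases hux : u = x
    · rw [hux]; exact hPx.1
    · rw [hPg u (Ne.symm hsu) hux]
  obtain ⟨g₀, hg₀s, hg₀u, hg₀x⟩ := fin4_exists_ne₃ s u x
  have hnl : ¬ LevelCell P := fun hl => by
    have e := hl g₀ u
    rw [hPg g₀ hg₀s hg₀x, htu] at e
    have := hu g₀ hg₀u; omega
  have hKP : KP P := Or.inl ⟨h3P, hnl⟩
  -- apex-bearing outcome: absent by (A₃)
  by_cases has : (P s).2 = (0, 0)
  · refine hA.2 P hP hKP ⟨s, has, fun g hg => ?_⟩
    have h2s := two_mul_absCharge (Z s)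
    have hs1 := hPs.2.1
    have hsg : nodeLevel (Z s) < causalTop (Z g) := by
      by_cases hgu : g = u
      · rw [hgu]; exact hns
      · have := hs g hgu; omega
    by_cases hgx : g = x
    · subst hgx; exact ⟨hPx.2.2.1, by rw [hPx.1]; omega⟩
    · rw [hPg g hg hgx]; exact ⟨h4 g, by omega⟩
  have h4P : FourCharged P := fun f => by
    by_cases hfs : f = s
    · rw [hfs]; exact has
    by_cases hfx : f = x
    · rw [hfx]; exact hPx.2.2.1
    · rw [hPg f hfs hfx]; exact h4 f
  -- charges
  have hQ : sum4 (fun f => absCharge (P f)) = sum4 (fun f => absCharge (Z f)) + (absCharge (P s) - absCharge (Z s)) + (absCharge (P x) - absCharge (Z x)) :=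
    sum4_two_slots (Ne.symm hxs) fun f h1 h2 => by simp [hPg f h1 h2]
  have h2Ps := two_mul_absCharge (P s); have h2Px := two_mul_absCharge (P x); have h2Zx := two_mul_absCharge (Z x)
  have hQ2 : 2 * chargeSum P = 2 * chargeSum Z + ((causalTop (P s) - nodeLevel (P s)) - (causalTop (Z s) - nodeLevel (Z s)))
      + (nodeLevel (Z x) - nodeLevel (P x)) := by
    rw [chargeSum_eq_sum4, chargeSum_eq_sum4, hQ]; have := hPx.1; omega
  -- tops, one stage: only `u` lies strictly below `s`: `≥ +τ`
  have ht1 : spreadOf (fun f => causalTop (Z f)) + (causalTop (Z s) - causalTop (P s)) ≤ spreadOf (fun f => causalTop (P f)) := by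
    refine spreadOf_lower_second (v := fun f => causalTop (Z f)) (w := fun f => causalTop (P f)) (y := s) (u := u) (fun g hg => hs g hg) ?_ hPs.1
    intro g hg; show causalTop (P g) = causalTop (Z g)
    by_cases hgx : g = x
    · rw [hgx]; exact hPx.1
    · rw [hPg g hg hgx]
  have h0 : 0 ≤ h := by have := chargeSum_le (hU.2 P hP); have := chargeSum_nonneg P; omega
  have hδ := hPx.2.1
  have hlt : phiW (2 * h + 1) (4 * h + 1) Z < phiW (2 * h + 1) (4 * h + 1) P := by
    rcases how with e | ⟨hn, ht⟩ | ⟨-, ht, hn⟩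
    · -- only `x` dropped, by `δ > 0`: nodes `+3δ`, `ΔG = 4δ`
      have hdx : nodeLevel (P x) < nodeLevel (Z x) := hPx.2.2.2 (hmv.elim (fun hne' => (hne' e).elim) id)
      have hn0 : spreadOf (fun f => nodeLevel (P f)) = spreadOf (fun f => nodeLevel (Z f)) + 3 * (nodeLevel (Z x) - nodeLevel (P x)) := by
        refine spreadOf_lower_min (v := fun f => nodeLevel (Z f)) (w := fun f => nodeLevel (P f)) (y := x) (fun g => hxn g) ?_ hPx.2.1
        intro g hg; show nodeLevel (P g) = nodeLevel (Z g)
        by_cases hgs : g = s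
        · rw [hgs, e]
        · rw [hPg g hgs hg]
      rw [e] at ht1 hQ2
      exact theta_lt_of_gKey_lt (hU.2 P hP) (by unfold gKey pairSpread; omega)
    · -- a descent `τ > 0` of `s` (node kept) and a drop `δ ≥ 0` of `x`: `ΔG = 4δ`, and for `δ = 0` the charge sum falls
      have hn0 : spreadOf (fun f => nodeLevel (P f)) = spreadOf (fun f => nodeLevel (Z f)) + 3 * (nodeLevel (Z x) - nodeLevel (P x)) := by
        refine spreadOf_lower_min (v := fun f => nodeLevel (Z f)) (w := fun f => nodeLevel (P f)) (y := x) (fun g => hxn g) ?_ hPx.2.1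
        intro g hg; show nodeLevel (P g) = nodeLevel (Z g)
        by_cases hgs : g = s
        · rw [hgs, hn]
        · rw [hPg g hgs hg]
      by_cases hdx : nodeLevel (P x) = nodeLevel (Z x)
      · exact theta_lt_of_gKey_le h0 (by unfold gKey pairSpread; omega) (by omega)
      · exact theta_lt_of_gKey_lt (hU.2 P hP) (by unfold gKey pairSpread; omega)
    · -- the overshoot: `t(P s) = n(Z s) < t(Z u)`; tops in two stages (`+τ₁`, then `+3τ₂` below the minimum `u`), nodes with the gap-0 witness `z`
      let m₁ : Fin 4 → ℤ := fun f => if f = s then causalTop (Z u) else causalTop (Z f)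
      have hm₁s : m₁ s = causalTop (Z u) := by simp [m₁]
      have hm₁g : ∀ g, g ≠ s → m₁ g = causalTop (Z g) := fun g hg => by simp [m₁, hg]
      have hA1 : spreadOf (fun f => causalTop (Z f)) + (causalTop (Z s) - m₁ s) ≤ spreadOf m₁ := by
        refine spreadOf_lower_second (v := fun f => causalTop (Z f)) (w := m₁) (y := s) (u := u) (fun g hg => hs g hg) (fun g hg => hm₁g g hg) ?_
        show m₁ s ≤ causalTop (Z s); rw [hm₁s]; exact hus.le
      have hA2 : spreadOf (fun f => causalTop (P f)) = spreadOf m₁ + 3 * (m₁ s - causalTop (P s)) := by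
        refine spreadOf_lower_min (v := m₁) (w := fun f => causalTop (P f)) (y := s) ?_ ?_ ?_
        · intro g
          rcases eq_or_ne g s with rfl | hgs
          · exact le_rfl
          · rw [hm₁g g hgs, hm₁s]
            rcases eq_or_ne g u with rfl | hgu
            · exact le_rfl
            · exact (hu g hgu).le
        · intro g hg; show causalTop (P g) = m₁ g
          rw [hm₁g g hg]
          by_cases hgx : g = x
          · rw [hgx]; exact hPx.1
          · rw [hPg g hg hgx]
        · show causalTop (P s) ≤ m₁ s; rw [hm₁s, ht]; exact hns.le
      rw [hm₁s] at hA1 hA2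
      let m₂ : Fin 4 → ℤ := fun f => if f = s then nodeLevel (P s) else nodeLevel (Z f)
      have hm₂s : m₂ s = nodeLevel (P s) := by simp [m₂]
      have hm₂g : ∀ g, g ≠ s → m₂ g = nodeLevel (Z g) := fun g hg => by simp [m₂, hg]
      have hB1 : spreadOf (fun f => nodeLevel (Z f)) ≤ spreadOf m₂ + (nodeLevel (Z s) - m₂ s) + 2 * 0 := by
        refine spreadOf_lower_gap (v := fun f => nodeLevel (Z f)) (w := m₂) (y := s) (z := z) hzs ?_ le_rfl (fun g hg => hm₂g g hg) ?_
        · show nodeLevel (Z s) - nodeLevel (Z z) ≤ 0; omega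
        · show m₂ s ≤ nodeLevel (Z s); rw [hm₂s]; exact hn.le
      have hB2 : spreadOf m₂ + (m₂ x - nodeLevel (P x)) ≤ spreadOf (fun f => nodeLevel (P f)) := by
        refine spreadOf_lower_second (v := m₂) (w := fun f => nodeLevel (P f)) (y := x) (u := s) ?_ ?_ ?_
        · intro g hg; show m₂ x ≤ m₂ g; rw [hm₂g x hxs, hm₂g g hg]; exact hxn g
        · intro g hg; show nodeLevel (P g) = m₂ g
          by_cases hgs : g = s
          · rw [hgs, hm₂s]
          · rw [hm₂g g hgs, hPg g hgs hg]
        · show nodeLevel (P x) ≤ m₂ x; rw [hm₂g x hxs]; exact hPx.2.1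
      rw [hm₂s] at hB1; rw [hm₂g x hxs] at hB2
      exact theta_lt_of_gKey_lt (hU.2 P hP) (by unfold gKey pairSpread; omega)
  exact hIH.2 P hP hKP h4P hlt

/-! ### §9d COVERING: the `N`-half of the Θ-step is a theorem for every `h` -/

theorem exists_min4 (v : Fin 4 → ℤ) : ∃ y, ∀ g, v y ≤ v g := by
  obtain ⟨y, -, hy⟩ := Finset.exists_min_image Finset.univ v Finset.univ_nonempty
  exact ⟨y, fun g => hy g (Finset.mem_univ g)⟩

theorem exists_min_ne (v : Fin 4 → ℤ) (y : Fin 4) : ∃ z, z ≠ y ∧ ∀ g, g ≠ y → v z ≤ v g := by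
  have h1 : y + 1 ≠ y := by revert y; decide
  obtain ⟨z, hz, hmin⟩ := Finset.exists_min_image (Finset.univ.erase y) v ⟨y + 1, Finset.mem_erase.2 ⟨h1, Finset.mem_univ _⟩⟩
  exact ⟨z, (Finset.mem_erase.1 hz).1, fun g hg => hmin g (Finset.mem_erase.2 ⟨hg, Finset.mem_univ _⟩)⟩

/-- a node-minimal letter other than `w` — unless `w` is the unique node-minimum. -/
theorem exists_nodeMin_ne (Z : MCell) (w : Fin 4) (hw : ¬ ∀ g, g ≠ w → nodeLevel (Z w) < nodeLevel (Z g)) :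
    ∃ x, x ≠ w ∧ ∀ g, nodeLevel (Z x) ≤ nodeLevel (Z g) := by
  simp only [not_forall, not_lt] at hw
  obtain ⟨g, hgw, hg⟩ := hw
  obtain ⟨x, hx⟩ := exists_min4 fun f => nodeLevel (Z f)
  have hx' : ∀ f, nodeLevel (Z x) ≤ nodeLevel (Z f) := hx
  by_cases hxw : x = w
  · subst hxw; exact ⟨g, hgw, fun f => le_trans hg (hx' f)⟩
  · exact ⟨x, hxw, hx'⟩

/-- **THE `N`-HALF OF THE Θ-STEP** (KERNEL, law-free, EVERY `h`): in a RULE-D-closed `◇_h` configuration without apex-bearing `K`-cells, a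
four-charged `K_N`-cell `Z` is absent as soon as the four-charged `K`-cells of larger `Θ_h` are.  DECISION LIST (the Θ-rulebook): LEVEL ⇒ (A1) at a
second node-minimal letter (witness: a third letter); else take a top-minimal `u`: `u` the unique node-minimum ⇒ (B); `u` not thin-high ⇒ (A1) at `u`;
`u` thin-high and tied ⇒ the tied letter gets (B) or (A1) (witness `u`); `u` thin-high and unique ⇒ its runner-up `s` gets (B) (unique node-minimum)
or (A2). -/
theorem thetaStep_N {h : ℤ} {C : MConfig} (hU : C.InDiamond h) (hD : RuleDMu4Closed C) (hA : InterfaceKAbsent C) {Z : MCell} (hZ : Z ∈ C.lower)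
    (hK : KN Z) (h4 : FourCharged Z) (hIH : FourChargedKAbsentAboveW (2 * h + 1) (4 * h + 1) C (phiW (2 * h + 1) (4 * h + 1) Z)) : False := by
  have hDZ : RuleDMu4N C Z := hD.1 Z hZ
  have h0 : 0 ≤ h := by have := chargeSum_le (hU.1 Z hZ); have := chargeSum_nonneg Z; omega
  have ha : (0 : ℤ) < 2 * h + 1 := by omega
  have hb : (0 : ℤ) ≤ 4 * h + 1 := by omega
  have hch : ∀ f, 0 < absCharge (Z f) := fun f => absCharge_pos_of_not_isApex (hU.1 Z hZ f).1 (not_isApex_of_snd_ne (h4 f))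
  -- rule (B) at a unique node-minimum `y`, outside the level∕`n_y = 6` exception
  have ruleB : ∀ y, (∀ g, g ≠ y → nodeLevel (Z y) < nodeLevel (Z g)) → (¬ LevelCell Z ∨ nodeLevel (Z y) ≤ 4) → False := by
    intro y hy hlev
    obtain ⟨z, hzy, hz⟩ := exists_min_ne (fun f => nodeLevel (Z f)) y
    exact ruleB_N_W ha hb hU hZ hDZ h4 (Ne.symm hzy) hy hz (hlev.imp id Or.inl) hIH
  by_cases hl : LevelCell Z
  · -- LEVEL: `y` node-minimal, `w ≠ y` node-minimal among the rest, witness a third letter `z`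
    obtain ⟨y, hy⟩ := exists_min4 fun f => nodeLevel (Z f)
    have hy' : ∀ g, nodeLevel (Z y) ≤ nodeLevel (Z g) := hy
    obtain ⟨w, hwy, hw⟩ := exists_min_ne (fun f => nodeLevel (Z f)) y
    have hw' : ∀ g, g ≠ y → nodeLevel (Z w) ≤ nodeLevel (Z g) := hw
    obtain ⟨z, hzy, hzw, -⟩ := fin4_exists_ne₃ y w w
    refine ruleA1_N_Θ hU hZ hDZ h4 hK (w := w) (x := y) (z := z) hwy hzw (fun g => (hl w g).le) hy' ?_ hA hIH
    have := hw' z hzy; have := hch w; have := two_mul_absCharge (Z w); omega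
  -- NON-LEVEL: a top-minimal letter `u`
  obtain ⟨u, hu⟩ := exists_min4 fun f => causalTop (Z f)
  have hut : ∀ g, causalTop (Z u) ≤ causalTop (Z g) := hu
  by_cases hun : ∀ g, g ≠ u → nodeLevel (Z u) < nodeLevel (Z g)
  · exact ruleB u hun (Or.inl hl)
  obtain ⟨x, hxu, hxn⟩ := exists_nodeMin_ne Z u hun
  by_cases hth : ∃ z, z ≠ u ∧ nodeLevel (Z u) - nodeLevel (Z z) < causalTop (Z u) - nodeLevel (Z u)
  · obtain ⟨z, hzu, hz⟩ := hth
    exact ruleA1_N_Θ hU hZ hDZ h4 hK (Ne.symm hxu) hzu hut hxn hz hA hIH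
  -- `u` is THIN-HIGH: `t_u − n_u ≤ n_u − n_z` for every `z ≠ u` (so `u` is the unique node-maximum)
  have hth' : ∀ z, z ≠ u → causalTop (Z u) - nodeLevel (Z u) ≤ nodeLevel (Z u) - nodeLevel (Z z) := by
    intro z hz; by_contra hc; exact hth ⟨z, hz, by omega⟩
  have hcu := hch u; have h2u := two_mul_absCharge (Z u)
  by_cases htie : ∃ g, g ≠ u ∧ causalTop (Z g) = causalTop (Z u)
  · -- a tied top-minimal letter `g` (below `u` in node): (B) or (A1) at `g` with the witness `u`
    obtain ⟨g, hgu, hg⟩ := htie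
    by_cases hgn : ∀ f, f ≠ g → nodeLevel (Z g) < nodeLevel (Z f)
    · exact ruleB g hgn (Or.inl hl)
    obtain ⟨x', hx'g, hx'n⟩ := exists_nodeMin_ne Z g hgn
    refine ruleA1_N_Θ hU hZ hDZ h4 hK (Ne.symm hx'g) (Ne.symm hgu) (fun f => by rw [hg]; exact hut f) hx'n ?_ hA hIH
    have := hth' g hgu; have := hch g; have := two_mul_absCharge (Z g); omega
  -- `u` is the UNIQUE top-minimum: hand over to its runner-up `s`
  have hu1 : ∀ g, g ≠ u → causalTop (Z u) < causalTop (Z g) := fun g hg =>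
    lt_of_le_of_ne (hut g) fun e => htie ⟨g, hg, e.symm⟩
  obtain ⟨s, hsu, hs⟩ := exists_min_ne (fun f => causalTop (Z f)) u
  have hs' : ∀ g, g ≠ u → causalTop (Z s) ≤ causalTop (Z g) := hs
  by_cases hsn : ∀ f, f ≠ s → nodeLevel (Z s) < nodeLevel (Z f)
  · exact ruleB s hsn (Or.inl hl)
  obtain ⟨x', hx's, hx'n⟩ := exists_nodeMin_ne Z s hsn
  have := hth' s hsu
  exact ruleA2_N_Θ hU hZ hDZ h4 (u := u) (s := s) (x := x') (z := u) hsu hx's (Ne.symm hsu) hu1 hs' (by omega) (by omega) hx'n hA hIH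

/-- the `P`-HALF of the Θ-step at height `h` (OPEN — the dual rules (A1)ᴾ, with its proviso, and (A2)ᴾ are pen-checked and census-exact to `h = 34`,
not yet typed): a four-charged `K_P`-cell is absent as soon as the four-charged `K`-cells of larger `Θ_h` are. -/
def ThetaStepP (h : ℤ) : Prop :=
  ∀ C : MConfig, C.InDiamond h → RuleDMu4Closed C → ApexBearingKAbsent C → ∀ P ∈ C.upper, KP P → FourCharged P →
    FourChargedKAbsentAboveW (2 * h + 1) (4 * h + 1) C (phiW (2 * h + 1) (4 * h + 1) P) → False

/-- **REDUCTION** (KERNEL, every `h`): the Θ-step at height `h` follows from its `P`-half alone. -/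
theorem phiStepW_theta_of_P {h : ℤ} (hP : ThetaStepP h) : PhiStepW (2 * h + 1) (4 * h + 1) h := by
  intro C hU hD hA φ hIH
  refine ⟨fun Z hZ hK h4 he => ?_, fun P hP' hK h4 he => ?_⟩
  · subst he; exact thetaStep_N hU hD (interfaceKAbsent_of_apexBearingKAbsent hA) hZ hK h4 hIH
  · subst he; exact hP C hU hD hA P hP' hK h4 hIH

/-- KERNEL: the `P`-half of the Θ-step at a height `h ≥ 0` already empties the four-charged `K`-stratum of every RULE-D-closed `◇_h` configuration
without apex-bearing `K`-cells (both phases). -/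
theorem fourChargedK_absent_of_thetaStepP {h : ℤ} (h0 : 0 ≤ h) (hP : ThetaStepP h) {C : MConfig} (hU : C.InDiamond h) (hD : RuleDMu4Closed C)
    (hA : ApexBearingKAbsent C) : FourChargedKAbsent C :=
  fourChargedK_absent_of_phiStepW (by omega) (by omega) (phiStepW_theta_of_P hP) hU hD hA

/-! ### §9e The `P`-side: the dual rules (A1)ᴾ (with its proviso) and (A2)ᴾ, the covering `thetaStep_P` — `ThetaStepP h`, the Θ-step and the Θ-law are THEOREMS

Read through the `N`-view `(n, t) ↦ (h − t, h − n)` the rulebook of §9d becomes: `w` top-minimal ↦ `w` NODE-MAXIMAL, `x` node-minimal ↦ `x` TOP-MAXIMAL,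
a top descent of `w` ↦ a LIFT of `w` (node raised, top kept; possibly to the apex), an overshoot ↦ an UPWARD overshoot (node raised through the causal
top), a drop of `x` ↦ a top RAISE of `x`; the clause (top of `w`, node of `x`) ↦ (node of `w`, top of `x`) = `edge_nt_outcomes_P`.  `Ψ`, `Q`, hence `G`
and `Θ_h`, are invariant, so the rank arithmetic is that of §9d verbatim; only the class test differs (`K` is not self-dual): a LEVEL outcome
`N ∈ C.lower` must exhibit a charged letter of node `< 2·#charged`.  For (A1)ᴾ this is automatic unless the upward overshoot of `w` lands exactly on
a common causal top of the other three letters — the one PROVISO of the rulebook (then a letter other than `w` has node `< 8`, or `t_w < 8`); for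
(A2)ᴾ a level outcome forces `P` level (the witness `z` keeps a top `≤ t_s`) and `(K_P)` supplies the low letter.  The covering `thetaStep_P` serves a
proviso-failing head by (A2)ᴾ at the unique node-maximum or by (A1)ᴾ at a tied one (whose proviso is vacuous). -/

/-- raising an entry `y` by `d ≥ 0` lowers the spread by at most `d + 2g` whenever some other entry `z` has `v z − v y ≤ g`, `g ≥ 0` (the dual of
`spreadOf_lower_gap`). -/
theorem spreadOf_raise_gap {v w : Fin 4 → ℤ} {y z : Fin 4} {g : ℤ} (hzy : z ≠ y) (hg : v z - v y ≤ g) (hg0 : 0 ≤ g)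
    (hw : ∀ f, f ≠ y → w f = v f) (hy : v y ≤ w y) : spreadOf v ≤ spreadOf w + (w y - v y) + 2 * g := by
  have := spreadOf_lower_gap (v := fun f => -v f) (w := fun f => -w f) (y := y) (z := z) (g := g) hzy
    (by show -v y - -v z ≤ g; omega) hg0 (fun f hf => by show -w f = -v f; rw [hw f hf]) (by show -w y ≤ -v y; omega)
  rw [spreadOf_neg, spreadOf_neg] at this
  omega

theorem exists_max4 (v : Fin 4 → ℤ) : ∃ y, ∀ g, v g ≤ v y := by
  obtain ⟨y, -, hy⟩ := Finset.exists_max_image Finset.univ v Finset.univ_nonempty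
  exact ⟨y, fun g => hy g (Finset.mem_univ g)⟩

theorem exists_max_ne (v : Fin 4 → ℤ) (y : Fin 4) : ∃ z, z ≠ y ∧ ∀ g, g ≠ y → v g ≤ v z := by
  have h1 : y + 1 ≠ y := by revert y; decide
  obtain ⟨z, hz, hmax⟩ := Finset.exists_max_image (Finset.univ.erase y) v ⟨y + 1, Finset.mem_erase.2 ⟨h1, Finset.mem_univ _⟩⟩
  exact ⟨z, (Finset.mem_erase.1 hz).1, fun g hg => hmax g (Finset.mem_erase.2 ⟨hg, Finset.mem_univ _⟩)⟩

/-- a top-maximal letter other than `w` — unless `w` is the unique top-maximum. -/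
theorem exists_topMax_ne (P : MCell) (w : Fin 4) (hw : ¬ ∀ g, g ≠ w → causalTop (P g) < causalTop (P w)) :
    ∃ x, x ≠ w ∧ ∀ g, causalTop (P g) ≤ causalTop (P x) := by
  simp only [not_forall, not_lt] at hw
  obtain ⟨g, hgw, hg⟩ := hw
  obtain ⟨x, hx⟩ := exists_max4 fun f => causalTop (P f)
  have hx' : ∀ f, causalTop (P f) ≤ causalTop (P x) := hx
  by_cases hxw : x = w
  · subst hxw; exact ⟨g, hgw, fun f => le_trans (hx' f) hg⟩
  · exact ⟨x, hxw, hx'⟩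

/-- **RULE (A1) ABOVE** (KERNEL, `h` even, law-free): the dual of `ruleA1_N_Θ`, with the one PROVISO of the rulebook.  A four-charged `K_P`-cell
`P ∈ C.upper`, a NODE-MAXIMAL letter `w` with a witness `z ≠ w`, `t_z − t_w < t_w − n_w` (not thin-high, read dually), a top-maximal `x ≠ w`, and
the proviso «if the three letters other than `w` have a common causal top above `t_w`, one of them has node `< 8` or `t_w < 8`»: RULE D at (node of `w`,
top of `x`) is served by an `N ∈ C.lower` of class `K_N`, apex-bearing — absent by `(A₃)` — or four-charged with `G(N) ≥ G(P) + 2`, so `Θ_h(N) > Θ_h(P)`. -/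
theorem ruleA1_P_Θ {h : ℤ} (hh : h % 2 = 0) {C : MConfig} (hU : C.InDiamond h) {P : MCell} (hP : P ∈ C.upper) (hD : RuleDMu4P C P)
    (h4 : FourCharged P) (hK : KP P) {w x z : Fin 4} (hwx : w ≠ x) (hzw : z ≠ w)
    (hwn : ∀ g, nodeLevel (P g) ≤ nodeLevel (P w)) (hxt : ∀ g, causalTop (P g) ≤ causalTop (P x))
    (hz : causalTop (P z) - causalTop (P w) < causalTop (P w) - nodeLevel (P w))
    (hprov : (∀ g, g ≠ w → causalTop (P g) = causalTop (P x)) → causalTop (P w) < causalTop (P x) →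
      (∃ g, g ≠ w ∧ nodeLevel (P g) < 8) ∨ causalTop (P w) < 8)
    (hA : InterfaceKAbsent C) (hIH : FourChargedKAbsentAboveW (2 * h + 1) (4 * h + 1) C (phiW (2 * h + 1) (4 * h + 1) P)) : False := by
  have hcw : 0 < absCharge (P w) := absCharge_pos_of_not_isApex (hU.2 P hP w).1 (not_isApex_of_snd_ne (h4 w))
  have h2w := two_mul_absCharge (P w)
  have hne : nodeLevel (P w) ≠ causalTop (P x) := by have := hxt w; omega
  obtain ⟨N, hN, hag, how, hox, hmv⟩ := edge_nt_outcomes_P hh hU hP hD hwx (h4 w) hne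
  have hNg : ∀ g, g ≠ w → g ≠ x → N g = P g := fun g h1 h2 => hag g h1 h2
  have hNx : nodeLevel (N x) = nodeLevel (P x) ∧ causalTop (P x) ≤ causalTop (N x) ∧ (N x).2 ≠ (0, 0) ∧
      (N x ≠ P x → causalTop (P x) < causalTop (N x)) := by
    rcases hox with e | ⟨hc, hn, ht⟩
    · rw [e]; exact ⟨rfl, le_rfl, h4 x, fun hne' => (hne' rfl).elim⟩
    · exact ⟨hn, ht.le, hc, fun _ => ht⟩
  have hNw : nodeLevel (P w) ≤ nodeLevel (N w) ∧ causalTop (P w) ≤ causalTop (N w) ∧ (N w ≠ P w → nodeLevel (P w) < nodeLevel (N w)) := by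
    rcases how with e | ⟨ht, hn⟩ | ⟨-, hn, ht⟩
    · rw [e]; exact ⟨le_rfl, le_rfl, fun hne' => (hne' rfl).elim⟩
    · exact ⟨hn.le, by rw [ht], fun _ => hn⟩
    · refine ⟨by rw [hn]; omega, ht.le, fun _ => by rw [hn]; omega⟩
  have h3N : 3 ≤ chargeCount N := chargeCount_ge_three fun f hfw => by
    by_cases hfx : f = x
    · rw [hfx]; exact hNx.2.2.1
    · rw [hNg f hfw hfx]; exact h4 f
  have h3N' : (3 : ℤ) ≤ chargeCount N := by exact_mod_cast h3N
  obtain ⟨g₀, hg₀w, hg₀x⟩ := exists_third w x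
  -- class `K_N`
  have hKN : KN N := by
    by_cases hl : LevelCell N
    · right; refine ⟨hl, ?_⟩
      have e1 := hl x w; have e0 := hl g₀ w
      rw [hNg g₀ hg₀w hg₀x] at e0
      by_cases hov : causalTop (N w) = causalTop (P w)
      · -- the tops of `N` are those of `P`: `P` is level and `(K_P)` gives a charged letter of node `< 6`
        have htops : ∀ f, causalTop (N f) = causalTop (P f) := fun f => by
          by_cases hfw : f = w
          · rw [hfw, hov]
          by_cases hfx : f = x
          · rw [hfx]; have := hNx.2.1; have := hxt w; omega
          · rw [hNg f hfw hfx]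
        have hlP : LevelCell P := (levelCell_iff_of_tops htops).1 hl
        have hcc := chargeCount_eq_four h4
        rcases hK with ⟨-, hnl⟩ | ⟨-, hnl, -⟩ | ⟨-, f₀, hf₀c, hf₀n⟩
        · exact (hnl hlP).elim
        · exact (hnl hlP).elim
        rw [hcc] at hf₀n; push_cast at hf₀n
        by_cases hf₀w : f₀ = w
        · rw [hf₀w] at hf₀n
          exact ⟨x, hNx.2.2.1, by rw [hNx.1]; have := hwn x; omega⟩
        by_cases hf₀x : f₀ = x
        · rw [hf₀x] at hf₀n; exact ⟨x, hNx.2.2.1, by rw [hNx.1]; omega⟩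
        · exact ⟨f₀, by rw [hNg f₀ hf₀w hf₀x]; exact hf₀c, by rw [hNg f₀ hf₀w hf₀x]; omega⟩
      · -- an upward overshoot of `w` landing on the common top of the other three letters: the proviso
        have hovr : OverUpOf (P w) (N w) := by
          rcases how with e | ⟨ht, -⟩ | ho
          · exact (hov (by rw [e])).elim
          · exact (hov ht).elim
          · exact ho
        obtain ⟨hc, hn, ht⟩ := hovr
        have htx : causalTop (N x) = causalTop (P x) := by have := hNx.2.1; have := hxt g₀; omega
        have hall : ∀ g, g ≠ w → causalTop (P g) = causalTop (P x) := fun g hg => by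
          by_cases hgx : g = x
          · rw [hgx]
          · have := hl g w; rw [hNg g hg hgx] at this; omega
        have hlt : causalTop (P w) < causalTop (P x) := by omega
        have h4N : ∀ f, (N f).2 ≠ (0, 0) := fun f => by
          by_cases hfw : f = w
          · rw [hfw]; exact hc
          by_cases hfx : f = x
          · rw [hfx]; exact hNx.2.2.1
          · rw [hNg f hfw hfx]; exact h4 f
        have hcc := chargeCount_eq_four h4N
        rw [hcc]; push_cast
        rcases hprov hall hlt with ⟨g, hgw, hg8⟩ | hw8
        · by_cases hgx : g = x
          · rw [hgx] at hg8; exact ⟨x, hNx.2.2.1, by rw [hNx.1]; omega⟩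
          · exact ⟨g, by rw [hNg g hgw hgx]; exact h4 g, by rw [hNg g hgw hgx]; omega⟩
        · exact ⟨w, hc, by rw [hn]; omega⟩
    · exact Or.inl ⟨by omega, hl⟩
  -- apex-bearing outcome: absent by (A₃)
  by_cases haw : (N w).2 = (0, 0)
  · refine hA.1 N hN hKN ⟨w, haw, fun g hg => ?_⟩
    have hcw : 0 < absCharge (P w) := absCharge_pos_of_not_isApex (hU.2 P hP w).1 (not_isApex_of_snd_ne (h4 w))
    have h2w := two_mul_absCharge (P w)
    have hw1 := hNw.2.1; have hwg := hwn g
    by_cases hgx : g = x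
    · rw [hgx]; exact ⟨hNx.2.2.1, by rw [hNx.1]; have := hwn x; omega⟩
    · rw [hNg g hg hgx]; exact ⟨h4 g, by omega⟩
  have h4N : FourCharged N := fun f => by
    by_cases hfw : f = w
    · rw [hfw]; exact haw
    by_cases hfx : f = x
    · rw [hfx]; exact hNx.2.2.1
    · rw [hNg f hfw hfx]; exact h4 f
  -- nodes: only `w` moves, and it is the maximum: `+3τ'` exactly
  have hn1 : spreadOf (fun f => nodeLevel (N f)) = spreadOf (fun f => nodeLevel (P f)) + 3 * (nodeLevel (N w) - nodeLevel (P w)) := by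
    refine spreadOf_raise_max (v := fun f => nodeLevel (P f)) (w := fun f => nodeLevel (N f)) (y := w) (fun g => hwn g) ?_ hNw.1
    intro g hg; show nodeLevel (N g) = nodeLevel (P g)
    by_cases hgx : g = x
    · rw [hgx]; exact hNx.1
    · rw [hNg g hg hgx]
  -- charges: `2·ΔQ = Δ(t − n)(w) + τ_x`
  have hQ : sum4 (fun f => absCharge (N f)) = sum4 (fun f => absCharge (P f)) + (absCharge (N w) - absCharge (P w)) + (absCharge (N x) - absCharge (P x)) :=
    sum4_two_slots hwx fun f h1 h2 => by simp [hNg f h1 h2]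
  have h2Nw := two_mul_absCharge (N w); have h2Nx := two_mul_absCharge (N x); have h2Px := two_mul_absCharge (P x)
  have hQ2 : 2 * chargeSum N = 2 * chargeSum P + ((causalTop (N w) - nodeLevel (N w)) - (causalTop (P w) - nodeLevel (P w)))
      + (causalTop (N x) - causalTop (P x)) := by
    rw [chargeSum_eq_sum4, chargeSum_eq_sum4, hQ]; have := hNx.1; omega
  -- tops, via the intermediate vector in which only `w` has moved (loss `≤ d + 2(T_w − 1)` by the witness `z`), then `x` (top-maximal off `w`): `≥ +τ_x`
  let m : Fin 4 → ℤ := fun f => if f = w then causalTop (N w) else causalTop (P f)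
  have hmw' : m w = causalTop (N w) := by simp [m]
  have hmg : ∀ g, g ≠ w → m g = causalTop (P g) := fun g hg => by simp [m, hg]
  have ht1 : spreadOf (fun f => causalTop (P f)) ≤ spreadOf m + (m w - causalTop (P w)) + 2 * (causalTop (P w) - nodeLevel (P w) - 1) := by
    refine spreadOf_raise_gap (v := fun f => causalTop (P f)) (w := m) (y := w) (z := z) hzw ?_ ?_ (fun g hg => hmg g hg) ?_
    · show causalTop (P z) - causalTop (P w) ≤ causalTop (P w) - nodeLevel (P w) - 1; omega
    · omega
    · show causalTop (P w) ≤ m w; rw [hmw']; exact hNw.2.1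
  have ht2 : spreadOf m + (causalTop (N x) - m x) ≤ spreadOf (fun f => causalTop (N f)) := by
    refine spreadOf_raise_second (v := m) (w := fun f => causalTop (N f)) (y := x) (u := w) ?_ ?_ ?_
    · intro g hg; show m g ≤ m x; rw [hmg x (Ne.symm hwx), hmg g hg]; exact hxt g
    · intro g hg; show causalTop (N g) = m g
      by_cases hgw : g = w
      · rw [hgw, hmw']
      · rw [hmg g hgw, hNg g hgw hg]
    · show m x ≤ causalTop (N x); rw [hmg x (Ne.symm hwx)]; exact hNx.2.1
  rw [hmw'] at ht1; rw [hmg x (Ne.symm hwx)] at ht2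
  have hG : gKey P + 2 ≤ gKey N := by
    rcases how with e | ⟨ht, hn⟩ | ⟨-, hn, ht⟩
    · -- only `x` is raised, by `τ_x > 0`: tops `+3τ_x` exactly
      have hρ : causalTop (P x) < causalTop (N x) := hNx.2.2.2 (hmv.elim (fun hne' => (hne' e).elim) id)
      have ht0 : spreadOf (fun f => causalTop (N f)) = spreadOf (fun f => causalTop (P f)) + 3 * (causalTop (N x) - causalTop (P x)) := by
        refine spreadOf_raise_max (v := fun f => causalTop (P f)) (w := fun f => causalTop (N f)) (y := x) (fun g => hxt g) ?_ hNx.2.1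
        intro g hg; show causalTop (N g) = causalTop (P g)
        by_cases hgw : g = w
        · rw [hgw, e]
        · rw [hNg g hgw hg]
      rw [e] at hn1 hQ2
      unfold gKey pairSpread; omega
    · -- a lift of `w` by `τ' > 0` (top kept) and a raise of `x` by `τ_x ≥ 0`: `ΔG = 2τ' + 4τ_x`
      have ht0 : spreadOf (fun f => causalTop (N f)) = spreadOf (fun f => causalTop (P f)) + 3 * (causalTop (N x) - causalTop (P x)) := by
        refine spreadOf_raise_max (v := fun f => causalTop (P f)) (w := fun f => causalTop (N f)) (y := x) (fun g => hxt g) ?_ hNx.2.1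
        intro g hg; show causalTop (N g) = causalTop (P g)
        by_cases hgw : g = w
        · rw [hgw, ht]
        · rw [hNg g hgw hg]
      unfold gKey pairSpread; omega
    · -- an upward overshoot of `w`: `ΔG ≥ 2 + 2τ_x`
      unfold gKey pairSpread; omega
  exact hIH.1 N hN hKN h4N (theta_lt_of_gKey_lt (hU.1 N hN) (by omega))

/-- **RULE (A2) ABOVE** (KERNEL, `h` even, law-free): the dual of `ruleA2_N_Θ`.  A four-charged `K_P`-cell `P ∈ C.upper` whose node-maximum `u` is
UNIQUE; a letter `s ≠ u` of the second node level with `n_u < t_s` which is not the unique top-minimum (a letter `z ≠ s` has `t_z ≤ t_s`); a top-maximal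
`x ≠ s`: RULE D at (node of `s`, top of `x`) is served by an `N ∈ C.lower` of class `K_N` (a level outcome has the tops of `P`, so `P` is level and
`(K_P)` supplies a low charged letter), apex-bearing or four-charged with `Θ_h(N) > Θ_h(P)`.  No proviso. -/
theorem ruleA2_P_Θ {h : ℤ} (hh : h % 2 = 0) {C : MConfig} (hU : C.InDiamond h) {P : MCell} (hP : P ∈ C.upper) (hD : RuleDMu4P C P)
    (h4 : FourCharged P) (hK : KP P) {u s x z : Fin 4} (hsu : s ≠ u) (hxs : x ≠ s) (hzs : z ≠ s)
    (hu : ∀ g, g ≠ u → nodeLevel (P g) < nodeLevel (P u)) (hs : ∀ g, g ≠ u → nodeLevel (P g) ≤ nodeLevel (P s))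
    (hns : nodeLevel (P u) < causalTop (P s)) (hz : causalTop (P z) ≤ causalTop (P s)) (hxt : ∀ g, causalTop (P g) ≤ causalTop (P x))
    (hA : InterfaceKAbsent C) (hIH : FourChargedKAbsentAboveW (2 * h + 1) (4 * h + 1) C (phiW (2 * h + 1) (4 * h + 1) P)) : False := by
  have hcs : 0 < absCharge (P s) := absCharge_pos_of_not_isApex (hU.2 P hP s).1 (not_isApex_of_snd_ne (h4 s))
  have h2s := two_mul_absCharge (P s)
  have hus : nodeLevel (P s) < nodeLevel (P u) := hu s hsu
  have hne : nodeLevel (P s) ≠ causalTop (P x) := by have := hxt s; omega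
  obtain ⟨N, hN, hag, how, hox, hmv⟩ := edge_nt_outcomes_P hh hU hP hD (Ne.symm hxs) (h4 s) hne
  have hNg : ∀ g, g ≠ s → g ≠ x → N g = P g := fun g h1 h2 => hag g h1 h2
  have hNx : nodeLevel (N x) = nodeLevel (P x) ∧ causalTop (P x) ≤ causalTop (N x) ∧ (N x).2 ≠ (0, 0) ∧
      (N x ≠ P x → causalTop (P x) < causalTop (N x)) := by
    rcases hox with e | ⟨hc, hn, ht⟩
    · rw [e]; exact ⟨rfl, le_rfl, h4 x, fun hne' => (hne' rfl).elim⟩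
    · exact ⟨hn, ht.le, hc, fun _ => ht⟩
  have hNs : nodeLevel (P s) ≤ nodeLevel (N s) ∧ causalTop (P s) ≤ causalTop (N s) ∧ (N s ≠ P s → nodeLevel (P s) < nodeLevel (N s)) := by
    rcases how with e | ⟨ht, hn⟩ | ⟨-, hn, ht⟩
    · rw [e]; exact ⟨le_rfl, le_rfl, fun hne' => (hne' rfl).elim⟩
    · exact ⟨hn.le, by rw [ht], fun _ => hn⟩
    · refine ⟨by rw [hn]; omega, ht.le, fun _ => by rw [hn]; omega⟩
  have h3N : 3 ≤ chargeCount N := chargeCount_ge_three fun f hfs => by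
    by_cases hfx : f = x
    · rw [hfx]; exact hNx.2.2.1
    · rw [hNg f hfs hfx]; exact h4 f
  have h3N' : (3 : ℤ) ≤ chargeCount N := by exact_mod_cast h3N
  -- class `K_N`: a level outcome keeps the tops of `P` (an upward overshoot of `s` is not level: `z` keeps a top `≤ t_s`), so `P` is level
  have hKN : KN N := by
    by_cases hl : LevelCell N
    · right; refine ⟨hl, ?_⟩
      have htsw : causalTop (N s) = causalTop (P s) := by
        rcases how with e | ⟨ht, -⟩ | ⟨-, -, ht⟩
        · rw [e]
        · exact ht
        · exfalso
          obtain ⟨g₀, hg₀s, hg₀x⟩ := exists_third s x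
          have e0 := hl g₀ s; rw [hNg g₀ hg₀s hg₀x] at e0
          have ex := hl x s
          by_cases hzx : z = x
          · rw [hzx] at hz; have := hxt g₀; omega
          · have ez := hl z s; rw [hNg z hzs hzx] at ez; omega
      have htops : ∀ f, causalTop (N f) = causalTop (P f) := fun f => by
        by_cases hfs : f = s
        · rw [hfs, htsw]
        by_cases hfx : f = x
        · rw [hfx]; have := hl x s; have := hNx.2.1; have := hxt s; omega
        · rw [hNg f hfs hfx]
      have hlP : LevelCell P := (levelCell_iff_of_tops htops).1 hl
      have hcc := chargeCount_eq_four h4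
      rcases hK with ⟨-, hnl⟩ | ⟨-, hnl, -⟩ | ⟨-, f₀, hf₀c, hf₀n⟩
      · exact (hnl hlP).elim
      · exact (hnl hlP).elim
      rw [hcc] at hf₀n; push_cast at hf₀n
      by_cases hf₀s : f₀ = s
      · -- use a third letter `g₁ ∉ {s, u}`: its node is `≤ n_s < 6` and is kept
        obtain ⟨g₁, hg₁s, hg₁u⟩ := exists_third s u
        rw [hf₀s] at hf₀n
        have hng : nodeLevel (N g₁) = nodeLevel (P g₁) := by
          by_cases hg₁x : g₁ = x
          · rw [hg₁x]; exact hNx.1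
          · rw [hNg g₁ hg₁s hg₁x]
        have hcg : (N g₁).2 ≠ (0, 0) := by
          by_cases hg₁x : g₁ = x
          · rw [hg₁x]; exact hNx.2.2.1
          · rw [hNg g₁ hg₁s hg₁x]; exact h4 g₁
        exact ⟨g₁, hcg, by rw [hng]; have := hs g₁ hg₁u; omega⟩
      by_cases hf₀x : f₀ = x
      · rw [hf₀x] at hf₀n; exact ⟨x, hNx.2.2.1, by rw [hNx.1]; omega⟩
      · exact ⟨f₀, by rw [hNg f₀ hf₀s hf₀x]; exact hf₀c, by rw [hNg f₀ hf₀s hf₀x]; omega⟩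
    · exact Or.inl ⟨by omega, hl⟩
  -- apex-bearing outcome: absent by (A₃)
  by_cases has : (N s).2 = (0, 0)
  · refine hA.1 N hN hKN ⟨s, has, fun g hg => ?_⟩
    have h2s := two_mul_absCharge (P s)
    have hs1 := hNs.2.1
    have hsg : nodeLevel (P g) < causalTop (P s) := by
      by_cases hgu : g = u
      · rw [hgu]; exact hns
      · have := hs g hgu; omega
    by_cases hgx : g = x
    · subst hgx; exact ⟨hNx.2.2.1, by rw [hNx.1]; omega⟩
    · rw [hNg g hg hgx]; exact ⟨h4 g, by omega⟩
  have h4N : FourCharged N := fun f => by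
    by_cases hfs : f = s
    · rw [hfs]; exact has
    by_cases hfx : f = x
    · rw [hfx]; exact hNx.2.2.1
    · rw [hNg f hfs hfx]; exact h4 f
  -- charges
  have hQ : sum4 (fun f => absCharge (N f)) = sum4 (fun f => absCharge (P f)) + (absCharge (N s) - absCharge (P s)) + (absCharge (N x) - absCharge (P x)) :=
    sum4_two_slots (Ne.symm hxs) fun f h1 h2 => by simp [hNg f h1 h2]
  have h2Ns := two_mul_absCharge (N s); have h2Nx := two_mul_absCharge (N x); have h2Px := two_mul_absCharge (P x)
  have hQ2 : 2 * chargeSum N = 2 * chargeSum P + ((causalTop (N s) - nodeLevel (N s)) - (causalTop (P s) - nodeLevel (P s)))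
      + (causalTop (N x) - causalTop (P x)) := by
    rw [chargeSum_eq_sum4, chargeSum_eq_sum4, hQ]; have := hNx.1; omega
  -- tops: `s` raised (overshoot only) with the gap-0 witness `z` (loss `≤ d`), then `x` (top-maximal off `s`): `≥ +τ_x`
  let m₂ : Fin 4 → ℤ := fun f => if f = s then causalTop (N s) else causalTop (P f)
  have hm₂s : m₂ s = causalTop (N s) := by simp [m₂]
  have hm₂g : ∀ g, g ≠ s → m₂ g = causalTop (P g) := fun g hg => by simp [m₂, hg]
  have hB1 : spreadOf (fun f => causalTop (P f)) ≤ spreadOf m₂ + (m₂ s - causalTop (P s)) + 2 * 0 := by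
    refine spreadOf_raise_gap (v := fun f => causalTop (P f)) (w := m₂) (y := s) (z := z) hzs ?_ le_rfl (fun g hg => hm₂g g hg) ?_
    · show causalTop (P z) - causalTop (P s) ≤ 0; omega
    · show causalTop (P s) ≤ m₂ s; rw [hm₂s]; exact hNs.2.1
  have hB2 : spreadOf m₂ + (causalTop (N x) - m₂ x) ≤ spreadOf (fun f => causalTop (N f)) := by
    refine spreadOf_raise_second (v := m₂) (w := fun f => causalTop (N f)) (y := x) (u := s) ?_ ?_ ?_
    · intro g hg; show m₂ g ≤ m₂ x; rw [hm₂g x hxs, hm₂g g hg]; exact hxt g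
    · intro g hg; show causalTop (N g) = m₂ g
      by_cases hgs : g = s
      · rw [hgs, hm₂s]
      · rw [hm₂g g hgs, hNg g hgs hg]
    · show m₂ x ≤ causalTop (N x); rw [hm₂g x hxs]; exact hNx.2.1
  rw [hm₂s] at hB1; rw [hm₂g x hxs] at hB2
  have h0 : 0 ≤ h := by have := chargeSum_le (hU.1 N hN); have := chargeSum_nonneg N; omega
  have hlt : phiW (2 * h + 1) (4 * h + 1) P < phiW (2 * h + 1) (4 * h + 1) N := by
    rcases how with e | ⟨ht, hn⟩ | ⟨-, hn, ht⟩
    · -- only `x` is raised, by `τ_x > 0`: tops `+3τ_x` exactly, nodes unchanged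
      have hρ : causalTop (P x) < causalTop (N x) := hNx.2.2.2 (hmv.elim (fun hne' => (hne' e).elim) id)
      have ht0 : spreadOf (fun f => causalTop (N f)) = spreadOf (fun f => causalTop (P f)) + 3 * (causalTop (N x) - causalTop (P x)) := by
        refine spreadOf_raise_max (v := fun f => causalTop (P f)) (w := fun f => causalTop (N f)) (y := x) (fun g => hxt g) ?_ hNx.2.1
        intro g hg; show causalTop (N g) = causalTop (P g)
        by_cases hgs : g = s
        · rw [hgs, e]
        · rw [hNg g hgs hg]
      have hn0 : spreadOf (fun f => nodeLevel (N f)) = spreadOf (fun f => nodeLevel (P f)) := by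
        have hfun : (fun f => nodeLevel (N f)) = (fun f => nodeLevel (P f)) := funext fun f => by
          by_cases hfs : f = s
          · rw [hfs, e]
          by_cases hfx : f = x
          · rw [hfx]; exact hNx.1
          · rw [hNg f hfs hfx]
        rw [hfun]
      rw [e] at hQ2
      exact theta_lt_of_gKey_lt (hU.1 N hN) (by unfold gKey pairSpread; omega)
    · -- a lift of `s` by `τ' > 0` (top kept; only `u` above `s`: nodes `≥ +τ'`), a raise of `x` by `τ_x ≥ 0` (tops `+3τ_x`): `ΔG ≥ 4τ_x`, `2ΔQ = τ_x − τ'`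
      have hn0 : spreadOf (fun f => nodeLevel (P f)) + (nodeLevel (N s) - nodeLevel (P s)) ≤ spreadOf (fun f => nodeLevel (N f)) := by
        refine spreadOf_raise_second (v := fun f => nodeLevel (P f)) (w := fun f => nodeLevel (N f)) (y := s) (u := u) (fun g hg => hs g hg) ?_ hNs.1
        intro g hg; show nodeLevel (N g) = nodeLevel (P g)
        by_cases hgx : g = x
        · rw [hgx]; exact hNx.1
        · rw [hNg g hg hgx]
      have ht0 : spreadOf (fun f => causalTop (N f)) = spreadOf (fun f => causalTop (P f)) + 3 * (causalTop (N x) - causalTop (P x)) := by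
        refine spreadOf_raise_max (v := fun f => causalTop (P f)) (w := fun f => causalTop (N f)) (y := x) (fun g => hxt g) ?_ hNx.2.1
        intro g hg; show causalTop (N g) = causalTop (P g)
        by_cases hgs : g = s
        · rw [hgs, ht]
        · rw [hNg g hgs hg]
      by_cases hρ0 : causalTop (N x) = causalTop (P x)
      · exact theta_lt_of_gKey_le h0 (by unfold gKey pairSpread; omega) (by omega)
      · exact theta_lt_of_gKey_lt (hU.1 N hN) (by unfold gKey pairSpread; omega)
    · -- an upward overshoot of `s` (`n(N s) = t_s > n_u`): nodes in two stages (`+τ₁` up to `n_u`, then `+3τ₂` above the maximum), tops `≥ −d + τ_x`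
      let m₁ : Fin 4 → ℤ := fun f => if f = s then nodeLevel (P u) else nodeLevel (P f)
      have hm₁s : m₁ s = nodeLevel (P u) := by simp [m₁]
      have hm₁g : ∀ g, g ≠ s → m₁ g = nodeLevel (P g) := fun g hg => by simp [m₁, hg]
      have hA1 : spreadOf (fun f => nodeLevel (P f)) + (m₁ s - nodeLevel (P s)) ≤ spreadOf m₁ := by
        refine spreadOf_raise_second (v := fun f => nodeLevel (P f)) (w := m₁) (y := s) (u := u) (fun g hg => hs g hg) (fun g hg => hm₁g g hg) ?_
        show nodeLevel (P s) ≤ m₁ s; rw [hm₁s]; exact hus.le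
      have hA2 : spreadOf (fun f => nodeLevel (N f)) = spreadOf m₁ + 3 * (nodeLevel (N s) - m₁ s) := by
        refine spreadOf_raise_max (v := m₁) (w := fun f => nodeLevel (N f)) (y := s) ?_ ?_ ?_
        · intro g
          by_cases hgs : g = s
          · rw [hgs]
          · rw [hm₁g g hgs, hm₁s]
            by_cases hgu : g = u
            · rw [hgu]
            · exact (hu g hgu).le
        · intro g hg; show nodeLevel (N g) = m₁ g
          rw [hm₁g g hg]
          by_cases hgx : g = x
          · rw [hgx]; exact hNx.1
          · rw [hNg g hg hgx]
        · show m₁ s ≤ nodeLevel (N s); rw [hm₁s, hn]; exact hns.le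
      rw [hm₁s] at hA1 hA2
      exact theta_lt_of_gKey_lt (hU.1 N hN) (by unfold gKey pairSpread; omega)
  exact hIH.1 N hN hKN h4N hlt

/-- **THE `P`-HALF OF THE Θ-STEP** (KERNEL, `h` even, law-free): the dual covering.  `u` node-maximal.  `u` the unique top-maximum: (B)ᴾ.  Else, `u`
not thin-high (a witness `z`): (A1)ᴾ at `u` when its proviso holds; when it fails (the other three letters share the top `t_x > t_u` with nodes `≥ 8`):
(A2)ᴾ at the runner-up of the then unique node-maximum `u`, or (A1)ᴾ at a tied node-maximum (witness `u`, proviso vacuous).  `u` thin-high (so the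
unique top-minimum): a tied node-maximum `g` is served by (B)ᴾ or (A1)ᴾ with the witness `u`; otherwise the runner-up `s` of `u` has `t_s ≥ 2t_u − n_u
> n_u` and is served by (B)ᴾ or by (A2)ᴾ with `z := u`. -/
theorem thetaStep_P {h : ℤ} (hh : h % 2 = 0) {C : MConfig} (hU : C.InDiamond h) (hD : RuleDMu4Closed C) (hA : InterfaceKAbsent C) {P : MCell}
    (hP : P ∈ C.upper) (hK : KP P) (h4 : FourCharged P) (hIH : FourChargedKAbsentAboveW (2 * h + 1) (4 * h + 1) C (phiW (2 * h + 1) (4 * h + 1) P)) :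
    False := by
  have hDP : RuleDMu4P C P := hD.2 P hP
  have h0 : 0 ≤ h := by have := chargeSum_le (hU.2 P hP); have := chargeSum_nonneg P; omega
  have ha : (0 : ℤ) < 2 * h + 1 := by omega
  have hb : (0 : ℤ) ≤ 4 * h + 1 := by omega
  have hch : ∀ f, 0 < absCharge (P f) := fun f => absCharge_pos_of_not_isApex (hU.2 P hP f).1 (not_isApex_of_snd_ne (h4 f))
  -- rule (B)ᴾ at a unique top-maximum
  have ruleB : ∀ y, (∀ g, g ≠ y → causalTop (P g) < causalTop (P y)) → False := by
    intro y hy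
    obtain ⟨z, hzy, hz⟩ := exists_max_ne (fun f => causalTop (P f)) y
    exact ruleB_P_W ha hb hh hU hP hDP h4 (Ne.symm hzy) hy hz hIH
  -- rule (A1)ᴾ at a node-maximal `w` with a witness `z` and a top-maximal `x ≠ w`, under its proviso
  have ruleA1 : ∀ w x z, w ≠ x → z ≠ w → (∀ g, nodeLevel (P g) ≤ nodeLevel (P w)) → (∀ g, causalTop (P g) ≤ causalTop (P x)) →
      causalTop (P z) - causalTop (P w) < causalTop (P w) - nodeLevel (P w) →
      ((∀ g, g ≠ w → causalTop (P g) = causalTop (P x)) → causalTop (P w) < causalTop (P x) →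
        (∃ g, g ≠ w ∧ nodeLevel (P g) < 8) ∨ causalTop (P w) < 8) → False :=
    fun w x z hwx hzw hwn hxt hz hprov => ruleA1_P_Θ hh hU hP hDP h4 hK hwx hzw hwn hxt hz hprov hA hIH
  obtain ⟨u, hu⟩ := exists_max4 fun f => nodeLevel (P f)
  have hun : ∀ g, nodeLevel (P g) ≤ nodeLevel (P u) := hu
  have hcu := hch u; have h2u := two_mul_absCharge (P u)
  by_cases hut : ∀ g, g ≠ u → causalTop (P g) < causalTop (P u)
  · exact ruleB u hut
  obtain ⟨x, hxu, hxt⟩ := exists_topMax_ne P u hut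
  by_cases hth : ∃ z, z ≠ u ∧ causalTop (P z) - causalTop (P u) < causalTop (P u) - nodeLevel (P u)
  · obtain ⟨z, hzu, hz⟩ := hth
    by_cases hprov : (∀ g, g ≠ u → causalTop (P g) = causalTop (P x)) → causalTop (P u) < causalTop (P x) →
        (∃ g, g ≠ u ∧ nodeLevel (P g) < 8) ∨ causalTop (P u) < 8
    · exact ruleA1 u x z (Ne.symm hxu) hzu hun hxt hz hprov
    -- the proviso fails: the other three letters share the top `t_x > t_u`, all with node `≥ 8`
    have hall : ∀ g, g ≠ u → causalTop (P g) = causalTop (P x) := by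
      by_contra hc; exact hprov fun h1 _ => (hc h1).elim
    have hlt : causalTop (P u) < causalTop (P x) := by
      by_contra hc; exact hprov fun _ h2 => (hc h2).elim
    have hbig : ∀ g, g ≠ u → 8 ≤ nodeLevel (P g) := fun g hg => by
      by_contra hc; exact hprov fun _ _ => Or.inl ⟨g, hg, by omega⟩
    by_cases htie : ∃ g, g ≠ u ∧ nodeLevel (P g) = nodeLevel (P u)
    · -- a tied node-maximum `g`: (A1)ᴾ at `g` with the witness `u` and a third letter as the top-maximal partner; its proviso is vacuous
      obtain ⟨g, hgu, hg⟩ := htie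
      obtain ⟨x', hx'u, hx'g⟩ := exists_third u g
      refine ruleA1 g x' u (Ne.symm hx'g) (Ne.symm hgu) (fun f => by rw [hg]; exact hun f) ?_ ?_ ?_
      · intro f; rw [hall x' hx'u]; exact hxt f
      · have := hall g hgu; have := hch g; have := two_mul_absCharge (P g); omega
      · intro h1 _; exfalso; have e := h1 u (Ne.symm hgu); have := hall x' hx'u; omega
    · -- `u` is the unique node-maximum: (A2)ᴾ at its runner-up `s` with `z := u` and a third letter as the top-maximal partner
      have hu1 : ∀ g, g ≠ u → nodeLevel (P g) < nodeLevel (P u) := fun g hg => lt_of_le_of_ne (hun g) fun e => htie ⟨g, hg, e⟩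
      obtain ⟨s, hsu, hs⟩ := exists_max_ne (fun f => nodeLevel (P f)) u
      have hs' : ∀ g, g ≠ u → nodeLevel (P g) ≤ nodeLevel (P s) := hs
      obtain ⟨x', hx's, hx'u⟩ := exists_third s u
      have hts := hall s hsu
      refine ruleA2_P_Θ hh hU hP hDP h4 hK (u := u) (s := s) (x := x') (z := u) hsu hx's (Ne.symm hsu) hu1 hs' (by omega) (by omega) ?_ hA hIH
      intro f; rw [hall x' hx'u]; exact hxt f
  -- `u` is thin-high (read dually): `t_z − t_u ≥ t_u − n_u > 0` for every `z ≠ u`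
  have hth' : ∀ z, z ≠ u → causalTop (P u) - nodeLevel (P u) ≤ causalTop (P z) - causalTop (P u) := by
    intro z hz; by_contra hc; exact hth ⟨z, hz, by omega⟩
  by_cases htie : ∃ g, g ≠ u ∧ nodeLevel (P g) = nodeLevel (P u)
  · -- a tied node-maximum `g`: (B)ᴾ or (A1)ᴾ at `g` with the witness `u`; the proviso is vacuous since `t_u < t_g ≤ t_x'`
    obtain ⟨g, hgu, hg⟩ := htie
    by_cases hgt : ∀ f, f ≠ g → causalTop (P f) < causalTop (P g)
    · exact ruleB g hgt
    obtain ⟨x', hx'g, hx't⟩ := exists_topMax_ne P g hgt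
    refine ruleA1 g x' u (Ne.symm hx'g) (Ne.symm hgu) (fun f => by rw [hg]; exact hun f) hx't ?_ ?_
    · have := hth' g hgu; have := hch g; have := two_mul_absCharge (P g); omega
    · intro h1 _; exfalso; have e := h1 u (Ne.symm hgu); have := hth' g hgu; have := hx't g; omega
  · -- `u` is the unique node-maximum: hand over to its runner-up `s`
    have hu1 : ∀ g, g ≠ u → nodeLevel (P g) < nodeLevel (P u) := fun g hg => lt_of_le_of_ne (hun g) fun e => htie ⟨g, hg, e⟩
    obtain ⟨s, hsu, hs⟩ := exists_max_ne (fun f => nodeLevel (P f)) u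
    have hs' : ∀ g, g ≠ u → nodeLevel (P g) ≤ nodeLevel (P s) := hs
    by_cases hst : ∀ f, f ≠ s → causalTop (P f) < causalTop (P s)
    · exact ruleB s hst
    obtain ⟨x', hx's, hx't⟩ := exists_topMax_ne P s hst
    have := hth' s hsu
    exact ruleA2_P_Θ hh hU hP hDP h4 hK (u := u) (s := s) (x := x') (z := u) hsu hx's (Ne.symm hsu) hu1 hs' (by omega) (by omega) hx't hA hIH

/-- **THE `P`-HALF OF THE Θ-STEP IS A THEOREM** (`h` even). -/
theorem thetaStepP_holds {h : ℤ} (hh : h % 2 = 0) : ThetaStepP h :=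
  fun _ hU hD hA _ hP hK h4 hIH => thetaStep_P hh hU hD (interfaceKAbsent_of_apexBearingKAbsent hA) hP hK h4 hIH

/-- **THE Θ-STEP IS A THEOREM** (KERNEL, every even `h`, law-free): RULE D at every four-charged `K`-cell of a RULE-D-closed `◇_h` configuration
without apex-bearing `K`-cells is served, in either phase, by a four-charged `K`-cell of strictly larger `Θ_h = (2h+1)Ψ + (4h+1)Q` or by an
apex-bearing `K`-cell. -/
theorem thetaStepW_holds {h : ℤ} (hh : h % 2 = 0) : PhiStepW (2 * h + 1) (4 * h + 1) h := phiStepW_theta_of_P (thetaStepP_holds hh)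

/-- **THE Θ-LAW IS A THEOREM.** -/
theorem thetaLawH_holds : ThetaLawH := fun _ _ hh => thetaStepW_holds hh

/-- **THE FOUR-CHARGED `K`-STRATUM IS EMPTY** (KERNEL, every even `h`, law-free; the g16 target): a RULE-D-closed `◇_h` configuration without
apex-bearing `K`-cells has no four-charged `K`-cell, in either phase.  (Downward induction on `Θ_h` = `fourChargedK_absent_of_phiStepW` fed with
`thetaStepW_holds`; the conditional corollaries `fourChargedK_absent_of_thetaLawH` ∕ `_of_thetaStepP` of §9a ∕ §9d are hereby discharged.) -/
theorem fourChargedK_absent {h : ℤ} (hh : h % 2 = 0) {C : MConfig} (hU : C.InDiamond h) (hD : RuleDMu4Closed C) (hA : ApexBearingKAbsent C) :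
    FourChargedKAbsent C := by
  refine ⟨fun Z hZ hK h4 => ?_, fun P hP hK h4 => ?_⟩
  · have h0 : 0 ≤ h := by have := chargeSum_le (hU.1 Z hZ); have := chargeSum_nonneg Z; omega
    exact (fourChargedK_absent_of_thetaStepP h0 (thetaStepP_holds hh) hU hD hA).1 Z hZ hK h4
  · have h0 : 0 ≤ h := by have := chargeSum_le (hU.2 P hP); have := chargeSum_nonneg P; omega
    exact (fourChargedK_absent_of_thetaStepP h0 (thetaStepP_holds hh) hU hD hA).2 P hP hK h4

/-- the whole kernel class `K` is absent (both phases). -/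
def KAbsent (C : MConfig) : Prop := (∀ Z ∈ C.lower, KN Z → False) ∧ (∀ P ∈ C.upper, KP P → False)

/-- **THE `K`-PEEL IS ITS APEX-BEARING STRATUM** (KERNEL, every even `h`, law-free): every cell is apex-bearing or four-charged, so in a RULE-D-closed
`◇_h` configuration the kernel class `K` is absent IF AND ONLY IF its apex-bearing cells are.  (The g13–g14 peel — `CHARGE-INDUCTION-g14` §14.5, whose
end `seedB1Odd_eight_of_cdP_seeds5` turns «`K`-cells absent» into (T₈) — is hereby reduced, at every even `h` at once, to `(A₃)`.) -/
theorem kAbsent_iff_apexBearingKAbsent {h : ℤ} (hh : h % 2 = 0) {C : MConfig} (hU : C.InDiamond h) (hD : RuleDMu4Closed C) :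
    KAbsent C ↔ ApexBearingKAbsent C := by
  refine ⟨fun hK => ⟨fun Z hZ hKZ _ => hK.1 Z hZ hKZ, fun P hP hKP _ => hK.2 P hP hKP⟩, fun hA => ?_⟩
  have h4 := fourChargedK_absent hh hU hD hA
  refine ⟨fun Z hZ hKZ => ?_, fun P hP hKP => ?_⟩
  · by_cases hap : ∃ f, (Z f).2 = (0, 0)
    · exact hA.1 Z hZ hKZ hap
    · exact h4.1 Z hZ hKZ fun f hf => hap ⟨f, hf⟩
  · by_cases hap : ∃ f, (P f).2 = (0, 0)
    · exact hA.2 P hP hKP hap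
    · exact h4.2 P hP hKP fun f hf => hap ⟨f, hf⟩

/-! ## §9g The INTERFACE of the peel and the `K`-core (g16 v9)

What the four-charged peel consumes of (A₃) is only its INTERFACE (A₃ᴵ) = `InterfaceKAbsent`: the one-apex cells a RULE-D move of an extremal charged
letter can create — a LOW one-apex `P`-cell (`LowApexP`: apex strictly below every charged top) and a HIGH one-apex `N`-cell (`HighApexN`: apex strictly
above every charged node).  Every rule and both coverings carry `(hA : InterfaceKAbsent C)`; the (A₃)-versions follow through
`interfaceKAbsent_of_apexBearingKAbsent`.  KERNEL (every even `h`): `fourChargedK_absent_of_interface`, `kAbsent_iff_interface`.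
THE `K`-CORE (machine, census-free, `tools/kcore.py`; least fixed point of «a `K`-head is derived absent once some `K`-closed clause has every alternative
absent» over ALL `K`-shapes): `h = 8`: `|K| = 5 177` (four-charged 1 429 · one-apex 2 194 · twin-apex 510 · split-two-apex 1 040 · three-apex 4),
interface 977; bases (A₃) → all; one-apex ∪ twin → all; `I` ∪ twin → all but the 5 (F1) heads; `I` ∪ twin ∪ (F1) (1 492 = 29 %) → ALL; `B₀` (no
`K`-closed clause) = 30 `N`-heads = (F1) 5 node-flat one-apex + (F2) 25 twin-apex.  `h = 10`: `|K| = 18 837`, interface 3 603, `I` ∪ twin ∪ (F1)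
(4 912 = 26 %) → ALL, `B₀` = 87 = 15 + 72.  `B₀ ≠ ∅`: RULE D alone never finishes (the all-`◇_h` configuration is RULE-D-closed); the base must come from
the other design laws.  NOT proved here: the absence of `I`, of the twin-apex cells, of (F1); (A₃); (T_h); H2. -/

/-- (Φ_{a,b}-STEPᴵ_h): the weighted step with the interface hypothesis (A₃ᴵ) in place of (A₃) — a STRONGER statement than `PhiStepW a b h`. -/
def PhiStepWI (a b h : ℤ) : Prop :=
  ∀ C : MConfig, C.InDiamond h → RuleDMu4Closed C → InterfaceKAbsent C → ∀ φ : ℤ, FourChargedKAbsentAboveW a b C φ →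
    (∀ Z ∈ C.lower, KN Z → FourCharged Z → phiW a b Z = φ → False) ∧ (∀ P ∈ C.upper, KP P → FourCharged P → phiW a b P = φ → False)

/-- the weighted Φ-peel with the interface hypothesis (the proof of `fourChargedK_absent_of_phiStepW` verbatim). -/
theorem fourChargedK_absent_of_phiStepWI {a b h : ℤ} (ha : 0 ≤ a) (hb : 0 ≤ b) (hS : PhiStepWI a b h) {C : MConfig} (hU : C.InDiamond h)
    (hD : RuleDMu4Closed C) (hA : InterfaceKAbsent C) : FourChargedKAbsent C := by
  have hbN : ∀ Z ∈ C.lower, phiW a b Z ≤ a * (8 * h) + b * (2 * h) := fun Z hZ => phiW_le ha hb (hU.1 Z hZ)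
  have hbP : ∀ P ∈ C.upper, phiW a b P ≤ a * (8 * h) + b * (2 * h) := fun P hP => phiW_le ha hb (hU.2 P hP)
  generalize a * (8 * h) + b * (2 * h) = B at hbN hbP
  have key : ∀ n : ℕ, (∀ Z ∈ C.lower, KN Z → FourCharged Z → B - n ≤ phiW a b Z → False) ∧
      (∀ P ∈ C.upper, KP P → FourCharged P → B - n ≤ phiW a b P → False) := by
    intro n
    induction n with
    | zero =>
      have hab : FourChargedKAbsentAboveW a b C B :=
        ⟨fun Z hZ _ _ hlt => absurd (hbN Z hZ) (not_le.2 hlt), fun P hP _ _ hlt => absurd (hbP P hP) (not_le.2 hlt)⟩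
      obtain ⟨hN, hP⟩ := hS C hU hD hA B hab
      refine ⟨fun Z hZ hK h4 hle => hN Z hZ hK h4 ?_, fun P hP' hK h4 hle => hP P hP' hK h4 ?_⟩
      · have := hbN Z hZ; push_cast at hle; omega
      · have := hbP P hP'; push_cast at hle; omega
    | succ n ih =>
      have hab : FourChargedKAbsentAboveW a b C (B - (n + 1)) :=
        ⟨fun Z hZ hK h4 hlt => ih.1 Z hZ hK h4 (by omega), fun P hP hK h4 hlt => ih.2 P hP hK h4 (by omega)⟩
      obtain ⟨hN, hP⟩ := hS C hU hD hA (B - (n + 1)) hab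
      refine ⟨fun Z hZ hK h4 hle => ?_, fun P hP' hK h4 hle => ?_⟩
      · by_cases he : phiW a b Z = B - (n + 1)
        · exact hN Z hZ hK h4 he
        · exact ih.1 Z hZ hK h4 (by push_cast at hle; omega)
      · by_cases he : phiW a b P = B - (n + 1)
        · exact hP P hP' hK h4 he
        · exact ih.2 P hP' hK h4 (by push_cast at hle; omega)
  refine ⟨fun Z hZ hK h4 => (key B.toNat).1 Z hZ hK h4 ?_, fun P hP hK h4 => (key B.toNat).2 P hP hK h4 ?_⟩
  · have := phiW_nonneg ha hb Z; have := Int.self_le_toNat B; omega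
  · have := phiW_nonneg ha hb P; have := Int.self_le_toNat B; omega

/-- KERNEL (every even `h`): the Θ-step with the interface hypothesis, both phases (`thetaStep_N` + `thetaStep_P`). -/
theorem thetaStepWI_holds {h : ℤ} (hh : h % 2 = 0) : PhiStepWI (2 * h + 1) (4 * h + 1) h := by
  intro C hU hD hA φ hIH
  refine ⟨fun Z hZ hK h4 he => ?_, fun P hP hK h4 he => ?_⟩
  · subst he; exact thetaStep_N hU hD hA hZ hK h4 hIH
  · subst he; exact thetaStep_P hh hU hD hA hP hK h4 hIH

/-- **THE FOUR-CHARGED `K`-STRATUM IS EMPTY GIVEN ONLY THE INTERFACE** (KERNEL, every even `h`, law-free): a RULE-D-closed `◇_h` configuration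
with no high-one-apex `K_N`-cell and no low-one-apex `K_P`-cell has no four-charged `K`-cell.  `fourChargedK_absent` is the special case (A₃). -/
theorem fourChargedK_absent_of_interface {h : ℤ} (hh : h % 2 = 0) {C : MConfig} (hU : C.InDiamond h) (hD : RuleDMu4Closed C)
    (hA : InterfaceKAbsent C) : FourChargedKAbsent C := by
  refine ⟨fun Z hZ hK h4 => ?_, fun P hP hK h4 => ?_⟩
  · have h0 : 0 ≤ h := by have := chargeSum_le (hU.1 Z hZ); have := chargeSum_nonneg Z; omega
    exact (fourChargedK_absent_of_phiStepWI (by omega) (by omega) (thetaStepWI_holds hh) hU hD hA).1 Z hZ hK h4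
  · have h0 : 0 ≤ h := by have := chargeSum_le (hU.2 P hP); have := chargeSum_nonneg P; omega
    exact (fourChargedK_absent_of_phiStepWI (by omega) (by omega) (thetaStepWI_holds hh) hU hD hA).2 P hP hK h4

/-- the apex-bearing `K`-cells OUTSIDE the interface: at least two apexes, or one apex that is not low (`P`) ∕ not high (`N`). -/
def NonInterfaceApexKAbsent (C : MConfig) : Prop :=
  (∀ Z ∈ C.lower, KN Z → ApexBearing Z → ¬ HighApexN Z → False) ∧ (∀ P ∈ C.upper, KP P → ApexBearing P → ¬ LowApexP P → False)

/-- **THE `K`-PEEL SPLITS AT THE INTERFACE** (KERNEL, every even `h`): `K` is absent iff the interface cells AND the remaining apex-bearing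
`K`-cells are; the four-charged stratum never has to be displayed. -/
theorem kAbsent_iff_interface {h : ℤ} (hh : h % 2 = 0) {C : MConfig} (hU : C.InDiamond h) (hD : RuleDMu4Closed C) :
    KAbsent C ↔ InterfaceKAbsent C ∧ NonInterfaceApexKAbsent C := by
  refine ⟨fun hK => ⟨⟨fun Z hZ hKZ _ => hK.1 Z hZ hKZ, fun P hP hKP _ => hK.2 P hP hKP⟩,
    ⟨fun Z hZ hKZ _ _ => hK.1 Z hZ hKZ, fun P hP hKP _ _ => hK.2 P hP hKP⟩⟩, fun ⟨hI, hR⟩ => ?_⟩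
  refine (kAbsent_iff_apexBearingKAbsent hh hU hD).2 ⟨fun Z hZ hKZ hap => ?_, fun P hP hKP hap => ?_⟩
  · by_cases hhi : HighApexN Z
    · exact hI.1 Z hZ hKZ hhi
    · exact hR.1 Z hZ hKZ hap hhi
  · by_cases hlo : LowApexP P
    · exact hI.2 P hP hKP hlo
    · exact hR.2 P hP hKP hap hlo

/-! ## §9h The apex strata: SPLIT two-apex and THREE-apex `K`-cells reduce law-free; `K` ⟺ one-apex ∪ twin-apex (g16 v10) -/

/-- apex letters have equal node level and causal top. -/
theorem causalTop_eq_nodeLevel_of_apex {x : BPoint} (hx : x.2 = (0, 0)) : causalTop x = nodeLevel x := by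
  rw [causalTop_eq, absCharge_of_uncharged hx]; ring

/-- exactly one apex. -/
def OneApex (Z : MCell) : Prop := ∃ f, (Z f).2 = (0, 0) ∧ ∀ g, g ≠ f → (Z g).2 ≠ (0, 0)

/-- TWIN apexes: exactly two apex letters, at the same level. -/
def TwinApex (Z : MCell) : Prop :=
  ∃ f g, f ≠ g ∧ (Z f).2 = (0, 0) ∧ (Z g).2 = (0, 0) ∧ causalTop (Z f) = causalTop (Z g) ∧ ∀ e, e ≠ f → e ≠ g → (Z e).2 ≠ (0, 0)

/-- SPLIT apexes: exactly two apex letters, at different levels. -/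
def SplitApex (Z : MCell) : Prop :=
  ∃ f g, f ≠ g ∧ (Z f).2 = (0, 0) ∧ (Z g).2 = (0, 0) ∧ causalTop (Z f) ≠ causalTop (Z g) ∧ ∀ e, e ≠ f → e ≠ g → (Z e).2 ≠ (0, 0)

def OneApexKAbsent (C : MConfig) : Prop :=
  (∀ Z ∈ C.lower, KN Z → OneApex Z → False) ∧ (∀ P ∈ C.upper, KP P → OneApex P → False)

def TwinApexKAbsent (C : MConfig) : Prop :=
  (∀ Z ∈ C.lower, KN Z → TwinApex Z → False) ∧ (∀ P ∈ C.upper, KP P → TwinApex P → False)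

/-! ### charge counts from apex data -/

theorem chargeCount_le_three_of_apex {Z : MCell} {a : Fin 4} (ha : (Z a).2 = (0, 0)) : chargeCount Z ≤ 3 := by
  unfold chargeCount
  calc _ ≤ (Finset.univ.erase a).card := Finset.card_le_card fun f hf => by
          rw [Finset.mem_filter] at hf; rw [Finset.mem_erase]; exact ⟨fun e => hf.2 (by rw [e]; exact ha), Finset.mem_univ f⟩
    _ = 3 := by rw [Finset.card_erase_of_mem (Finset.mem_univ a)]; simp

theorem chargeCount_le_two_of_apex2 {Z : MCell} {a b : Fin 4} (hab : a ≠ b) (ha : (Z a).2 = (0, 0)) (hb : (Z b).2 = (0, 0)) :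
    chargeCount Z ≤ 2 := by
  unfold chargeCount
  calc _ ≤ ((Finset.univ.erase a).erase b).card := Finset.card_le_card fun f hf => by
          rw [Finset.mem_filter] at hf; rw [Finset.mem_erase, Finset.mem_erase]
          exact ⟨fun e => hf.2 (by rw [e]; exact hb), fun e => hf.2 (by rw [e]; exact ha), Finset.mem_univ f⟩
    _ = 2 := by
        rw [Finset.card_erase_of_mem (by rw [Finset.mem_erase]; exact ⟨hab.symm, Finset.mem_univ b⟩),
          Finset.card_erase_of_mem (Finset.mem_univ a)]; simp

theorem chargeCount_le_one_of_apex3 {Z : MCell} {a b c : Fin 4} (hab : a ≠ b) (hac : a ≠ c) (hbc : b ≠ c) (ha : (Z a).2 = (0, 0))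
    (hb : (Z b).2 = (0, 0)) (hc : (Z c).2 = (0, 0)) : chargeCount Z ≤ 1 := by
  unfold chargeCount
  calc _ ≤ (((Finset.univ.erase a).erase b).erase c).card := Finset.card_le_card fun f hf => by
          rw [Finset.mem_filter] at hf; rw [Finset.mem_erase, Finset.mem_erase, Finset.mem_erase]
          exact ⟨fun e => hf.2 (by rw [e]; exact hc), fun e => hf.2 (by rw [e]; exact hb), fun e => hf.2 (by rw [e]; exact ha), Finset.mem_univ f⟩
    _ = 1 := by
        rw [Finset.card_erase_of_mem (by rw [Finset.mem_erase, Finset.mem_erase]; exact ⟨hbc.symm, hac.symm, Finset.mem_univ c⟩),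
          Finset.card_erase_of_mem (by rw [Finset.mem_erase]; exact ⟨hab.symm, Finset.mem_univ b⟩),
          Finset.card_erase_of_mem (Finset.mem_univ a)]; simp

theorem two_le_chargeCount_of_charged2 {Z : MCell} {x y : Fin 4} (hxy : x ≠ y) (hx : (Z x).2 ≠ (0, 0)) (hy : (Z y).2 ≠ (0, 0)) :
    2 ≤ chargeCount Z := by
  unfold chargeCount
  calc 2 = ({x, y} : Finset (Fin 4)).card := by rw [Finset.card_pair hxy]
    _ ≤ _ := Finset.card_le_card fun f hf => by
        rw [Finset.mem_insert, Finset.mem_singleton] at hf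
        rw [Finset.mem_filter]; refine ⟨Finset.mem_univ f, ?_⟩
        rcases hf with e | e <;> (rw [e]; assumption)

/-! ### no `K`-cell has three apexes in `P` or four apexes anywhere; a three-apex `K_N`-cell is level with a floor letter -/

theorem not_KP_of_apex3 {h : ℤ} {C : MConfig} (hU : C.InDiamond h) {P : MCell} (hP : P ∈ C.upper) {a b c : Fin 4} (hab : a ≠ b) (hac : a ≠ c)
    (hbc : b ≠ c) (ha : (P a).2 = (0, 0)) (hb : (P b).2 = (0, 0)) (hc : (P c).2 = (0, 0)) : ¬ KP P := by
  have hcc := chargeCount_le_one_of_apex3 hab hac hbc ha hb hc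
  rintro (⟨h3, -⟩ | ⟨h2, -, -⟩ | ⟨-, f, -, hfn⟩)
  · omega
  · omega
  · have := (inDiamond_levels (hU.2 P hP f)).1; omega

theorem not_KN_of_apex4 {Z : MCell} (hall : ∀ f, (Z f).2 = (0, 0)) : ¬ KN Z := by
  have hcc : chargeCount Z = 0 := by
    unfold chargeCount; rw [Finset.card_eq_zero, Finset.filter_eq_empty_iff]; intro f _; exact fun hne => hne (hall f)
  rintro (⟨h2, -⟩ | ⟨-, f, hf, -⟩)
  · omega
  · exact hf (hall f)

/-! ### SPLIT two-apex cells reduce (one clause: the two apexes) -/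

/-- **SPLIT APEXES BELOW** (KERNEL, law-free, every `h`): an `N`-cell with apexes `a ≠ b` at different levels and the other two letters charged is
absent once the one-apex and the four-charged `K_P`-cells are: RULE D at (node `a`, node `b`) drops one or both apexes (a dropped apex keeps its
top), and the outcome keeps two different tops, so it is a non-level `P`-cell with `≥ 3` charged letters — in `K_P`. -/
theorem splitApex_N {h : ℤ} {C : MConfig} (hU : C.InDiamond h) {Z : MCell} (hZ : Z ∈ C.lower) (hD : RuleDMu4N C Z) {a b : Fin 4} (hab : a ≠ b)
    (ha : (Z a).2 = (0, 0)) (hb : (Z b).2 = (0, 0)) (hne : causalTop (Z a) ≠ causalTop (Z b)) (hch : ∀ e, e ≠ a → e ≠ b → (Z e).2 ≠ (0, 0))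
    (h1 : ∀ P ∈ C.upper, KP P → OneApex P → False) (h4 : ∀ P ∈ C.upper, KP P → FourCharged P → False) : False := by
  have hta := causalTop_eq_nodeLevel_of_apex ha
  have htb := causalTop_eq_nodeLevel_of_apex hb
  have hne' : nodeLevel (Z a) ≠ nodeLevel (Z b) := by rw [← hta, ← htb]; exact hne
  obtain ⟨P, hP, hag, hoa, hob, hmv⟩ := edge_nn_outcomes hU hZ hD hab hne'
  -- tops of the `a`- and `b`-slots are kept
  have hTa : causalTop (P a) = causalTop (Z a) := by rcases hoa with e | ⟨-, ht, -⟩ <;> [rw [e]; exact ht]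
  have hTb : causalTop (P b) = causalTop (Z b) := by rcases hob with e | ⟨-, ht, -⟩ <;> [rw [e]; exact ht]
  have hnl : ¬ LevelCell P := fun hl => hne (by rw [← hTa, ← hTb]; exact hl a b)
  have hPe : ∀ e, e ≠ a → e ≠ b → (P e).2 ≠ (0, 0) := fun e h1' h2' => by rw [hag e h1' h2']; exact hch e h1' h2'
  rcases hoa with ea | hda
  · rcases hob with eb | hdb
    · exact hmv.elim (fun hne'' => hne'' ea) (fun hne'' => hne'' eb)
    · -- `b` dropped, `a` still an apex: a one-apex `K_P`-cell
      have hothers : ∀ g, g ≠ a → (P g).2 ≠ (0, 0) := fun g hg => by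
        by_cases hgb : g = b
        · rw [hgb]; exact hdb.1
        · exact hPe g hg hgb
      have ha' : (P a).2 = (0, 0) := by rw [ea]; exact ha
      exact h1 P hP (Or.inl ⟨chargeCount_ge_three hothers, hnl⟩) ⟨a, ha', hothers⟩
  · rcases hob with eb | hdb
    · have hothers : ∀ g, g ≠ b → (P g).2 ≠ (0, 0) := fun g hg => by
        by_cases hga : g = a
        · rw [hga]; exact hda.1
        · exact hPe g hga hg
      have hb' : (P b).2 = (0, 0) := by rw [eb]; exact hb
      exact h1 P hP (Or.inl ⟨chargeCount_ge_three hothers, hnl⟩) ⟨b, hb', hothers⟩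
    · have hfour : FourCharged P := fun g => by
        by_cases hga : g = a
        · rw [hga]; exact hda.1
        by_cases hgb : g = b
        · rw [hgb]; exact hdb.1
        · exact hPe g hga hgb
      exact h4 P hP (Or.inl ⟨by rw [chargeCount_eq_four hfour]; norm_num, hnl⟩) hfour

/-- **SPLIT APEXES ABOVE** (KERNEL, `h` even, law-free): a `K_P`-cell with apexes `a ≠ b` at different levels and the other two letters charged is
absent once the one-apex and the four-charged `K_N`-cells are: such a cell has exactly `2` charged letters and is not level, so `K_P` gives it a charged
letter of node `< 4`; RULE D at (top `a`, top `b`) raises one or both apexes (a raised apex keeps its node), the low charged letter survives, and the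
outcome is in `K_N` (non-level, or level with a node `< 4 ≤ 2·count`). -/
theorem splitApex_P {h : ℤ} (hh : h % 2 = 0) {C : MConfig} (hU : C.InDiamond h) {P : MCell} (hP : P ∈ C.upper) (hD : RuleDMu4P C P)
    (hK : KP P) {a b : Fin 4} (hab : a ≠ b) (ha : (P a).2 = (0, 0)) (hb : (P b).2 = (0, 0)) (hne : causalTop (P a) ≠ causalTop (P b))
    (hch : ∀ e, e ≠ a → e ≠ b → (P e).2 ≠ (0, 0))
    (h1 : ∀ N ∈ C.lower, KN N → OneApex N → False) (h4 : ∀ N ∈ C.lower, KN N → FourCharged N → False) : False := by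
  -- the low charged letter
  have hcc2 : chargeCount P ≤ 2 := chargeCount_le_two_of_apex2 hab ha hb
  have hnlP : ¬ LevelCell P := fun hl => hne (hl a b)
  obtain ⟨f, hfc, hfn⟩ : ∃ f, (P f).2 ≠ (0, 0) ∧ nodeLevel (P f) < 4 := by
    rcases hK with ⟨h3, -⟩ | ⟨-, -, f, hf, hfn⟩ | ⟨hl, -⟩
    · omega
    · exact ⟨f, hf, hfn⟩
    · exact (hnlP hl).elim
  have hfa : f ≠ a := fun e => hfc (by rw [e]; exact ha)
  have hfb : f ≠ b := fun e => hfc (by rw [e]; exact hb)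
  obtain ⟨N, hN, hag, hoa, hob, hmv⟩ := edge_tt_outcomes_P hh hU hP hD hab hne
  have hNf : N f = P f := hag f hfa hfb
  have hNe : ∀ e, e ≠ a → e ≠ b → (N e).2 ≠ (0, 0) := fun e h1' h2' => by rw [hag e h1' h2']; exact hch e h1' h2'
  -- membership in `K_N` of any outcome with `≥ 2` ... we only need: count `c ≥ 3` and the low letter `f`
  have hKN : ∀ c : ℕ, chargeCount N = c → 3 ≤ c → KN N := fun c hc h3 => by
    by_cases hl : LevelCell N
    · exact Or.inr ⟨hl, f, by rw [hNf]; exact hfc, by rw [hNf, hc]; omega⟩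
    · exact Or.inl ⟨by rw [hc]; omega, hl⟩
  rcases hoa with ea | hra
  · rcases hob with eb | hrb
    · exact hmv.elim (fun hne'' => hne'' ea) (fun hne'' => hne'' eb)
    · have hothers : ∀ g, g ≠ a → (N g).2 ≠ (0, 0) := fun g hg => by
        by_cases hgb : g = b
        · rw [hgb]; exact hrb.1
        · exact hNe g hg hgb
      have ha' : (N a).2 = (0, 0) := by rw [ea]; exact ha
      have h3 := chargeCount_ge_three hothers
      have h3' := chargeCount_le_three_of_apex ha'
      exact h1 N hN (hKN 3 (by omega) le_rfl) ⟨a, ha', hothers⟩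
  · rcases hob with eb | hrb
    · have hothers : ∀ g, g ≠ b → (N g).2 ≠ (0, 0) := fun g hg => by
        by_cases hga : g = a
        · rw [hga]; exact hra.1
        · exact hNe g hga hg
      have hb' : (N b).2 = (0, 0) := by rw [eb]; exact hb
      have h3 := chargeCount_ge_three hothers
      have h3' := chargeCount_le_three_of_apex hb'
      exact h1 N hN (hKN 3 (by omega) le_rfl) ⟨b, hb', hothers⟩
    · have hfour : FourCharged N := fun g => by
        by_cases hga : g = a
        · rw [hga]; exact hra.1
        by_cases hgb : g = b
        · rw [hgb]; exact hrb.1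
        · exact hNe g hga hgb
      exact h4 N hN (hKN 4 (chargeCount_eq_four hfour) (by norm_num)) hfour

/-! ### THREE-apex `K_N`-cells reduce to twin-apex `K_P`-cells -/

/-- **THREE APEXES BELOW** (KERNEL, law-free, every `h`): a `K_N`-cell with three apex letters is LEVEL (count `≤ 1` forbids the non-level branch), so
its fourth letter `x` is charged with node `< 2`, i.e. on the floor, and the three apexes sit at its top; RULE D at (node `x`, node `a`) cannot lower
`x` (node `0`), so it drops the apex `a` keeping its top: the outcome is a LEVEL `P`-cell with twin apexes `b, c`, two charged letters and the floor
letter `x` of node `0 < 2 = 2·2 − 2` — a twin-apex `K_P`-cell. -/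
theorem threeApex_N {h : ℤ} {C : MConfig} (hU : C.InDiamond h) {Z : MCell} (hZ : Z ∈ C.lower) (hD : RuleDMu4N C Z) (hK : KN Z)
    {a b c x : Fin 4} (hab : a ≠ b) (hac : a ≠ c) (hbc : b ≠ c) (hxa : x ≠ a) (hxb : x ≠ b) (hxc : x ≠ c)
    (ha : (Z a).2 = (0, 0)) (hb : (Z b).2 = (0, 0)) (hc : (Z c).2 = (0, 0))
    (hT : ∀ P ∈ C.upper, KP P → TwinApex P → False) : False := by
  have hcc := chargeCount_le_one_of_apex3 hab hac hbc ha hb hc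
  -- `Z` is level and `x` is the charged floor letter
  obtain ⟨hl, hxc', hxn⟩ : LevelCell Z ∧ (Z x).2 ≠ (0, 0) ∧ nodeLevel (Z x) < 2 := by
    rcases hK with ⟨h2, -⟩ | ⟨hl, f, hf, hfn⟩
    · omega
    · have hfx : f = x := by
        by_contra hfx
        have hfa : f ≠ a := fun e => hf (by rw [e]; exact ha)
        have hfb : f ≠ b := fun e => hf (by rw [e]; exact hb)
        have hfc : f ≠ c := fun e => hf (by rw [e]; exact hc)
        -- five distinct indices in `Fin 4`
        have : ({f, x, a, b, c} : Finset (Fin 4)).card ≤ 4 := (Finset.card_le_univ _).trans (by simp)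
        rw [Finset.card_insert_of_notMem (by simp [hfx, hfa, hfb, hfc]), Finset.card_insert_of_notMem (by simp [hxa, hxb, hxc]),
          Finset.card_insert_of_notMem (by simp [hab, hac]), Finset.card_pair hbc] at this
        omega
      subst hfx
      exact ⟨hl, hf, by omega⟩
  have hx0 := (inDiamond_levels (hU.1 Z hZ x)).1
  have hxpar := (inDiamond_levels (hU.1 Z hZ x)).2.1
  have hxnode : nodeLevel (Z x) = 0 := by omega
  have hta := causalTop_eq_nodeLevel_of_apex ha
  have hcx : 0 < absCharge (Z x) := absCharge_pos_of_not_isApex (hU.1 Z hZ x).1 (not_isApex_of_snd_ne hxc')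
  have hne : nodeLevel (Z x) ≠ nodeLevel (Z a) := by
    have := hl x a; have := causalTop_eq (Z x); omega
  obtain ⟨P, hP, hag, hox, hoa, hmv⟩ := edge_nn_outcomes hU hZ hD hxa hne
  -- `x` cannot be lowered
  have hPx : P x = Z x := by
    rcases hox with e | ⟨-, -, hlt⟩
    · exact e
    · have := (inDiamond_levels (hU.2 P hP x)).1; omega
  rcases hoa with ea | hda
  · exact hmv.elim (fun hne'' => hne'' hPx) (fun hne'' => hne'' ea)
  -- the outcome: twin apexes `b, c`, charged `a'` and `x`, level, floor letter `x`
  have hPb : P b = Z b := hag b (Ne.symm hxb) hab.symm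
  have hPc : P c = Z c := hag c (Ne.symm hxc) hac.symm
  have hPb0 : (P b).2 = (0, 0) := by rw [hPb]; exact hb
  have hPc0 : (P c).2 = (0, 0) := by rw [hPc]; exact hc
  have hPbc : causalTop (P b) = causalTop (P c) := by rw [hPb, hPc]; exact hl b c
  have hPothers : ∀ e, e ≠ b → e ≠ c → (P e).2 ≠ (0, 0) := fun e heb hec => by
    by_cases hex : e = x
    · rw [hex, hPx]; exact hxc'
    · have hea : e = a := by
        by_contra hea
        have : ({e, x, a, b, c} : Finset (Fin 4)).card ≤ 4 := (Finset.card_le_univ _).trans (by simp)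
        rw [Finset.card_insert_of_notMem (by simp [hex, hea, heb, hec]), Finset.card_insert_of_notMem (by simp [hxa, hxb, hxc]),
          Finset.card_insert_of_notMem (by simp [hab, hac]), Finset.card_pair hbc] at this
        omega
      rw [hea]; exact hda.1
  have htwin : TwinApex P := ⟨b, c, hbc, hPb0, hPc0, hPbc, hPothers⟩
  have hlevP : LevelCell P := by
    refine (levelCell_iff_of_tops (P := P) (Z := Z) fun g => ?_).2 hl
    by_cases hgx : g = x
    · rw [hgx, hPx]
    by_cases hga : g = a
    · rw [hga]; exact hda.2.1
    · rw [hag g hgx hga]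
  have hccP : chargeCount P = 2 := by
    have h2 : 2 ≤ chargeCount P := two_le_chargeCount_of_charged2 hxa (by rw [hPx]; exact hxc') hda.1
    have h2' := chargeCount_le_two_of_apex2 hbc hPb0 hPc0
    omega
  exact hT P hP (Or.inr (Or.inr ⟨hlevP, x, by rw [hPx]; exact hxc', by rw [hPx, hccP]; push_cast; omega⟩)) htwin

/-! ### the apex strata exhaust all cells; `K` ⟺ its one-apex and twin-apex strata -/

theorem exists_fourth (a b c : Fin 4) : ∃ x : Fin 4, x ≠ a ∧ x ≠ b ∧ x ≠ c := by
  revert a b c; decide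

/-- every cell is four-charged, one-apex, twin-apex, split-apex, or has three distinct apex letters. -/
theorem apex_strata (Z : MCell) : FourCharged Z ∨ OneApex Z ∨ TwinApex Z ∨ SplitApex Z ∨
    ∃ a b c : Fin 4, a ≠ b ∧ a ≠ c ∧ b ≠ c ∧ (Z a).2 = (0, 0) ∧ (Z b).2 = (0, 0) ∧ (Z c).2 = (0, 0) := by
  classical
  set A : Finset (Fin 4) := Finset.univ.filter (fun f : Fin 4 => (Z f).2 = (0, 0)) with hA
  have hmem : ∀ f, f ∈ A ↔ (Z f).2 = (0, 0) := fun f => by simp [hA]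
  rcases Nat.lt_or_ge A.card 3 with hlt | hge
  · interval_cases hc : A.card
    · left; intro f hf
      have hf' : f ∈ A := (hmem f).2 hf
      rw [Finset.card_eq_zero] at hc; rw [hc] at hf'; simp at hf'
    · obtain ⟨a, ha⟩ := Finset.card_eq_one.1 hc
      right; left
      refine ⟨a, (hmem a).1 (by rw [ha]; simp), fun g hg hg0 => ?_⟩
      have hg' : g ∈ A := (hmem g).2 hg0
      rw [ha, Finset.mem_singleton] at hg'; exact hg hg'
    · obtain ⟨a, b, hab, hAab⟩ := Finset.card_eq_two.1 hc
      have ha : (Z a).2 = (0, 0) := (hmem a).1 (by rw [hAab]; simp)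
      have hb : (Z b).2 = (0, 0) := (hmem b).1 (by rw [hAab]; simp)
      have hothers : ∀ e, e ≠ a → e ≠ b → (Z e).2 ≠ (0, 0) := fun e hea heb he0 => by
        have he' : e ∈ A := (hmem e).2 he0
        rw [hAab, Finset.mem_insert, Finset.mem_singleton] at he'; tauto
      rcases eq_or_ne (causalTop (Z a)) (causalTop (Z b)) with ht | ht
      · right; right; left; exact ⟨a, b, hab, ha, hb, ht, hothers⟩
      · right; right; right; left; exact ⟨a, b, hab, ha, hb, ht, hothers⟩
  · right; right; right; right
    obtain ⟨B, hBA, hB3⟩ := Finset.exists_subset_card_eq hge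
    obtain ⟨a, b, c, hab, hac, hbc, hB⟩ := Finset.card_eq_three.1 hB3
    exact ⟨a, b, c, hab, hac, hbc, (hmem a).1 (hBA (by rw [hB]; simp)), (hmem b).1 (hBA (by rw [hB]; simp)),
      (hmem c).1 (hBA (by rw [hB]; simp))⟩

/-- **THE `K`-PEEL IS ITS ONE-APEX AND TWIN-APEX STRATA** (KERNEL, every even `h`, law-free).  Under RULE D alone, the `K`-cells of a
configuration in `◇_h` are absent as soon as its ONE-APEX `K`-cells (one apex letter, three charged) and its TWIN-APEX `K`-cells (two apex letters at
the same level, two charged) are: the four-charged stratum follows from the interface one-apex cells (`fourChargedK_absent_of_interface`, the `Θ` key of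
§9f), the split-two-apex stratum from the one-apex and four-charged ones (`splitApex_N`, `splitApex_P`), the three-apex `K_N`-cells from the twin-apex
`K_P`-cells (`threeApex_N`), and no other `K`-cell exists (`not_KP_of_apex3`, `not_KN_of_apex4`).  This is the all-`h` form of the census row
"base one-apex ∪ twin-apex ⟹ all of `K`" of the `K`-core tables (`h = 8, 10`); the one-apex and twin-apex strata themselves are NOT reduced here — they
are where laws beyond RULE D must enter. -/
theorem kAbsent_iff_oneApex_twinApex {h : ℤ} (hh : h % 2 = 0) {C : MConfig} (hU : C.InDiamond h) (hD : RuleDMu4Closed C) :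
    KAbsent C ↔ OneApexKAbsent C ∧ TwinApexKAbsent C := by
  refine ⟨fun hK => ⟨⟨fun Z hZ hKZ _ => hK.1 Z hZ hKZ, fun P hP hKP _ => hK.2 P hP hKP⟩,
    ⟨fun Z hZ hKZ _ => hK.1 Z hZ hKZ, fun P hP hKP _ => hK.2 P hP hKP⟩⟩, fun ⟨h1, hT⟩ => ?_⟩
  have hI : InterfaceKAbsent C :=
    ⟨fun Z hZ hK ⟨f, hf, hg⟩ => h1.1 Z hZ hK ⟨f, hf, fun g hg' => (hg g hg').1⟩,
     fun P hP hK ⟨f, hf, hg⟩ => h1.2 P hP hK ⟨f, hf, fun g hg' => (hg g hg').1⟩⟩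
  have h4 := fourChargedK_absent_of_interface hh hU hD hI
  refine ⟨fun Z hZ hK => ?_, fun P hP hK => ?_⟩
  · rcases apex_strata Z with hfc | hone | htwin | ⟨a, b, hab, ha, hb, hne, hch⟩ | ⟨a, b, c, hab, hac, hbc, ha, hb, hc⟩
    · exact h4.1 Z hZ hK hfc
    · exact h1.1 Z hZ hK hone
    · exact hT.1 Z hZ hK htwin
    · exact splitApex_N hU hZ (hD.1 Z hZ) hab ha hb hne hch h1.2 h4.2
    · obtain ⟨x, hxa, hxb, hxc⟩ := exists_fourth a b c
      exact threeApex_N hU hZ (hD.1 Z hZ) hK hab hac hbc hxa hxb hxc ha hb hc hT.2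
  · rcases apex_strata P with hfc | hone | htwin | ⟨a, b, hab, ha, hb, hne, hch⟩ | ⟨a, b, c, hab, hac, hbc, ha, hb, hc⟩
    · exact h4.2 P hP hK hfc
    · exact h1.2 P hP hK hone
    · exact hT.2 P hP hK htwin
    · exact splitApex_P hh hU hP (hD.2 P hP) hK hab ha hb hne hch h1.1 h4.1
    · exact (not_KP_of_apex3 hU hP hab hac hbc ha hb hc hK).elim

/-- corollary: the three absence statements — `KAbsent`, interface + non-interface apex (`kAbsent_iff_interface`), one-apex + twin-apex — are one. -/
theorem oneApex_twinApex_iff_interface {h : ℤ} (hh : h % 2 = 0) {C : MConfig} (hU : C.InDiamond h) (hD : RuleDMu4Closed C) :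
    (OneApexKAbsent C ∧ TwinApexKAbsent C) ↔ (InterfaceKAbsent C ∧ NonInterfaceApexKAbsent C) := by
  rw [← kAbsent_iff_oneApex_twinApex hh hU hD, kAbsent_iff_interface hh hU hD]
/-! ## §9i The ONE-APEX `K`-stratum: an `h`-uniform RULE-D rulebook down to three explicit families (v12)

By §9h (`kAbsent_iff_oneApex_twinApex`) the whole `K`-peel is its one-apex ∪ twin-apex stratum.  This section orients the ONE-APEX stratum itself by
`K`-internal RULE D, `h`-uniformly and law-free, with the LEXICOGRAPHIC key (fewer letters of causal top `≤` the apex level FIRST, then the pairwise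
spread Ψ = `pairSpread`), packaged as the integer `oneKey h X f = (8h+1)·(4 − lowTops X f) + Ψ X`: every one-apex `K`-cell outside three explicit
families has a RULE-D clause ALL of whose outcomes are four-charged `K`-cells (absent given the interface, §9g), interface cells, twin-apex `K_N`-cells,
or one-apex `K`-cells of STRICTLY LARGER key — rules NA ∕ NB below (`oneApex_N`), PA ∕ PT ∕ PB1 ∕ PB2 above (`oneApex_P`).  The three families:
 * (A₃ᴵ) the INTERFACE (`InterfaceKAbsent`: high-one-apex `K_N`-cells, low-one-apex `K_P`-cells);
 * the TWIN-APEX `K`-cells (`TwinApexKAbsent`, §9h);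
 * (F1) the NODE-FLAT one-apex `K_N`-cells (`F1Absent`: the apex and the three charged nodes on one level — these have NO `K`-closed RULE-D clause at
   all, census family B₀).
Ψ alone does NOT orient the rule PB2 (apex at `α`, two charged letters of causal top exactly `α`, one below: at `h = 22` the head
`{O₂₀, (6,20), (6,20), (16,18)}` has no Ψ-good `K`-closed clause, hub-local census `data/k3rules_h22.txt` of the g16 folder); the first component of the
key does — the clause (node `y`, top `p`) at a top-`α` letter `y` leaves, besides interface ∕ twin-apex ∕ four-charged outcomes, only one-apex cells with a
charged causal top strictly ABOVE the apex, i.e. with fewer letters of top `≤ α`.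
THEOREMS (KERNEL, every even `h`, law-free): `oneApexK_absent_of_core` and
  `kAbsent_iff_core : KAbsent C ↔ InterfaceKAbsent C ∧ TwinApexKAbsent C ∧ F1Absent C`
for RULE-D-closed `◇_h` configurations — at `h = 8` exactly the hub-local census row «lfp(I ∪ twin ∪ F1) = all 5 177 `K`-shapes of ◇₈»
(`data/k3_h8.txt`), now a theorem at every even `h`.  Rulebook census (engine `tools/k3rules3.py`): 0 failures, 0 residual heads over all
1 182 ∕ 4 467 ∕ 13 687 ∕ 35 996 ∕ 84 276 ∕ 180 069 ∕ 357 379 ∕ 667 458 ∕ 1 184 690 ∕ 2 013 687 one-apex non-base `K`-heads of `h = 8, …, 26` — the theorems below make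
the census unnecessary.  NOT proved here (displayed hypotheses): the absence of the three families, hence (A₃), (T_h), H2, HC_CM-conditional or not, HC. -/

/-- (F1) a NODE-FLAT one-apex cell: one apex letter, the three others charged with node EQUAL to the apex level. -/
def FlatApexN (Z : MCell) : Prop := ∃ f, (Z f).2 = (0, 0) ∧ ∀ g, g ≠ f → (Z g).2 ≠ (0, 0) ∧ nodeLevel (Z g) = nodeLevel (Z f)

/-- (F1) no node-flat one-apex `K_N`-cell. -/
def F1Absent (C : MConfig) : Prop := ∀ Z ∈ C.lower, KN Z → FlatApexN Z → False

/-- the number of letters whose causal top is `≤` the causal top of the letter `f` (for a one-apex cell and its apex `f`: the letters not reaching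
strictly above the apex level; the apex itself counts). -/
def lowTops (X : MCell) (f : Fin 4) : ℕ := (Finset.univ.filter fun e => causalTop (X e) ≤ causalTop (X f)).card

/-- the one-apex KEY: lexicographic (`4 − lowTops` first, Ψ second) packed into one integer with the weight `8h + 1 > Ψ`. -/
def oneKey (h : ℤ) (X : MCell) (f : Fin 4) : ℤ := (8 * h + 1) * (4 - (lowTops X f : ℤ)) + pairSpread X

theorem lowTops_le_four (X : MCell) (f : Fin 4) : lowTops X f ≤ 4 := by
  unfold lowTops
  calc _ ≤ Finset.univ.card := Finset.card_filter_le _ _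
    _ = 4 := by simp

theorem one_le_lowTops (X : MCell) (f : Fin 4) : 1 ≤ lowTops X f := by
  unfold lowTops
  exact Finset.card_pos.2 ⟨f, Finset.mem_filter.2 ⟨Finset.mem_univ f, le_rfl⟩⟩

theorem lowTops_congr {X Y : MCell} {f : Fin 4} (hc : ∀ e, causalTop (X e) ≤ causalTop (X f) ↔ causalTop (Y e) ≤ causalTop (Y f)) :
    lowTops X f = lowTops Y f := by
  unfold lowTops
  congr 1
  exact Finset.filter_congr fun e _ => hc e

/-- if every letter of `Y` has causal top `≤` that of `g`, while some letter of `X` reaches strictly above that of `f`, then `X, f` has fewer low tops. -/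
theorem lowTops_lt_of_escape {X Y : MCell} {f g : Fin 4} (hall : ∀ e, causalTop (Y e) ≤ causalTop (Y g)) {e : Fin 4}
    (he : causalTop (X f) < causalTop (X e)) : lowTops X f < lowTops Y g := by
  unfold lowTops
  apply Finset.card_lt_card
  rw [Finset.ssubset_iff_subset_ne]
  refine ⟨fun a _ => Finset.mem_filter.2 ⟨Finset.mem_univ a, hall a⟩, fun heq => ?_⟩
  have hm : e ∈ Finset.univ.filter (fun a => causalTop (X a) ≤ causalTop (X f)) := by
    rw [heq]; exact Finset.mem_filter.2 ⟨Finset.mem_univ e, hall e⟩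
  have := (Finset.mem_filter.1 hm).2
  omega

theorem oneKey_lt_of_psi {h : ℤ} {X Y : MCell} {f g : Fin 4} (hl : lowTops X f = lowTops Y g) (hψ : pairSpread X < pairSpread Y) :
    oneKey h X f < oneKey h Y g := by
  unfold oneKey; rw [hl]; linarith

theorem oneKey_lt_of_lowTops {h : ℤ} {X Y : MCell} (hX : MCell.InDiamond h X) {f g : Fin 4} (hl : lowTops Y g < lowTops X f) :
    oneKey h X f < oneKey h Y g := by
  have h1 := pairSpread_le hX
  have h2 := pairSpread_nonneg X
  have h3 := pairSpread_nonneg Y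
  have h8 : (0 : ℤ) ≤ 8 * h + 1 := by omega
  have hl' : (1 : ℤ) ≤ (lowTops X f : ℤ) - lowTops Y g := by omega
  have e1 : (8 * h + 1) * (4 - (lowTops Y g : ℤ)) = (8 * h + 1) * (4 - (lowTops X f : ℤ)) + (8 * h + 1) * ((lowTops X f : ℤ) - lowTops Y g) := by
    ring
  have e2 := mul_le_mul_of_nonneg_left hl' h8
  unfold oneKey; rw [e1]; linarith

theorem oneKey_nonneg {h : ℤ} {X : MCell} (hX : MCell.InDiamond h X) (f : Fin 4) : 0 ≤ oneKey h X f := by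
  have h1 := pairSpread_le hX
  have h2 := pairSpread_nonneg X
  have h4 : (lowTops X f : ℤ) ≤ 4 := by exact_mod_cast lowTops_le_four X f
  have : (0 : ℤ) ≤ (8 * h + 1) * (4 - (lowTops X f : ℤ)) := mul_nonneg (by omega) (by omega)
  unfold oneKey; linarith

theorem oneKey_le {h : ℤ} {X : MCell} (hX : MCell.InDiamond h X) (f : Fin 4) : oneKey h X f ≤ (8 * h + 1) * 3 + 8 * h := by
  have h1 := pairSpread_le hX
  have h2 := pairSpread_nonneg X
  have h3 : (1 : ℤ) ≤ lowTops X f := by exact_mod_cast one_le_lowTops X f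
  have := mul_le_mul_of_nonneg_left (show 4 - (lowTops X f : ℤ) ≤ 3 by omega) (show (0 : ℤ) ≤ 8 * h + 1 by omega)
  unfold oneKey; linarith

/-- induction hypothesis of the key-descent on the one-apex stratum: the one-apex `K`-cells (cell, apex letter) of key `> k` are absent. -/
def OneApexKeyAbove (h : ℤ) (C : MConfig) (k : ℤ) : Prop :=
  (∀ Z ∈ C.lower, KN Z → ∀ f, (Z f).2 = (0, 0) → (∀ g, g ≠ f → (Z g).2 ≠ (0, 0)) → k < oneKey h Z f → False) ∧
    (∀ P ∈ C.upper, KP P → ∀ f, (P f).2 = (0, 0) → (∀ g, g ≠ f → (P g).2 ≠ (0, 0)) → k < oneKey h P f → False)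

theorem node_lt_top_lower {h : ℤ} {C : MConfig} (hU : C.InDiamond h) {Z : MCell} (hZ : Z ∈ C.lower) {g : Fin 4} (hgc : (Z g).2 ≠ (0, 0)) :
    nodeLevel (Z g) < causalTop (Z g) := by
  have := two_mul_absCharge (Z g)
  have := absCharge_pos_of_not_isApex (hU.1 Z hZ g).1 (not_isApex_of_snd_ne hgc)
  omega

theorem node_lt_top_upper {h : ℤ} {C : MConfig} (hU : C.InDiamond h) {P : MCell} (hP : P ∈ C.upper) {g : Fin 4} (hgc : (P g).2 ≠ (0, 0)) :
    nodeLevel (P g) < causalTop (P g) := by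
  have := two_mul_absCharge (P g)
  have := absCharge_pos_of_not_isApex (hU.2 P hP g).1 (not_isApex_of_snd_ne hgc)
  omega

/-- **ONE APEX BELOW — rules NA ∕ NB** (KERNEL, law-free, every `h`).  A one-apex `K_N`-cell `Z ∈ C.lower` (apex `p` at level `α`) that is not
interface (high-one-apex) and not node-flat is served by RULE D at two NODES: (NA) if the minimal charged node `n_g < α`, at (node `p`, node `g`) —
`g` is then the global node-minimum, so dropping `g` by `d` gives a one-apex non-level `K_P`-cell of Ψ larger by `3d`, and dropping `p` gives a
four-charged non-level `K_P`-cell; (NB) if every charged node is `≥ α` (and one, `j`, is `≠ α`), at (node `p`, node `j`) — dropping `j` keeps the apex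
strictly below every charged causal top: a LOW-one-apex `K_P`-cell (interface); dropping `p`: four-charged again.  (Causal tops never move at a
node clause, so `lowTops` is unchanged and the key rises with Ψ.) -/
theorem oneApex_N {h : ℤ} {C : MConfig} (hU : C.InDiamond h) {Z : MCell} (hZ : Z ∈ C.lower) (hD : RuleDMu4N C Z) (hK : KN Z)
    {p : Fin 4} (hp : (Z p).2 = (0, 0)) (hch : ∀ g, g ≠ p → (Z g).2 ≠ (0, 0))
    (hI : InterfaceKAbsent C) (hF : F1Absent C) (h4 : ∀ P ∈ C.upper, KP P → FourCharged P → False)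
    (hup : ∀ P ∈ C.upper, KP P → ∀ f, (P f).2 = (0, 0) → (∀ g, g ≠ f → (P g).2 ≠ (0, 0)) → oneKey h Z p < oneKey h P f → False) :
    False := by
  have htp := causalTop_eq_nodeLevel_of_apex hp
  -- a level one-apex `N`-cell is high-one-apex: interface
  by_cases hl : LevelCell Z
  · exact hI.1 Z hZ hK ⟨p, hp, fun e he => ⟨hch e he, by
      have := node_lt_top_lower hU hZ (hch e he); have := hl e p; omega⟩⟩
  -- the served outcome of RULE D at (node `p`, node `j`), unless it is four-charged (then it is absent outright)
  have main : ∀ j, j ≠ p → nodeLevel (Z p) ≠ nodeLevel (Z j) →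
      ∃ P ∈ C.upper, KP P ∧ (∀ f, causalTop (P f) = causalTop (Z f)) ∧ (P p).2 = (0, 0) ∧ (∀ e, e ≠ p → (P e).2 ≠ (0, 0)) ∧
        (∀ e, e ≠ j → P e = Z e) ∧ DropOf (Z j) (P j) := by
    intro j hjp hne
    obtain ⟨P, hP, hag, hop, hoj, hmv⟩ := edge_nn_outcomes hU hZ hD (Ne.symm hjp) hne
    have hTp : causalTop (P p) = causalTop (Z p) := by rcases hop with e | ⟨-, ht, -⟩ <;> [rw [e]; exact ht]
    have hTj : causalTop (P j) = causalTop (Z j) := by rcases hoj with e | ⟨-, ht, -⟩ <;> [rw [e]; exact ht]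
    have hT : ∀ f, causalTop (P f) = causalTop (Z f) := fun f => by
      by_cases hfp : f = p
      · rw [hfp]; exact hTp
      by_cases hfj : f = j
      · rw [hfj]; exact hTj
      · rw [hag f hfp hfj]
    have hnl : ¬ LevelCell P := fun hl' => hl ((levelCell_iff_of_tops hT).1 hl')
    have hjc : (P j).2 ≠ (0, 0) := by
      rcases hoj with e | hd
      · rw [e]; exact hch j hjp
      · exact hd.1
    have hothers : ∀ e, e ≠ p → (P e).2 ≠ (0, 0) := fun e he => by
      by_cases hej : e = j
      · rw [hej]; exact hjc
      · rw [hag e he hej]; exact hch e he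
    rcases hop with ep | hdp
    · rcases hoj with ej | hdj
      · exact (hmv.elim (fun hne' => hne' ep) (fun hne' => hne' ej)).elim
      · refine ⟨P, hP, Or.inl ⟨chargeCount_ge_three hothers, hnl⟩, hT, by rw [ep]; exact hp, hothers, fun e hej => ?_, hdj⟩
        by_cases hep : e = p
        · rw [hep, ep]
        · exact hag e hep hej
    · -- `p` dropped: a four-charged non-level `K_P`-cell, absent
      have hfour : FourCharged P := fun f => by
        by_cases hfp : f = p
        · rw [hfp]; exact hdp.1
        · exact hothers f hfp
      exact (h4 P hP (Or.inl ⟨by rw [chargeCount_eq_four hfour]; norm_num, hnl⟩) hfour).elim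
  -- the charged letter of minimal node
  obtain ⟨g, hgp, hg⟩ := exists_min_ne (fun f => nodeLevel (Z f)) p
  have hgmin : ∀ e, e ≠ p → nodeLevel (Z g) ≤ nodeLevel (Z e) := hg
  by_cases hA : nodeLevel (Z g) < nodeLevel (Z p)
  · -- RULE NA: `g` is the global node-minimum; it drops by `d` and Ψ rises by `3d`
    obtain ⟨P, hP, hKP, hT, hp', hothers, hPe, hdg⟩ := main g hgp (by omega)
    refine hup P hP hKP p hp' hothers (oneKey_lt_of_psi (lowTops_congr fun e => by rw [hT e, hT p]).symm ?_)
    have ht : spreadOf (fun f => causalTop (P f)) = spreadOf (fun f => causalTop (Z f)) := by simp only [hT]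
    have hn : spreadOf (fun f => nodeLevel (P f)) = spreadOf (fun f => nodeLevel (Z f)) + 3 * (nodeLevel (Z g) - nodeLevel (P g)) := by
      refine spreadOf_lower_min (v := fun f => nodeLevel (Z f)) (w := fun f => nodeLevel (P f)) (y := g) ?_ ?_ (le_of_lt hdg.2.2)
      · intro e; show nodeLevel (Z g) ≤ nodeLevel (Z e)
        by_cases hep : e = p
        · rw [hep]; exact le_of_lt hA
        · exact hgmin e hep
      · intro e he; show nodeLevel (P e) = nodeLevel (Z e); rw [hPe e he]
    have := hdg.2.2; unfold pairSpread; omega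
  · -- every charged node `≥ α`
    push Not at hA
    by_cases hF1 : ∀ e, e ≠ p → nodeLevel (Z e) = nodeLevel (Z p)
    · exact hF Z hZ hK ⟨p, hp, fun e he => ⟨hch e he, hF1 e he⟩⟩
    push Not at hF1
    obtain ⟨j, hjp, hjne⟩ := hF1
    -- RULE NB: `j` drops, the apex stays strictly below every charged causal top: a low-one-apex `K_P`-cell
    obtain ⟨P, hP, hKP, hT, hp', hothers, hPe, -⟩ := main j hjp (Ne.symm hjne)
    refine hI.2 P hP hKP ⟨p, hp', fun e he => ⟨hothers e he, ?_⟩⟩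
    rw [hT e, hPe p (Ne.symm hjp)]
    have := hgmin e he; have := node_lt_top_lower hU hZ (hch e he); omega

/-- **ONE APEX ABOVE — rules PA ∕ PT ∕ PB1 ∕ PB2** (KERNEL, `h` even, law-free).  A one-apex `K_P`-cell `P ∈ C.upper` (apex `p` at level `α`)
that is not interface (low-one-apex) is served by RULE D: (PA) if the maximal charged causal top `M > α`, at (top `p`, top `g_M`) — raising `g_M` by `d`
gives a one-apex non-level `K_N`-cell of the same `lowTops` and Ψ larger by `3d`, raising `p` a four-charged non-level one (a letter of top `≤ α`
survives); (PT) if every charged causal top is `α` (`P` level, so ((CD-P)) gives a charged node `< 4`), at (node `g_x`, top `p`) with `g_x` the charged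
letter of maximal node — lifting `g_x` gives a level high-one-apex `K_N`-cell (interface) or, at the apex, a level TWIN-APEX `K_N`-cell; the jump of
`g_x` over its top and the raise of `p` with `g_x` lifted to the apex give one-apex non-level `K_N`-cells with FEWER letters of top `≤ α` (larger key);
everything else is four-charged non-level; (PB) if the minimal charged causal top `t_m < α`: (PB2) when the two other charged tops are exactly `α`, at
(node `y`, top `p`) for one of them, `y` — `y` lifted: high-one-apex non-level `K_N` (interface) or, at the apex, a non-level TWIN-APEX `K_N`-cell; `y`
over its top, or `p` raised with `y` lifted to the apex: one-apex non-level `K_N`-cells with fewer letters of top `≤ α`; the rest four-charged; (PB1)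
otherwise, at (top `p`, top `g_m`) — raising `g_m` gives a high-one-apex NON-LEVEL `K_N`-cell (a third letter keeps a top `< α` or `g_m` passes `α`),
raising `p` a four-charged non-level cell. -/
theorem oneApex_P {h : ℤ} (hh : h % 2 = 0) {C : MConfig} (hU : C.InDiamond h) {P : MCell} (hP : P ∈ C.upper) (hD : RuleDMu4P C P)
    (hK : KP P) {p : Fin 4} (hp : (P p).2 = (0, 0)) (hch : ∀ g, g ≠ p → (P g).2 ≠ (0, 0))
    (hI : InterfaceKAbsent C) (hT : TwinApexKAbsent C) (h4 : ∀ N ∈ C.lower, KN N → FourCharged N → False)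
    (hdn : ∀ N ∈ C.lower, KN N → ∀ f, (N f).2 = (0, 0) → (∀ g, g ≠ f → (N g).2 ≠ (0, 0)) → oneKey h P p < oneKey h N f → False) :
    False := by
  have htp := causalTop_eq_nodeLevel_of_apex hp
  have hcc3 : chargeCount P = 3 := le_antisymm (chargeCount_le_three_of_apex hp) (chargeCount_ge_three hch)
  -- a low-one-apex cell is interface
  by_cases hlow : ∀ e, e ≠ p → nodeLevel (P p) < causalTop (P e)
  · exact hI.2 P hP hK ⟨p, hp, fun e he => ⟨hch e he, hlow e he⟩⟩
  push Not at hlow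
  obtain ⟨t, htp', htle⟩ := hlow
  -- the charged letter of maximal causal top
  obtain ⟨gM, hgMp, hgM⟩ := exists_max_ne (fun f => causalTop (P f)) p
  have hgMmax : ∀ e, e ≠ p → causalTop (P e) ≤ causalTop (P gM) := hgM
  by_cases hPA : nodeLevel (P p) < causalTop (P gM)
  · -- RULE PA: (top `p`, top `gM`)
    have htgM : t ≠ gM := fun e => by rw [e] at htle; omega
    have hne : causalTop (P p) ≠ causalTop (P gM) := by rw [htp]; exact ne_of_lt hPA
    obtain ⟨N, hN, hag, hop, hog, hmv⟩ := edge_tt_outcomes_P hh hU hP hD (Ne.symm hgMp) hne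
    have hNt : N t = P t := hag t htp' htgM
    have hgMc : (N gM).2 ≠ (0, 0) := by
      rcases hog with e | hr
      · rw [e]; exact hch gM hgMp
      · exact hr.1
    have hothers : ∀ e, e ≠ p → (N e).2 ≠ (0, 0) := fun e he => by
      by_cases heg : e = gM
      · rw [heg]; exact hgMc
      · rw [hag e he heg]; exact hch e he
    rcases hop with ep | hrp
    · rcases hog with eg | hrg
      · exact hmv.elim (fun hne' => hne' ep) (fun hne' => hne' eg)
      · -- `gM` raised by `d`: a one-apex non-level `K_N`-cell of Ψ larger by `3d`
        have hnl : ¬ LevelCell N := fun hl => by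
          have := hl t gM; rw [hNt] at this; have := hgMmax t htp'; have := hrg.2.2; omega
        have hp' : (N p).2 = (0, 0) := by rw [ep]; exact hp
        have hlow : lowTops N p = lowTops P p := lowTops_congr fun e => by
          by_cases hep : e = p
          · rw [hep, ep]
          by_cases heg : e = gM
          · rw [heg, ep, htp]; have := hrg.2.2; constructor <;> intro <;> omega
          · rw [hag e hep heg, ep]
        refine hdn N hN (Or.inl ⟨by have := chargeCount_ge_three hothers; omega, hnl⟩) p hp' hothers (oneKey_lt_of_psi hlow.symm ?_)
        have hnn : ∀ f, nodeLevel (N f) = nodeLevel (P f) := fun f => by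
          by_cases hfp : f = p
          · rw [hfp, ep]
          by_cases hfg : f = gM
          · rw [hfg]; exact hrg.2.1
          · rw [hag f hfp hfg]
        have hn : spreadOf (fun f => nodeLevel (N f)) = spreadOf (fun f => nodeLevel (P f)) := by simp only [hnn]
        have ht : spreadOf (fun f => causalTop (N f)) = spreadOf (fun f => causalTop (P f)) + 3 * (causalTop (N gM) - causalTop (P gM)) := by
          refine spreadOf_raise_max (v := fun f => causalTop (P f)) (w := fun f => causalTop (N f)) (y := gM) ?_ ?_ (le_of_lt hrg.2.2)
          · intro e; show causalTop (P e) ≤ causalTop (P gM)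
            by_cases hep : e = p
            · rw [hep, htp]; exact le_of_lt hPA
            · exact hgMmax e hep
          · intro e he; show causalTop (N e) = causalTop (P e)
            by_cases hep : e = p
            · rw [hep, ep]
            · rw [hag e hep he]
        have := hrg.2.2; unfold pairSpread; omega
    · -- `p` raised: four-charged and not level (the letter `t` keeps its top `≤ α`)
      have hfour : FourCharged N := fun f => by
        by_cases hfp : f = p
        · rw [hfp]; exact hrp.1
        · exact hothers f hfp
      have hnl : ¬ LevelCell N := fun hl => by
        have := hl t p; rw [hNt] at this; have := hrp.2.2; omega
      exact h4 N hN (Or.inl ⟨by rw [chargeCount_eq_four hfour]; norm_num, hnl⟩) hfour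
  · -- every charged causal top is `≤ α`, hence every charged node `< α`
    push Not at hPA
    have htops : ∀ e, e ≠ p → causalTop (P e) ≤ nodeLevel (P p) := fun e he => le_trans (hgMmax e he) hPA
    have hnodes : ∀ e, e ≠ p → nodeLevel (P e) < nodeLevel (P p) := fun e he =>
      lt_of_lt_of_le (node_lt_top_upper hU hP (hch e he)) (htops e he)
    -- the charged letter of minimal causal top
    obtain ⟨gm, hgmp, hgm⟩ := exists_min_ne (fun f => causalTop (P f)) p
    have hgmmin : ∀ e, e ≠ p → causalTop (P gm) ≤ causalTop (P e) := hgm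
    by_cases hPT : causalTop (P gm) = nodeLevel (P p)
    · -- RULE PT: every causal top is `α`; `P` is level, so ((CD-P)) gives a charged letter of node `< 4`
      have hall : ∀ e, causalTop (P e) = nodeLevel (P p) := fun e => by
        by_cases hep : e = p
        · rw [hep]; exact htp
        · exact le_antisymm (htops e hep) (by rw [← hPT]; exact hgmmin e hep)
      have hl : LevelCell P := fun f g => by rw [hall f, hall g]
      have hallP : ∀ e, causalTop (P e) ≤ causalTop (P p) := fun e => by rw [hall e, htp]
      obtain ⟨f, hfc, hfn⟩ : ∃ f, (P f).2 ≠ (0, 0) ∧ nodeLevel (P f) < 4 := by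
        rcases hK with ⟨-, hnl⟩ | ⟨h2, -, -⟩ | ⟨-, f, hf, hfn⟩
        · exact (hnl hl).elim
        · omega
        · exact ⟨f, hf, by rw [hcc3] at hfn; push_cast at hfn; omega⟩
      have hfp : f ≠ p := fun e => hfc (by rw [e]; exact hp)
      -- the charged letter of maximal node
      obtain ⟨gx, hgxp, hgx⟩ := exists_max_ne (fun f => nodeLevel (P f)) p
      have hgxmax : ∀ e, e ≠ p → nodeLevel (P e) ≤ nodeLevel (P gx) := hgx
      have hgxc := hch gx hgxp
      have hne : nodeLevel (P gx) ≠ causalTop (P p) := by rw [htp]; exact ne_of_lt (hnodes gx hgxp)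
      -- a letter `e0 ∉ {p, gx}` of node `< 4`
      obtain ⟨e0, he0p, he0x, he0n⟩ : ∃ e0, e0 ≠ p ∧ e0 ≠ gx ∧ nodeLevel (P e0) < 4 := by
        by_cases hfx : f = gx
        · obtain ⟨e, hep, hex⟩ := exists_third p gx
          exact ⟨e, hep, hex, by have := hgxmax e hep; rw [← hfx] at this; omega⟩
        · exact ⟨f, hfp, hfx, hfn⟩
      obtain ⟨N, hN, hag, hox, hop, hmv⟩ := edge_nt_outcomes_P hh hU hP hD hgxp hgxc hne
      have hNe0 : N e0 = P e0 := hag e0 he0x he0p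
      have he0c : (N e0).2 ≠ (0, 0) := by rw [hNe0]; exact hch e0 he0p
      have hNe : ∀ e, e ≠ gx → e ≠ p → (N e).2 ≠ (0, 0) := fun e h1 h2 => by rw [hag e h1 h2]; exact hch e h2
      have hTe : ∀ e, e ≠ gx → e ≠ p → causalTop (N e) = nodeLevel (P p) := fun e h1 h2 => by rw [hag e h1 h2]; exact hall e
      rcases hop with ep | hrp
      · -- the apex `p` stays
        have hp' : (N p).2 = (0, 0) := by rw [ep]; exact hp
        have hTp : causalTop (N p) = nodeLevel (P p) := by rw [ep]; exact htp
        rcases hox with ex | hlx | hox'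
        · exact hmv.elim (fun hne' => hne' ex) (fun hne' => hne' ep)
        · -- `gx` lifted, top kept `= α`: the outcome is LEVEL
          have hTx : causalTop (N gx) = nodeLevel (P p) := by rw [hlx.1]; exact hall gx
          have hTall : ∀ e, causalTop (N e) = nodeLevel (P p) := fun e => by
            by_cases hex : e = gx
            · rw [hex]; exact hTx
            by_cases hep : e = p
            · rw [hep]; exact hTp
            · exact hTe e hex hep
          have hlN : LevelCell N := fun a b => by rw [hTall a, hTall b]
          by_cases hxa : (N gx).2 = (0, 0)
          · -- lifted to the apex: a level TWIN-APEX cell with the charged letter `e0` of node `< 4 = 2·2`: a twin-apex `K_N`-cell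
            obtain ⟨e1, he1p, he1x, he10⟩ := exists_fourth p gx e0
            have he1c : (N e1).2 ≠ (0, 0) := hNe e1 he1x he1p
            have hcc2 : chargeCount N = 2 :=
              le_antisymm (chargeCount_le_two_of_apex2 (Ne.symm hgxp) hp' hxa) (two_le_chargeCount_of_charged2 (Ne.symm he10) he0c he1c)
            have hKN : KN N := Or.inr ⟨hlN, e0, he0c, by rw [hNe0, hcc2]; push_cast; omega⟩
            exact hT.1 N hN hKN ⟨p, gx, Ne.symm hgxp, hp', hxa, by rw [hTp, hTx], fun e hep hex => hNe e hex hep⟩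
          · -- still charged: a level one-apex cell with `e0` of node `< 4 < 6 = 2·3`, a `K_N`-cell whose charged nodes lie below `α`: interface
            have hothers : ∀ e, e ≠ p → (N e).2 ≠ (0, 0) := fun e he => by
              by_cases hex : e = gx
              · rw [hex]; exact hxa
              · exact hNe e hex he
            have hcc3N : chargeCount N = 3 := le_antisymm (chargeCount_le_three_of_apex hp') (chargeCount_ge_three hothers)
            have hKN : KN N := Or.inr ⟨hlN, e0, he0c, by rw [hNe0, hcc3N]; push_cast; omega⟩
            refine hI.1 N hN hKN ⟨p, hp', fun e he => ⟨hothers e he, ?_⟩⟩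
            rw [hTp]
            by_cases hex : e = gx
            · rw [hex]; have := node_lt_top_lower hU hN hxa; rw [hTx] at this; exact this
            · rw [hag e hex he]; exact hnodes e he
        · -- `gx` jumps over its top (node `→ α`, top above `α`): a one-apex non-level `K_N`-cell with fewer letters of top `≤ α`
          have hothers : ∀ e, e ≠ p → (N e).2 ≠ (0, 0) := fun e he => by
            by_cases hex : e = gx
            · rw [hex]; exact hox'.1
            · exact hNe e hex he
          have hnl : ¬ LevelCell N := fun hl' => by
            have := hl' gx p; rw [hTp] at this; have := hox'.2.2; rw [hall gx] at this; omega
          refine hdn N hN (Or.inl ⟨by have := chargeCount_ge_three hothers; omega, hnl⟩) p hp' hothers (oneKey_lt_of_lowTops (hU.2 P hP) ?_)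
          exact lowTops_lt_of_escape hallP (e := gx) (by rw [hTp, ← hall gx]; exact hox'.2.2)
      · -- `p` raised: `N p` charged, node `α` kept, top above `α`; no outcome is level (`e0` keeps its top `α`)
        have hpc : (N p).2 ≠ (0, 0) := hrp.1
        have hTp : nodeLevel (P p) < causalTop (N p) := by have := hrp.2.2; rw [htp] at this; exact this
        have hnl : ¬ LevelCell N := fun hl' => by have := hl' e0 p; rw [hTe e0 he0x he0p] at this; omega
        rcases hox with ex | hlx | hox'
        · have hfour : FourCharged N := fun f => by
            by_cases hfp : f = p
            · rw [hfp]; exact hpc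
            by_cases hfx : f = gx
            · rw [hfx, ex]; exact hgxc
            · exact hNe f hfx hfp
          exact h4 N hN (Or.inl ⟨by rw [chargeCount_eq_four hfour]; norm_num, hnl⟩) hfour
        · by_cases hxa : (N gx).2 = (0, 0)
          · -- `gx` lifted to the apex at `α` while `p` rises: a one-apex non-level `K_N`-cell (apex `gx`) with fewer letters of top `≤ α`
            have hothers : ∀ e, e ≠ gx → (N e).2 ≠ (0, 0) := fun e he => by
              by_cases hep : e = p
              · rw [hep]; exact hpc
              · exact hNe e he hep
            refine hdn N hN (Or.inl ⟨by have := chargeCount_ge_three hothers; omega, hnl⟩) gx hxa hothers (oneKey_lt_of_lowTops (hU.2 P hP) ?_)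
            exact lowTops_lt_of_escape hallP (e := p) (by rw [hlx.1, hall gx]; exact hTp)
          · have hfour : FourCharged N := fun f => by
              by_cases hfp : f = p
              · rw [hfp]; exact hpc
              by_cases hfx : f = gx
              · rw [hfx]; exact hxa
              · exact hNe f hfx hfp
            exact h4 N hN (Or.inl ⟨by rw [chargeCount_eq_four hfour]; norm_num, hnl⟩) hfour
        · have hfour : FourCharged N := fun f => by
            by_cases hfp : f = p
            · rw [hfp]; exact hpc
            by_cases hfx : f = gx
            · rw [hfx]; exact hox'.1
            · exact hNe f hfx hfp
          exact h4 N hN (Or.inl ⟨by rw [chargeCount_eq_four hfour]; norm_num, hnl⟩) hfour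
    · -- RULE PB: the minimal charged causal top is `< α`
      have hgmt : causalTop (P gm) < nodeLevel (P p) := lt_of_le_of_ne (htops gm hgmp) hPT
      have hallP : ∀ e, causalTop (P e) ≤ causalTop (P p) := fun e => by
        by_cases hep : e = p
        · rw [hep]
        · rw [htp]; exact htops e hep
      by_cases hPB2 : ∀ e, e ≠ p → e ≠ gm → causalTop (P e) = nodeLevel (P p)
      · -- RULE PB2: the two other charged tops are exactly `α`; clause (node `y`, top `p`) at one of them
        obtain ⟨y, hyp, hygm⟩ := exists_third p gm
        obtain ⟨z, hzp, hzgm, hzy⟩ := exists_fourth p gm y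
        have hyc := hch y hyp
        have hyt : causalTop (P y) = nodeLevel (P p) := hPB2 y hyp hygm
        have hzt : causalTop (P z) = nodeLevel (P p) := hPB2 z hzp hzgm
        have hne : nodeLevel (P y) ≠ causalTop (P p) := by rw [htp]; exact ne_of_lt (hnodes y hyp)
        obtain ⟨N, hN, hag, hoy, hop, hmv⟩ := edge_nt_outcomes_P hh hU hP hD hyp hyc hne
        have hNgm : N gm = P gm := hag gm (Ne.symm hygm) hgmp
        have hNz : N z = P z := hag z hzy hzp
        have hgmc' : (N gm).2 ≠ (0, 0) := by rw [hNgm]; exact hch gm hgmp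
        have hzc' : (N z).2 ≠ (0, 0) := by rw [hNz]; exact hch z hzp
        -- no outcome is level: `gm` keeps its top `< α`, `z` its top `α`
        have hnl : ¬ LevelCell N := fun hl => by have := hl gm z; rw [hNgm, hNz, hzt] at this; omega
        have hNe : ∀ e, e ≠ y → e ≠ p → (N e).2 ≠ (0, 0) := fun e h1 h2 => by rw [hag e h1 h2]; exact hch e h2
        rcases hop with ep | hrp
        · have hp' : (N p).2 = (0, 0) := by rw [ep]; exact hp
          have hTp : causalTop (N p) = nodeLevel (P p) := by rw [ep]; exact htp
          rcases hoy with ey | hly | hoy'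
          · exact hmv.elim (fun hne' => hne' ey) (fun hne' => hne' ep)
          · by_cases hya : (N y).2 = (0, 0)
            · -- `y` lifted to the apex at `α`: a non-level TWIN-APEX `K_N`-cell
              have hcc2 : chargeCount N = 2 :=
                le_antisymm (chargeCount_le_two_of_apex2 (Ne.symm hyp) hp' hya) (two_le_chargeCount_of_charged2 (Ne.symm hzgm) hgmc' hzc')
              have hKN : KN N := Or.inl ⟨hcc2.ge, hnl⟩
              exact hT.1 N hN hKN ⟨p, y, Ne.symm hyp, hp', hya, by rw [hTp, hly.1, hyt], fun e hep hey => hNe e hey hep⟩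
            · -- `y` lifted, still charged: a one-apex non-level `K_N`-cell whose charged nodes lie below `α`: interface
              have hothers : ∀ e, e ≠ p → (N e).2 ≠ (0, 0) := fun e he => by
                by_cases hey : e = y
                · rw [hey]; exact hya
                · exact hNe e hey he
              have hKN : KN N := Or.inl ⟨by have := chargeCount_ge_three hothers; omega, hnl⟩
              refine hI.1 N hN hKN ⟨p, hp', fun e he => ⟨hothers e he, ?_⟩⟩
              rw [hTp]
              by_cases hey : e = y
              · rw [hey]; have := node_lt_top_lower hU hN hya; rw [hly.1, hyt] at this; exact this
              · rw [hag e hey he]; exact hnodes e he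
          · -- `y` jumps over its top: a one-apex non-level `K_N`-cell (apex `p`) with fewer letters of top `≤ α`
            have hothers : ∀ e, e ≠ p → (N e).2 ≠ (0, 0) := fun e he => by
              by_cases hey : e = y
              · rw [hey]; exact hoy'.1
              · exact hNe e hey he
            have hKN : KN N := Or.inl ⟨by have := chargeCount_ge_three hothers; omega, hnl⟩
            refine hdn N hN hKN p hp' hothers (oneKey_lt_of_lowTops (hU.2 P hP) ?_)
            exact lowTops_lt_of_escape hallP (e := y) (by rw [hTp, ← hyt]; exact hoy'.2.2)
        · -- `p` raised: `N p` charged, node `α`, top above `α`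
          have hpc : (N p).2 ≠ (0, 0) := hrp.1
          rcases hoy with ey | hly | hoy'
          · have hfour : FourCharged N := fun f => by
              by_cases hfp : f = p
              · rw [hfp]; exact hpc
              by_cases hfy : f = y
              · rw [hfy, ey]; exact hyc
              · exact hNe f hfy hfp
            exact h4 N hN (Or.inl ⟨by rw [chargeCount_eq_four hfour]; norm_num, hnl⟩) hfour
          · by_cases hya : (N y).2 = (0, 0)
            · -- `y` lifted to the apex at `α` while `p` rises: a one-apex non-level `K_N`-cell (apex `y`) with fewer letters of top `≤ α`
              have hothers : ∀ e, e ≠ y → (N e).2 ≠ (0, 0) := fun e he => by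
                by_cases hep : e = p
                · rw [hep]; exact hpc
                · exact hNe e he hep
              have hKN : KN N := Or.inl ⟨by have := chargeCount_ge_three hothers; omega, hnl⟩
              refine hdn N hN hKN y hya hothers (oneKey_lt_of_lowTops (hU.2 P hP) ?_)
              exact lowTops_lt_of_escape hallP (e := p) (by rw [hly.1, hyt, ← htp]; exact hrp.2.2)
            · have hfour : FourCharged N := fun f => by
                by_cases hfp : f = p
                · rw [hfp]; exact hpc
                by_cases hfy : f = y
                · rw [hfy]; exact hya
                · exact hNe f hfy hfp
              exact h4 N hN (Or.inl ⟨by rw [chargeCount_eq_four hfour]; norm_num, hnl⟩) hfour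
          · have hfour : FourCharged N := fun f => by
              by_cases hfp : f = p
              · rw [hfp]; exact hpc
              by_cases hfy : f = y
              · rw [hfy]; exact hoy'.1
              · exact hNe f hfy hfp
            exact h4 N hN (Or.inl ⟨by rw [chargeCount_eq_four hfour]; norm_num, hnl⟩) hfour
      · -- RULE PB1: a third letter `e1 ∉ {p, gm}` has causal top `< α`; clause (top `p`, top `gm`)
        push Not at hPB2
        obtain ⟨e1, he1p, he1g, he1t⟩ := hPB2
        have he1lt : causalTop (P e1) < nodeLevel (P p) := lt_of_le_of_ne (htops e1 he1p) he1t
        have hne : causalTop (P p) ≠ causalTop (P gm) := by rw [htp]; exact (ne_of_lt hgmt).symm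
        obtain ⟨N, hN, hag, hop, hog, hmv⟩ := edge_tt_outcomes_P hh hU hP hD (Ne.symm hgmp) hne
        have hNe1 : N e1 = P e1 := hag e1 he1p he1g
        have hgmc : (N gm).2 ≠ (0, 0) := by
          rcases hog with e | hr
          · rw [e]; exact hch gm hgmp
          · exact hr.1
        have hothers : ∀ e, e ≠ p → (N e).2 ≠ (0, 0) := fun e he => by
          by_cases heg : e = gm
          · rw [heg]; exact hgmc
          · rw [hag e he heg]; exact hch e he
        have hngm : nodeLevel (N gm) = nodeLevel (P gm) := by
          rcases hog with e | hr
          · rw [e]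
          · exact hr.2.1
        -- no outcome is level: `e1` keeps its top `< α ≤` the top of `N p`
        have hTp_ge : nodeLevel (P p) ≤ causalTop (N p) := by
          rcases hop with e | hr
          · rw [e, htp]
          · have := hr.2.2; rw [htp] at this; exact le_of_lt this
        have hnl : ¬ LevelCell N := fun hl' => by have := hl' e1 p; rw [hNe1] at this; omega
        rcases hop with ep | hrp
        · rcases hog with eg | hrg
          · exact hmv.elim (fun hne' => hne' ep) (fun hne' => hne' eg)
          · -- only `gm` raised: a one-apex non-level cell whose charged nodes lie below `α`: interface
            have hp' : (N p).2 = (0, 0) := by rw [ep]; exact hp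
            have hTp : causalTop (N p) = nodeLevel (P p) := by rw [ep]; exact htp
            have hnN : ∀ e, e ≠ p → nodeLevel (N e) = nodeLevel (P e) := fun e he => by
              by_cases heg : e = gm
              · rw [heg]; exact hngm
              · rw [hag e he heg]
            have hKN : KN N := Or.inl ⟨by have := chargeCount_ge_three hothers; omega, hnl⟩
            refine hI.1 N hN hKN ⟨p, hp', fun e he => ⟨hothers e he, ?_⟩⟩
            rw [hTp, hnN e he]; exact hnodes e he
        · -- `p` raised: four-charged and not level
          have hfour : FourCharged N := fun f => by
            by_cases hfp : f = p
            · rw [hfp]; exact hrp.1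
            · exact hothers f hfp
          exact h4 N hN (Or.inl ⟨by rw [chargeCount_eq_four hfour]; norm_num, hnl⟩) hfour

/-- the one-apex KEY-STEP, both phases: given the three families and the one-apex `K`-cells of larger key, the one-apex `K`-cells of key `k` are absent
(the four-charged `K`-cells are absent outright by `fourChargedK_absent_of_interface`). -/
theorem oneApexStep {h : ℤ} (hh : h % 2 = 0) {C : MConfig} (hU : C.InDiamond h) (hD : RuleDMu4Closed C) (hI : InterfaceKAbsent C)
    (hT : TwinApexKAbsent C) (hF : F1Absent C) (k : ℤ) (hIH : OneApexKeyAbove h C k) :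
    (∀ Z ∈ C.lower, KN Z → ∀ f, (Z f).2 = (0, 0) → (∀ g, g ≠ f → (Z g).2 ≠ (0, 0)) → oneKey h Z f = k → False) ∧
      (∀ P ∈ C.upper, KP P → ∀ f, (P f).2 = (0, 0) → (∀ g, g ≠ f → (P g).2 ≠ (0, 0)) → oneKey h P f = k → False) := by
  have h4 := fourChargedK_absent_of_interface hh hU hD hI
  refine ⟨fun Z hZ hK f hf hch he => ?_, fun P hP hK f hf hch he => ?_⟩
  · exact oneApex_N hU hZ (hD.1 Z hZ) hK hf hch hI hF h4.2 fun P hP hKP f' hf' hch' hlt => hIH.2 P hP hKP f' hf' hch' (by rw [he] at hlt; exact hlt)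
  · exact oneApex_P hh hU hP (hD.2 P hP) hK hf hch hI hT h4.1 fun N hN hKN f' hf' hch' hlt => hIH.1 N hN hKN f' hf' hch' (by rw [he] at hlt; exact hlt)

/-- **THE ONE-APEX `K`-STRATUM REDUCES TO THREE EXPLICIT FAMILIES** (KERNEL, every even `h`, law-free): in a RULE-D-closed `◇_h` configuration with no
interface `K`-cell, no twin-apex `K`-cell and no node-flat one-apex `K_N`-cell there is no one-apex `K`-cell at all (downward induction on the key
`oneKey ≤ (8h+1)·3 + 8h` through `oneApexStep`). -/
theorem oneApexK_absent_of_core {h : ℤ} (hh : h % 2 = 0) {C : MConfig} (hU : C.InDiamond h) (hD : RuleDMu4Closed C) (hI : InterfaceKAbsent C)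
    (hT : TwinApexKAbsent C) (hF : F1Absent C) : OneApexKAbsent C := by
  have hbN : ∀ Z ∈ C.lower, ∀ f, oneKey h Z f ≤ (8 * h + 1) * 3 + 8 * h := fun Z hZ f => oneKey_le (hU.1 Z hZ) f
  have hbP : ∀ P ∈ C.upper, ∀ f, oneKey h P f ≤ (8 * h + 1) * 3 + 8 * h := fun P hP f => oneKey_le (hU.2 P hP) f
  have h0N : ∀ Z ∈ C.lower, ∀ f, 0 ≤ oneKey h Z f := fun Z hZ f => oneKey_nonneg (hU.1 Z hZ) f
  have h0P : ∀ P ∈ C.upper, ∀ f, 0 ≤ oneKey h P f := fun P hP f => oneKey_nonneg (hU.2 P hP) f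
  generalize (8 * h + 1) * 3 + 8 * h = B at hbN hbP
  have key : ∀ n : ℕ, (∀ Z ∈ C.lower, KN Z → ∀ f, (Z f).2 = (0, 0) → (∀ g, g ≠ f → (Z g).2 ≠ (0, 0)) → B - n ≤ oneKey h Z f → False) ∧
      (∀ P ∈ C.upper, KP P → ∀ f, (P f).2 = (0, 0) → (∀ g, g ≠ f → (P g).2 ≠ (0, 0)) → B - n ≤ oneKey h P f → False) := by
    intro n
    induction n with
    | zero =>
      have hab : OneApexKeyAbove h C B :=
        ⟨fun Z hZ _ f _ _ hlt => absurd (hbN Z hZ f) (not_le.2 hlt), fun P hP _ f _ _ hlt => absurd (hbP P hP f) (not_le.2 hlt)⟩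
      obtain ⟨hN, hP⟩ := oneApexStep hh hU hD hI hT hF B hab
      refine ⟨fun Z hZ hK f hf hch hle => hN Z hZ hK f hf hch ?_, fun P hP' hK f hf hch hle => hP P hP' hK f hf hch ?_⟩
      · have := hbN Z hZ f; push_cast at hle; omega
      · have := hbP P hP' f; push_cast at hle; omega
    | succ n ih =>
      have hab : OneApexKeyAbove h C (B - (n + 1)) :=
        ⟨fun Z hZ hK f hf hch hlt => ih.1 Z hZ hK f hf hch (by omega), fun P hP hK f hf hch hlt => ih.2 P hP hK f hf hch (by omega)⟩
      obtain ⟨hN, hP⟩ := oneApexStep hh hU hD hI hT hF (B - (n + 1)) hab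
      refine ⟨fun Z hZ hK f hf hch hle => ?_, fun P hP' hK f hf hch hle => ?_⟩
      · by_cases he : oneKey h Z f = B - (n + 1)
        · exact hN Z hZ hK f hf hch he
        · exact ih.1 Z hZ hK f hf hch (by push_cast at hle; omega)
      · by_cases he : oneKey h P f = B - (n + 1)
        · exact hP P hP' hK f hf hch he
        · exact ih.2 P hP' hK f hf hch (by push_cast at hle; omega)
  refine ⟨fun Z hZ hK ⟨f, hf, hch⟩ => (key B.toNat).1 Z hZ hK f hf hch ?_, fun P hP hK ⟨f, hf, hch⟩ => (key B.toNat).2 P hP hK f hf hch ?_⟩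
  · have := h0N Z hZ f; have := Int.self_le_toNat B; omega
  · have := h0P P hP f; have := Int.self_le_toNat B; omega

/-- **THE `K`-PEEL IS THREE EXPLICIT FAMILIES** (KERNEL, every even `h`, law-free): for a RULE-D-closed `◇_h` configuration, «no `K`-cell» is
EQUIVALENT to «no interface `K`-cell (A₃ᴵ), no twin-apex `K`-cell, no node-flat one-apex `K_N`-cell (F1)» — by `kAbsent_iff_oneApex_twinApex` and
`oneApexK_absent_of_core`.  None of the three is proved here. -/
theorem kAbsent_iff_core {h : ℤ} (hh : h % 2 = 0) {C : MConfig} (hU : C.InDiamond h) (hD : RuleDMu4Closed C) :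
    KAbsent C ↔ InterfaceKAbsent C ∧ TwinApexKAbsent C ∧ F1Absent C := by
  refine ⟨fun hK => ⟨⟨fun Z hZ hKZ _ => hK.1 Z hZ hKZ, fun P hP hKP _ => hK.2 P hP hKP⟩,
    ⟨fun Z hZ hKZ _ => hK.1 Z hZ hKZ, fun P hP hKP _ => hK.2 P hP hKP⟩, fun Z hZ hKZ _ => hK.1 Z hZ hKZ⟩,
    fun ⟨hI, hT, hF⟩ => (kAbsent_iff_oneApex_twinApex hh hU hD).2 ⟨oneApexK_absent_of_core hh hU hD hI hT hF, hT⟩⟩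

/-- **◇₈: the `K`-peel is the interface, the twin-apex cells and (F1)** (KERNEL) — the hub-local census row «lfp(I ∪ twin ∪ F1) = all of `K`»
(`data/k3_h8.txt`), as the `h = 8` instance of `kAbsent_iff_core`. -/
theorem kAbsent_iff_core_h8 {C : MConfig} (hU : C.InDiamond 8) (hD : RuleDMu4Closed C) :
    KAbsent C ↔ InterfaceKAbsent C ∧ TwinApexKAbsent C ∧ F1Absent C :=
  kAbsent_iff_core (by decide) hU hD

end Summit.HodgeConjecture.HodgeConjecture.Cruxes.BlochSeedDiscOne.PairSpread
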